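import Literature.Computability.Cryptography.WordRAMPrattRepetition
import Literature.Computability.Cryptography.WordRAMTripleScan
import Literature.Computability.Cryptography.WordRAMArithRoutines
import Literature.Computability.Cryptography.WordRAMPrattParse
import Literature.Computability.Cryptography.WordRAMRandPrefix
import Mathlib.Data.ZMod.Basic
import HarnessLib

/-!
# The word RAM — Pratt's balanced-tripartitioning program: repetition loop, parameters, set-up

The program of K. Pratt, STOC 2024, proof of Thm. 1.9, assembled (sixteenth instalment of the proof
of `Literature.Computability.AlgebraicComplexity.pratt2024_thm_1_9`) in coins-first normal form
`SProg.prattProg K = withCoins (prattPre K) 98 99 prattMain` (`WordRAMRandPrefix`), for a record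
`PrattConsts` of everything fixed before the input is seen (block size `k`, the decomposed power
`T_k^{⊗m}` with `R` triads and its signed coefficient literals, `C = binom(3k,k)`, the block-membership
literal, the word-size threshold `cB · M + c0`).

* `SProg.repLoop`, `repLoop_spec` — `Q` repetitions of `repBody` (`WordRAMPrattRepetition`): the
  flag `81` becomes `flagOf (∃ j < Q, repVj j ≠ 0)`;
* plain-memory forms of the arithmetic routines of `WordRAMArithRoutines` (`probeWidth_plain`,
  `powLoop_plain`, `writeConsts_plain`), signed literals `writeInts` (`wordOfInt w v`, the residue of
  `v` modulo `2^w`, `natCast_wordOfInt`), the offset loop `lbLoop` of the output level;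
* `PrattConsts` and the run-time parameters as functions of `n₀` (`q = n₀/(km) + 1`, `r = mq`,
  `n = kr`, `M = 3n`, `Ntot = C^r`, `G = (q+1) B^q`, `Q = 5 · 27^n / (C C₂)^r + 1`, `coins`, `RC`,
  `off`, the pad masks `PM`, the threshold `thr`), the layout `K.lay n₀ L` (`lay_eqs`, `repSide_lay`);
* the programs `paramsA`, `smallPre`, `bigPre1` (`bigB1–7`, `lbLoop`), `bigB8a/b/c`, `bigPre3`
  (tables and the three parses), `prattPre`, `prattMain`, `prattProg`, with their specifications
  `paramsA_spec`, `smallPre_spec`, `bigPre1_spec`, `bigB8a/b/c_spec`, `bigPre3_spec` under the size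
  hypotheses `BigFits` (`BigFits.bounds`), and the packaging `tabs`, `BigOut`, `preBigTime` used by
  the branch theorems of the next file.

## References

* K. Pratt, *A stronger connection between the asymptotic rank conjecture and the set cover
  conjecture*, STOC 2024, arXiv:2311.02774, §2 (proof of Thm. 1.9).
* T. Hagerup, *Sorting and searching on the word RAM*, STACS 1998, §2 (the machine model).
-/

namespace Literature.Computability.Cryptography.WordRAM

open Finset

open scoped BigOperators

/-! ## The repetition loop -/

namespace SProg

open Finset StateTransition Literature.Combinatorics.Enumerative

variable {w : ℕ} {O : List ℕ → List ℕ}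

/-- `orFlag` of a flag word is the flag of the disjunction. [folklore] -/
theorem orFlag_flagOf (P : Prop) (v : ℕ) : orFlag (flagOf P) v = flagOf (P ∨ v ≠ 0) := by
  unfold orFlag
  by_cases hP : P
  · rw [flagOf_pos hP, flagOf_pos (Or.inl hP), if_pos (by omega)]
  · rw [flagOf_neg hP]
    by_cases hv : v = 0
    · subst hv; rw [flagOf_neg (by simp [hP])]; simp
    · rw [flagOf_pos (Or.inr hv), if_pos (Nat.pos_of_ne_zero hv)]; simp

/-- **The repetition loop**: `Q` repetitions (counter `25`), each followed by `25 -= 1`.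
[cite: Pratt2024SCC, §2 (proof of Thm. 1.9)] -/
def repLoop : SProg := whilenz (.dir 25) (seq repBody (block [(.sub, .dir 25, .dir 25, .imm 1)]))

/-- The value of repetition `j` from the coin words `cv` of all repetitions. [cite: Pratt2024SCC, §2 (proof of Thm. 1.9)] -/
def repVj (w : ℕ) (T : RepTables) (Lay : RepLayout) (cv : ℕ → ℕ) (j : ℕ) : ℕ :=
  repV w T Lay (fun t => cv (j * Lay.coins + t)) (fun t => cv (j * Lay.coins + (Lay.M - 1 + t)))

/-- Invariant of the repetition loop after `i` repetitions. [folklore] -/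
structure RInv (m : ℕ → ℕ) (T : RepTables) (Lay : RepLayout) (cp0 Q : ℕ) (cv : ℕ → ℕ)
    (qs : List (List ℕ)) (i : ℕ) (st : Store) : Prop where
  queries : st.queries = qs
  regs : RepRegs st.mem Lay (cp0 + i * Lay.coins) (flagOf (∃ j, j < i ∧ repVj w T Lay cv j ≠ 0))
  r25 : st.mem 25 = Q - i
  frame : ∀ c, 100 ≤ c → ¬ (Lay.pa ≤ c ∧ c < Lay.pt + Lay.r * Lay.C) →
    ¬ (Lay.X 0 ≤ c ∧ c < Lay.X 2 + Lay.dsz) → st.mem c = m c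
  low : ∀ c, c < 40 → c ≠ 25 → st.mem c = m c

set_option linter.unusedSimpArgs false in
/-- **The repetition loop, specified.** From `RepRegs` with flag `0` and coin pointer `cp0`, the
counter `25 = Q`, the layout, the tables and `Q · coins` coin words at `cp0`, `repLoop` ends within
`Q (repTime + 3) + 1` steps with `81 = flagOf (∃ j < Q, repVj j ≠ 0)`; registers below `40` other
than `25` and all read-only data are unchanged. [cite: Pratt2024SCC, §2 (proof of Thm. 1.9)] -/
theorem repLoop_spec {m : ℕ → ℕ} {T : RepTables} {Lay : RepLayout} {cp0 Q : ℕ} {cv : ℕ → ℕ}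
    (hR : RepRegs m Lay cp0 0) (h25 : m 25 = Q) (hS : RepSide w Lay cp0) (hD : RepData w m T Lay)
    (hQE : cp0 + Q * Lay.coins + 1 < 2 ^ w)
    (hcv : ∀ t, t < Q * Lay.coins → m (cp0 + t) = cv t ∧ cv t < 2 ^ w) (qs : List (List ℕ)) :
    ∃ st', ExecLE w O repLoop ⟨m, qs⟩ st' (Q * (repTime Lay + 3) + 1) ∧ st'.queries = qs ∧
      st'.mem 81 = flagOf (∃ j, j < Q ∧ repVj w T Lay cv j ≠ 0) ∧
      (∀ c, 100 ≤ c → ¬ (Lay.pa ≤ c ∧ c < Lay.pt + Lay.r * Lay.C) →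
        ¬ (Lay.X 0 ≤ c ∧ c < Lay.X 2 + Lay.dsz) → st'.mem c = m c) ∧
      (∀ c, c < 40 → c ≠ 25 → st'.mem c = m c) := by
  have c3 := hS.c3; have c4 := hS.c4; have c7 := hS.c7; have c10 := hS.c10; have c13 := hS.c13
  have c5 := hS.c5; have c6 := hS.c6; have c8 := hS.c8; have c9 := hS.c9; have hpa := hS.hpa
  have c1 := hS.c1; have c2 := hS.c2; have c11 := hS.c11; have c12 := hS.c12
  have h0 : RInv (w := w) m T Lay cp0 Q cv qs 0 ⟨m, qs⟩ := by
    refine ⟨rfl, ?_, by simpa using h25, fun c _ _ _ => rfl, fun c _ _ => rfl⟩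
    have hf : flagOf (∃ j, j < 0 ∧ repVj w T Lay cv j ≠ 0) = 0 :=
      flagOf_neg (by rintro ⟨j, hj, _⟩; exact Nat.not_lt_zero _ hj)
    rw [hf, zero_mul, add_zero]; exact hR
  have hbody : ∀ i, i < Q → ∀ st, RInv (w := w) m T Lay cp0 Q cv qs i st →
      (Operand.dir 25).read st.mem ≠ 0 ∧ ∃ st', ExecLE w O (seq repBody (block [(.sub, .dir 25, .dir 25, .imm 1)]))
        st st' (repTime Lay + 1) ∧ RInv (w := w) m T Lay cp0 Q cv qs (i + 1) st' := by
    intro i hi st hst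
    obtain ⟨hq, hregs, h25i, hfr, hlow⟩ := hst
    obtain ⟨mm, qq⟩ := st
    simp only at hq hregs h25i hfr hlow
    subst qq
    refine ⟨by simp only [Operand.read_dir]; rw [h25i]; omega, ?_⟩
    have hic : i * Lay.coins + Lay.coins ≤ Q * Lay.coins := by
      have := Nat.mul_le_mul_right Lay.coins hi; rw [Nat.succ_mul] at this; exact this
    have hD' : RepData w mm T Lay := by
      obtain ⟨hBM, hBM1, hFt, hFt1, hUc, hUcw⟩ := hD
      refine ⟨fun j i' hj hi' => ?_, hBM1, fun l a hl ha => ?_, hFt1, fun l i' d hl hi' hd => ?_, hUcw⟩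
      · have : j * Lay.tk + Lay.tk ≤ Lay.C * Lay.tk := by
          have := Nat.mul_le_mul_right Lay.tk hj; rw [Nat.succ_mul] at this; exact this
        rw [hfr _ (by omega) (by omega) (by omega)]; exact hBM j i' hj hi'
      · have h1 : Lay.FT 0 ≤ Lay.FT l ∧ Lay.FT l + Lay.MB ≤ Lay.rU 0 := by
          interval_cases l <;> constructor <;> omega
        rw [hfr _ (by omega) (by omega) (by omega)]; exact hFt l a hl ha
      · have h1 : Lay.rU 0 ≤ Lay.rU l ∧ Lay.rU l + Lay.R * Lay.N ≤ Lay.X 0 := by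
          interval_cases l <;> constructor <;> omega
        have : i' * Lay.N + Lay.N ≤ Lay.R * Lay.N := by
          have := Nat.mul_le_mul_right Lay.N hi'; rw [Nat.succ_mul] at this; exact this
        rw [hfr _ (by omega) (by omega) (by omega)]; exact hUc l i' d hl hi' hd
    obtain ⟨st₁, hex₁, hq₁, f81, f80, kL, kD⟩ := repBody_spec (w := w) (O := O) hregs hS hD'
      (Nat.le_add_right _ _) (by omega)
      (fun t ht => by
        rw [hfr _ (by omega) (by omega) (by omega), Nat.add_assoc]; exact hcv _ (by omega)) qs
    obtain ⟨m₁, qq₁⟩ := st₁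
    simp only at hq₁ f81 f80 kL kD
    subst qq₁
    have g25 : m₁ 25 = Q - i := by rw [kL 25 (by omega)]; exact h25i
    obtain ⟨st₂, hex₂, hP₂⟩ : ∃ st', Exec w O (block [(.sub, .dir 25, .dir 25, .imm 1)]) ⟨m₁, qs⟩ st' 1 ∧
        (st'.queries = qs ∧ st'.mem 25 = Q - (i + 1) ∧ ∀ c, c ≠ 25 → st'.mem c = m₁ c) := by
      refine Exec.block_of_fwd _ qs fun Rf hRf => ?_
      have hQw : Q - i < 2 ^ w := by
        have := hS.hM; unfold RepLayout.coins at hQE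
        have : Q ≤ Q * (Lay.M - 1 + 3 * Lay.Ntot) :=
          Nat.le_mul_of_pos_right _ (by have := Nat.pow_pos (n := Lay.q) hS.hN; unfold RepLayout.Ntot; omega)
        omega
      have htmp := execOps_cons_fwd hRf; clear hRf; obtain ⟨v1, hv1, hRf⟩ := htmp
      simp -failIfUnchanged (disch := omega) only [Operand.write, Operand.read,
        Function.update_self, Function.update_of_ne, BinOp.eval_sub_of_le, Nat.add_zero, g25] at hv1 hRf
      subst v1
      simp only [execOps_nil] at hRf
      subst hRf
      refine ⟨rfl, ?_, fun c hc => ?_⟩ <;> dsimp only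
      · simp (disch := omega) only [Function.update_of_ne, Function.update_self]; omega
      · simp (disch := omega) only [Function.update_of_ne, Function.update_self]
    obtain ⟨hq₂, e25, k₂⟩ := hP₂
    obtain ⟨m₂, qq₂⟩ := st₂
    simp only at hq₂ e25 k₂
    subst qq₂
    refine ⟨⟨m₂, qs⟩, hex₁.seq hex₂.execLE, rfl, ?_, e25, fun c hc hna hnx => ?_, fun c hc hc25 => ?_⟩
    · obtain ⟨r5, r6, r7, r8, r9, r10, r12, r13, r14, r15, r16, r17, r18, r19, r20, r21, r23, r30, r31,
        r32, r33, r34, r35, r36, r37, r38, r39, r48, r52, r53, _, _, _⟩ := hregs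
      refine ⟨?_, ?_, ?_, ?_, ?_, ?_, ?_, ?_, ?_, ?_, ?_, ?_, ?_, ?_, ?_, ?_, ?_, ?_, ?_, ?_, ?_, ?_, ?_,
        ?_, ?_, ?_, ?_, ?_, ?_, ?_, ?_, ?_, flagOf_le_one _⟩ <;> dsimp only
      all_goals first
        | (rw [k₂ _ (by omega), kL _ (by omega)]; assumption)
        | skip
      · rw [k₂ 80 (by omega), f80]; ring
      · rw [k₂ 81 (by omega), f81, orFlag_flagOf]
        congr 1
        refine propext ⟨?_, ?_⟩
        · rintro (⟨j, hj, hne⟩ | hne)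
          · exact ⟨j, by omega, hne⟩
          · exact ⟨i, by omega, hne⟩
        · rintro ⟨j, hj, hne⟩
          rcases Nat.lt_succ_iff_lt_or_eq.1 hj with hj | rfl
          · exact Or.inl ⟨j, hj, hne⟩
          · exact Or.inr hne
    · show m₂ c = m c
      rw [k₂ c (by omega), kD c hc hna hnx]; exact hfr c hc hna hnx
    · show m₂ c = m c
      rw [k₂ c hc25, kL c (by omega)]; exact hlow c hc hc25
  obtain ⟨st', hex, hI⟩ := ExecLE.whilenz_invariant (w := w) (O := O) (x := .dir 25)
    (s := seq repBody (block [(.sub, .dir 25, .dir 25, .imm 1)])) Q (repTime Lay + 1)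
    (fun i st => RInv (w := w) m T Lay cp0 Q cv qs i st) hbody
    (fun st hst => by rw [Operand.read_dir, hst.r25]; omega) h0
  refine ⟨st', ?_, hI.queries, hI.regs.r81, hI.frame, hI.low⟩
  unfold repLoop
  rw [show repTime Lay + 1 + 2 = repTime Lay + 3 by omega] at hex
  exact hex

end SProg

/-! ## Plain-memory forms of the arithmetic routines of `WordRAMArithRoutines` -/

namespace SProg

open Finset StateTransition

variable {w : ℕ} {O : List ℕ → List ℕ}

/-- A merged memory whose register part is an update of the data part below `100`. [folklore] -/
theorem merge_update_of_lt {m m' : ℕ → ℕ} {X v : ℕ} (hX : X < 100) (S : ℕ → ℕ) (hS : merge S m = m') :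
    merge (Function.update S X v) m = Function.update m' X v := by
  subst hS
  funext a
  unfold merge
  by_cases ha : a < 100
  · rw [if_pos ha]
    by_cases haX : a = X
    · subst haX; simp
    · rw [Function.update_of_ne haX, Function.update_of_ne haX, if_pos ha]
  · rw [if_neg ha, Function.update_of_ne (by omega), if_neg ha]

/-- **`probeWidth`, plain form**: `W := w`, `X := 0`, `4w + 3` steps. [folklore] -/
theorem probeWidth_plain {m : ℕ → ℕ} {X W : ℕ} (hX : X < 100) (hW : W < 100) (hXW : X ≠ W)
    (hw : 1 ≤ w) (qs : List (List ℕ)) :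
    Exec w O (probeWidth X W) ⟨m, qs⟩ ⟨Function.update (Function.update m X 0) W w, qs⟩ (4 * w + 3) := by
  have h := probeWidth_exec (O := O) hX hW hXW m m hw qs
  rw [merge_self] at h
  refine h.of_eq ?_
  have key : merge (probeR m X W w w) m = Function.update (Function.update m X 0) W w := by
    unfold probeR
    rw [merge_update_of_lt hW _ (merge_update_of_lt hX _ (merge_self m)), Nat.mod_self]
  rw [key]

/-- **`powLoop`, plain form**: `Y := X ^ E`, `E := 0`, `4E + 2` steps. [folklore] -/
theorem powLoop_plain {m : ℕ → ℕ} {X E Y x e : ℕ} (hX : X < 100) (hE : E < 100) (hY : Y < 100)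
    (hXY : X ≠ Y) (hEY : E ≠ Y) (hXE : X ≠ E) (hx : m X = x) (he : m E = e) (hw : 1 ≤ w)
    (hpow : x ^ e < 2 ^ w) (hew : e < 2 ^ w) (qs : List (List ℕ)) :
    Exec w O (powLoop X E Y) ⟨m, qs⟩ ⟨Function.update (Function.update m Y (x ^ e)) E 0, qs⟩ (4 * e + 2) := by
  have h := powLoop_exec (O := O) hX hE hY hXY hEY hXE (R := m) (H := m) hx he hw hpow hew qs
  rw [merge_self] at h
  refine h.of_eq ?_
  have key : merge (powR m E Y x e e) m = Function.update (Function.update m Y (x ^ e)) E 0 := by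
    unfold powR
    rw [merge_update_of_lt hE _ (merge_update_of_lt hY _ (merge_self m)), Nat.sub_self]
  rw [key]

/-- The memory after `writeConsts P vs` from pointer value `p`. [folklore] -/
def wcMem (m : ℕ → ℕ) (P p : ℕ) (vs : List ℕ) : ℕ → ℕ := fun a =>
  if a = P then p + vs.length else if p ≤ a ∧ a < p + vs.length then vs.getD (a - p) 0 else m a

/-- **`writeConsts`, plain form.** [folklore] -/
theorem writeConsts_plain {m : ℕ → ℕ} {P p : ℕ} (hP : P < 100) (vs : List ℕ) (hp : m P = p)
    (hp100 : 100 ≤ p) (hpE : p + vs.length < 2 ^ w) (hv : ∀ v ∈ vs, v < 2 ^ w) (qs : List (List ℕ)) :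
    Exec w O (writeConsts P vs) ⟨m, qs⟩ ⟨wcMem m P p vs, qs⟩ (2 * vs.length) := by
  have h := writeConsts_exec (O := O) hP vs (R := m) (H := m) hp hp100 hpE hv qs
  rw [merge_self] at h
  refine h.of_eq ?_
  suffices key : merge (Function.update m P (p + vs.length)) (tableH m p vs) = wcMem m P p vs by rw [key]
  funext a
  unfold merge wcMem tableH
  by_cases ha : a < 100
  · rw [if_pos ha]
    by_cases haP : a = P
    · subst haP; simp
    · rw [Function.update_of_ne haP, if_neg haP, if_neg (by omega)]
  · rw [if_neg ha, if_neg (show a ≠ P by omega)]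

/-! ## Signed constants -/

/-- The word of an integer: its residue modulo `2^w`. [folklore] -/
def wordOfInt (w : ℕ) (v : ℤ) : ℕ := (v % (2 ^ w : ℕ)).toNat

/-- The word of a small natural number is itself. [folklore] -/
theorem wordOfInt_natCast {w u : ℕ} (hu : u < 2 ^ w) : wordOfInt w u = u := by
  unfold wordOfInt
  rw [← Int.natCast_mod, Int.toNat_natCast, Nat.mod_eq_of_lt hu]

/-- The word of a small negative number is its two's complement. [folklore] -/
theorem wordOfInt_neg {w u : ℕ} (hu0 : 0 < u) (hu : u < 2 ^ w) : wordOfInt w (-(u : ℤ)) = 2 ^ w - u := by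
  unfold wordOfInt
  have h2 : (0 : ℤ) < (2 ^ w : ℕ) := by exact_mod_cast Nat.two_pow_pos w
  have : (-(u : ℤ)) % ((2 ^ w : ℕ) : ℤ) = ((2 ^ w - u : ℕ) : ℤ) := by
    rw [Nat.cast_sub hu.le]
    have hlt : ((2 ^ w : ℕ) : ℤ) - u < (2 ^ w : ℕ) := by omega
    have hnn : 0 ≤ ((2 ^ w : ℕ) : ℤ) - u := by omega
    rw [show (-(u : ℤ)) = ((2 ^ w : ℕ) : ℤ) - u + ((2 ^ w : ℕ) : ℤ) * (-1) by ring,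
      Int.add_mul_emod_self_left, Int.emod_eq_of_lt hnn hlt]
  rw [this, Int.toNat_natCast]

/-- Words are words. [folklore] -/
theorem wordOfInt_lt (w : ℕ) (v : ℤ) : wordOfInt w v < 2 ^ w := by
  unfold wordOfInt
  have h2 : (0 : ℤ) < (2 ^ w : ℕ) := by exact_mod_cast Nat.two_pow_pos w
  have := Int.emod_lt_of_pos v h2
  have h0 := Int.emod_nonneg v h2.ne'
  omega

/-- The word of an integer casts to the integer in `ZMod (2^w)`. [folklore] -/
theorem natCast_wordOfInt (w : ℕ) (v : ℤ) : ((wordOfInt w v : ℕ) : ZMod (2 ^ w)) = (v : ZMod (2 ^ w)) := by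
  unfold wordOfInt
  have h2 : (0 : ℤ) < (2 ^ w : ℕ) := by exact_mod_cast Nat.two_pow_pos w
  have h0 := Int.emod_nonneg v h2.ne'
  have : ((wordOfInt w v : ℕ) : ZMod (2 ^ w)) = (((v % (2 ^ w : ℕ)).toNat : ℤ) : ZMod (2 ^ w)) := by
    unfold wordOfInt; push_cast; rfl
  rw [wordOfInt] at this
  rw [this, Int.toNat_of_nonneg h0, ZMod.intCast_mod]

/-- Write the signed literals `vs` as words at the pointer register `P` (advancing it): a
non-negative literal by `mem[P] := v + 0`, a negative one by `mem[P] := 0 - |v|` (subtraction is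
modulo `2^w`). [folklore] -/
def writeInts (P : ℕ) : List ℤ → SProg
  | [] => skip
  | v :: vs => seq (seq (if 0 ≤ v then op .add (.ind P) (.imm v.toNat) (.imm 0)
        else op .sub (.ind P) (.imm 0) (.imm v.natAbs)) (op .add (.dir P) (.dir P) (.imm 1)))
      (writeInts P vs)

/-- `writeInts` makes no oracle query. [folklore] -/
theorem writeInts_queryFree (P : ℕ) : ∀ vs : List ℤ, (writeInts P vs).QueryFree
  | [] => trivial
  | v :: vs => by
    unfold writeInts
    refine ⟨⟨?_, trivial⟩, writeInts_queryFree P vs⟩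
    split_ifs <;> trivial

/-- The memory after `writeInts P vs` from pointer value `p`. [folklore] -/
def wiMem (w : ℕ) (m : ℕ → ℕ) (P p : ℕ) (vs : List ℤ) : ℕ → ℕ := fun a =>
  if a = P then p + vs.length
  else if p ≤ a ∧ a < p + vs.length then wordOfInt w (vs.getD (a - p) 0) else m a

/-- **`writeInts`, specified**: `2 |vs|` steps, the words `wordOfInt w vs[i]` at `p + i`, the pointer
advanced, nothing else changed. [folklore] -/
theorem writeInts_spec {P : ℕ} (hP : P < 100) (hw : 1 ≤ w) :
    ∀ (vs : List ℤ) {m : ℕ → ℕ} {p : ℕ}, m P = p → 100 ≤ p → p + vs.length < 2 ^ w →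
      (∀ v ∈ vs, v.natAbs < 2 ^ w) → ∀ qs : List (List ℕ),
      Exec w O (writeInts P vs) ⟨m, qs⟩ ⟨wiMem w m P p vs, qs⟩ (2 * vs.length)
  | [], m, p, hRp, hp, hpw, hv, qs => by
    have hS : wiMem w m P p [] = m := by
      funext a; unfold wiMem
      by_cases haP : a = P
      · subst haP; simp [hRp]
      · rw [if_neg haP, if_neg (by simp)]
    rw [show 2 * ([] : List ℤ).length = 0 by rfl]
    exact (Exec.skip (w := w) (O := O) ⟨m, qs⟩).of_eq (by rw [hS])
  | v :: vs, m, p, hRp, hp, hpw, hv, qs => by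
    have hvw : v.natAbs < 2 ^ w := hv v (by simp)
    have hlen : (v :: vs).length = vs.length + 1 := rfl
    -- the literal
    have h1 : Exec w O (if 0 ≤ v then op .add (.ind P) (.imm v.toNat) (.imm 0)
        else op .sub (.ind P) (.imm 0) (.imm v.natAbs)) ⟨m, qs⟩
        ⟨Function.update m p (wordOfInt w v), qs⟩ 1 := by
      split_ifs with hv0
      · refine (Exec.op (w := w) (O := O) .add (.ind P) (.imm v.toNat) (.imm 0) ⟨m, qs⟩).of_eq ?_
        show (⟨Operand.write m (BinOp.add.eval w v.toNat 0) (.ind P), qs⟩ : Store) = _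
        congr 1
        simp only [Operand.write, hRp]
        congr 1
        have htn : ((v.toNat : ℕ) : ℤ) = v := Int.toNat_of_nonneg hv0
        have hlt : v.toNat < 2 ^ w := by
          have : ((v.toNat : ℕ) : ℤ) = v.natAbs := by rw [htn]; exact (Int.natAbs_of_nonneg hv0).symm
          omega
        have key : wordOfInt w v = v.toNat := by
          have := wordOfInt_natCast (w := w) hlt; rwa [htn] at this
        rw [BinOp.eval_add_mod', Nat.add_zero, Nat.mod_eq_of_lt hlt, key]
      · have hneg : v < 0 := lt_of_not_ge hv0
        refine (Exec.op (w := w) (O := O) .sub (.ind P) (.imm 0) (.imm v.natAbs) ⟨m, qs⟩).of_eq ?_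
        show (⟨Operand.write m (BinOp.sub.eval w 0 v.natAbs) (.ind P), qs⟩ : Store) = _
        congr 1
        simp only [Operand.write, hRp]
        congr 1
        have hva : -(v.natAbs : ℤ) = v := by omega
        have hpos : 0 < v.natAbs := by omega
        have key : wordOfInt w v = 2 ^ w - v.natAbs := by
          have := wordOfInt_neg (w := w) hpos hvw; rwa [hva] at this
        rw [key]
        show (0 + 2 ^ w - v.natAbs % 2 ^ w) % 2 ^ w = 2 ^ w - v.natAbs
        rw [Nat.mod_eq_of_lt hvw, Nat.zero_add, Nat.mod_eq_of_lt (by omega)]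
    -- the pointer
    have h2 : Exec w O (op .add (.dir P) (.dir P) (.imm 1)) ⟨Function.update m p (wordOfInt w v), qs⟩
        ⟨Function.update (Function.update m p (wordOfInt w v)) P (p + 1), qs⟩ 1 := by
      refine (Exec.op (w := w) (O := O) .add (.dir P) (.dir P) (.imm 1) _).of_eq ?_
      show (⟨Operand.write _ (BinOp.add.eval w _ 1) (.dir P), qs⟩ : Store) = _
      congr 1
      simp only [Operand.write, Operand.read, Function.update_of_ne (show P ≠ p by omega), hRp]
      rw [BinOp.eval_add_mod', Nat.mod_eq_of_lt (by omega)]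
    -- the rest
    have h3 := writeInts_spec hP hw vs (m := Function.update (Function.update m p (wordOfInt w v)) P (p + 1))
      (p := p + 1) (by simp) (by omega) (by rw [hlen] at hpw; omega)
      (fun u hu => hv u (List.mem_cons_of_mem v hu)) qs
    have hS : wiMem w (Function.update (Function.update m p (wordOfInt w v)) P (p + 1)) P (p + 1) vs =
        wiMem w m P p (v :: vs) := by
      funext a
      unfold wiMem
      by_cases haP : a = P
      · subst haP; rw [if_pos rfl, if_pos rfl, hlen]; omega
      · rw [if_neg haP, if_neg haP, hlen]
        by_cases h1 : p + 1 ≤ a ∧ a < p + 1 + vs.length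
        · rw [if_pos h1, if_pos (by omega)]
          obtain ⟨i, rfl⟩ : ∃ i, a = p + (i + 1) := ⟨a - p - 1, by omega⟩
          rw [show p + (i + 1) - (p + 1) = i by omega, show p + (i + 1) - p = i + 1 by omega]
          rfl
        · rw [if_neg h1]
          by_cases h2 : a = p
          · subst h2
            rw [if_pos (by omega), Function.update_of_ne haP, Function.update_self, Nat.sub_self]; rfl
          · rw [if_neg (by omega), Function.update_of_ne haP, Function.update_of_ne h2]
    rw [hS] at h3
    have ht : 2 * (v :: vs).length = 1 + 1 + 2 * vs.length := by rw [hlen]; omega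
    rw [ht]
    unfold writeInts
    exact Exec.seq (Exec.seq h1 h2) h3

/-! ## The offset of the output level -/

/-- Body of the offset loop: `s += t; t := t / N * R; cnt -= 1` (registers `60 s, 61 t, 62 cnt`). [folklore] -/
def lbBody (N R : ℕ) : List OpSpec :=
  [(.add, .dir 60, .dir 60, .dir 61), (.div, .dir 61, .dir 61, .imm N), (.mul, .dir 61, .dir 61, .imm R),
    (.sub, .dir 62, .dir 62, .imm 1)]

/-- The offset loop: from `s = 0`, `t = N^q`, `cnt = q` it computes `s = ∑_{j<q} R^j N^{q-j}`, the
offset of level `q` in a level region. [folklore] -/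
def lbLoop (N R : ℕ) : SProg := whilenz (.dir 62) (block (lbBody N R))

/-- Invariant of the offset loop after `j` iterations. [folklore] -/
structure LBInv (m : ℕ → ℕ) (N R q : ℕ) (qs : List (List ℕ)) (j : ℕ) (st : Store) : Prop where
  queries : st.queries = qs
  r60 : st.mem 60 = ∑ j' ∈ range j, R ^ j' * N ^ (q - j')
  r61 : st.mem 61 = R ^ j * N ^ (q - j)
  r62 : st.mem 62 = q - j
  frame : ∀ c, c ≠ 60 → c ≠ 61 → c ≠ 62 → st.mem c = m c

set_option linter.unusedSimpArgs false in
/-- **The offset loop, specified.** [folklore] -/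
theorem lbLoop_spec {m : ℕ → ℕ} {N R q : ℕ} (hN : 1 ≤ N) (hR : 1 ≤ R) (h60 : m 60 = 0)
    (h61 : m 61 = N ^ q) (h62 : m 62 = q) (hfit : dpSize R N q < 2 ^ w) (qs : List (List ℕ)) :
    ∃ st', ExecLE w O (lbLoop N R) ⟨m, qs⟩ st' (q * 6 + 1) ∧ st'.queries = qs ∧
      st'.mem 60 = ∑ j ∈ range q, R ^ j * N ^ (q - j) ∧
      (∀ c, c ≠ 60 → c ≠ 61 → c ≠ 62 → st'.mem c = m c) := by
  have hqd := succ_le_dpSize hR hN q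
  have h0 : LBInv m N R q qs 0 ⟨m, qs⟩ :=
    ⟨rfl, by simpa using h60, by simpa using h61, by simpa using h62, fun c _ _ _ => rfl⟩
  have hbody : ∀ j, j < q → ∀ st, LBInv m N R q qs j st →
      (Operand.dir 62).read st.mem ≠ 0 ∧ ∃ st', ExecLE w O (block (lbBody N R)) st st' 4 ∧
        LBInv m N R q qs (j + 1) st' := by
    intro j hj st hst
    obtain ⟨hq, h60j, h61j, h62j, hfr⟩ := hst
    obtain ⟨mm, qq⟩ := st
    simp only at hq h60j h61j h62j hfr
    subst qq
    refine ⟨by simp only [Operand.read_dir]; rw [h62j]; omega, ?_⟩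
    -- sizes
    have hsum : ∑ j' ∈ range (j + 1), R ^ j' * N ^ (q - j') ≤ dpSize R N q := by
      unfold dpSize
      exact sum_le_sum_of_subset (range_subset_range.2 (by omega))
    rw [sum_range_succ] at hsum
    have hdiv : R ^ j * N ^ (q - j) / N = R ^ j * N ^ (q - (j + 1)) := by
      rw [show q - j = (q - (j + 1)) + 1 by omega, pow_succ, ← mul_assoc, Nat.mul_div_cancel _ (by omega)]
    have hnext : R ^ j * N ^ (q - (j + 1)) * R = R ^ (j + 1) * N ^ (q - (j + 1)) := by ring
    have hle : R ^ (j + 1) * N ^ (q - (j + 1)) ≤ dpSize R N q := pow_mul_pow_le_dpSize R N q (by omega)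
    obtain ⟨T, hT⟩ : ∃ T, R ^ j * N ^ (q - j) = T := ⟨_, rfl⟩
    obtain ⟨T', hT'⟩ : ∃ T', R ^ (j + 1) * N ^ (q - (j + 1)) = T' := ⟨_, rfl⟩
    obtain ⟨S, hS⟩ : ∃ S, ∑ j' ∈ range j, R ^ j' * N ^ (q - j') = S := ⟨_, rfl⟩
    rw [hT] at h61j hdiv hsum; rw [hS] at h60j hsum; rw [hT'] at hnext hle
    suffices hh : ∃ st', Exec w O (block (lbBody N R)) ⟨mm, qs⟩ st' 4 ∧ LBInv m N R q qs (j + 1) st' by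
      obtain ⟨st', h1, h2⟩ := hh; exact ⟨st', h1.execLE, h2⟩
    refine Exec.block_of_fwd (lbBody N R) qs fun Rf hRf => ?_
    unfold lbBody at hRf
    have htmp := execOps_cons_fwd hRf; clear hRf; obtain ⟨v1, hv1, hRf⟩ := htmp
    simp -failIfUnchanged (disch := omega) only [Operand.write, Operand.read,
      Function.update_self, Function.update_of_ne, BinOp.eval_add_mod', BinOp.eval_mul_mod',
      Nat.mod_eq_of_lt, BinOp.eval_sub_of_le, BinOp.eval_div, Nat.add_zero, h60j, h61j] at hv1 hRf
    subst v1
    have htmp := execOps_cons_fwd hRf; clear hRf; obtain ⟨v2, hv2, hRf⟩ := htmp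
    simp -failIfUnchanged (disch := omega) only [Operand.write, Operand.read,
      Function.update_self, Function.update_of_ne, BinOp.eval_add_mod', BinOp.eval_mul_mod',
      Nat.mod_eq_of_lt, BinOp.eval_sub_of_le, BinOp.eval_div, Nat.add_zero, h61j, hdiv] at hv2 hRf
    subst v2
    have htmp := execOps_cons_fwd hRf; clear hRf; obtain ⟨v3, hv3, hRf⟩ := htmp
    simp -failIfUnchanged (disch := omega) only [Operand.write, Operand.read,
      Function.update_self, Function.update_of_ne, BinOp.eval_add_mod', BinOp.eval_mul_mod',
      Nat.mod_eq_of_lt, BinOp.eval_sub_of_le, BinOp.eval_div, Nat.add_zero, hnext] at hv3 hRf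
    subst v3
    have htmp := execOps_cons_fwd hRf; clear hRf; obtain ⟨v4, hv4, hRf⟩ := htmp
    simp -failIfUnchanged (disch := omega) only [Operand.write, Operand.read,
      Function.update_self, Function.update_of_ne, BinOp.eval_add_mod', BinOp.eval_mul_mod',
      Nat.mod_eq_of_lt, BinOp.eval_sub_of_le, BinOp.eval_div, Nat.add_zero, h62j] at hv4 hRf
    subst v4
    simp only [execOps_nil] at hRf
    subst hRf
    refine ⟨rfl, ?_, ?_, ?_, fun c h1 h2 h3 => ?_⟩ <;> dsimp only
    · simp (disch := omega) only [Function.update_of_ne, Function.update_self]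
      rw [sum_range_succ, hS, hT]
    · simp (disch := omega) only [Function.update_of_ne, Function.update_self]; rw [hT']
    · simp (disch := omega) only [Function.update_of_ne, Function.update_self]; omega
    · simp (disch := omega) only [Function.update_of_ne, Function.update_self]; exact hfr c h1 h2 h3
  obtain ⟨st', hex, hI⟩ := ExecLE.whilenz_invariant (w := w) (O := O) (x := .dir 62)
    (s := block (lbBody N R)) q 4 (fun j st => LBInv m N R q qs j st) hbody
    (fun st hst => by rw [Operand.read_dir, hst.r62]; omega) h0
  exact ⟨st', hex, hI.queries, hI.r60, hI.frame⟩

/-- The offset is the base of level `q` relative to the region. [folklore] -/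
theorem levelBase_eq_add_sum (X R N q : ℕ) :
    levelBase X R N q q = X + ∑ j ∈ range q, R ^ j * N ^ (q - j) := rfl

end SProg

/-! ## The constants of the algorithm and the run-time parameters -/

/-- The constants of Pratt's algorithm for fixed `k` and `ε` (all fixed before the input is seen):
block size `k`, Kronecker exponent `m` of the decomposed tensor `D = T_k^{⊗m}`, its number of triads
`R`, `C = binom(3k,k)`, `C₂ = binom(2k,k)`, a common bound `B ≥ R, C^m`, the word-size threshold
`cB · M + c0` of the table branch, the `0/1` block-membership literal (`C` rows of `3k`) and the
`3 R C^m` signed coefficient literals. [cite: Pratt2024SCC, §2 (proof of Thm. 1.9)] -/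
structure PrattConsts where
  /-- Block size. -/
  k : ℕ
  /-- Kronecker exponent of the decomposed tensor. -/
  m : ℕ
  /-- Number of triads of the decomposition. -/
  R : ℕ
  /-- `binom(3k, k)`. -/
  C : ℕ
  /-- `binom(2k, k)`. -/
  C₂ : ℕ
  /-- A common bound for `R` and `N = C^m`. -/
  B : ℕ
  /-- Slope of the word-size threshold. -/
  cB : ℕ
  /-- Offset of the word-size threshold. -/
  c0 : ℕ
  /-- The block-membership table, row `j` = indicator of the `j`-th `k`-subset of `[3k]`. -/
  BMl : List ℕ
  /-- The three coefficient tables `U, V, W` (each `R` rows of `N`), flattened. -/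
  UVWl : List ℤ
  hk : 1 ≤ k
  hm : 1 ≤ m
  hR : 1 ≤ R
  hC : 1 ≤ C
  hC₂ : 1 ≤ C₂
  hRB : R ≤ B
  hNB : C ^ m ≤ B
  hBMlen : BMl.length = C * (3 * k)
  hBM1 : ∀ v ∈ BMl, v ≤ 1
  hUVWlen : UVWl.length = 3 * (R * C ^ m)
  hcB : 1 ≤ cB

namespace PrattConsts

variable (K : PrattConsts)

/-- Positions per block. [cite: Pratt2024SCC, §2 (proof of Thm. 1.9)] -/
def tk : ℕ := 3 * K.k
/-- The base `N = C^m` of the level tables. [cite: Pratt2024SCC, §2 (proof of Thm. 1.9)] -/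
def N : ℕ := K.C ^ K.m
/-- Number of levels for block count parameter `n₀`: `q = n₀ / (k m) + 1`. [cite: Pratt2024SCC, §2 (proof of Thm. 1.9)] -/
def q (n₀ : ℕ) : ℕ := n₀ / (K.k * K.m) + 1
/-- Number of blocks `r = m q`. [cite: Pratt2024SCC, §2 (proof of Thm. 1.9)] -/
def r (n₀ : ℕ) : ℕ := K.m * K.q n₀
/-- The padded `n = k r ≥ n₀ + 1`. [cite: Pratt2024SCC, §2 (proof of Thm. 1.9)] -/
def n (n₀ : ℕ) : ℕ := K.k * K.r n₀
/-- Universe size `M = 3n = r · 3k`. [cite: Pratt2024SCC, §2 (proof of Thm. 1.9)] -/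
def M (n₀ : ℕ) : ℕ := K.r n₀ * K.tk
/-- Number of flat indices `C^r`. [cite: Pratt2024SCC, §2 (proof of Thm. 1.9)] -/
def Ntot (n₀ : ℕ) : ℕ := K.C ^ K.r n₀
/-- Room for one level region: `(q+1) B^q ≥ dpSize`. [cite: Pratt2024SCC, §2 (proof of Thm. 1.9)] -/
def G (n₀ : ℕ) : ℕ := K.B ^ K.q n₀ * (K.q n₀ + 1)
/-- Number of repetitions `Q = 5 · 27^n / (C C₂)^r + 1`. [cite: Pratt2024SCC, §2 (proof of Thm. 1.9)] -/
def Q (n₀ : ℕ) : ℕ := 27 ^ K.n n₀ * 5 / (K.C * K.C₂) ^ K.r n₀ + 1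
/-- Coin words per repetition. [cite: Pratt2024SCC, §2 (proof of Thm. 1.9)] -/
def coins (n₀ : ℕ) : ℕ := (K.M n₀ - 1) + K.Ntot n₀ * 3
/-- All coin words. [cite: Pratt2024SCC, §2 (proof of Thm. 1.9)] -/
def RC (n₀ : ℕ) : ℕ := K.Q n₀ * K.coins n₀
/-- Offset of the output level in a level region. [cite: Pratt2024SCC, §2 (proof of Thm. 1.9)] -/
def off (n₀ : ℕ) : ℕ := ∑ j ∈ Finset.range (K.q n₀), K.R ^ j * K.N ^ (K.q n₀ - j)
/-- Padding elements per family `d = n - n₀`. [cite: Pratt2024SCC, §2 (proof of Thm. 1.9)] -/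
def d (n₀ : ℕ) : ℕ := K.n n₀ - n₀
/-- Pad mask of family `l`: the `d` bits from `3 n₀ + l d`. [cite: Pratt2024SCC, §2 (proof of Thm. 1.9)] -/
def PM (n₀ l : ℕ) : ℕ := (2 ^ K.d n₀ - 1) * 2 ^ (3 * n₀ + l * K.d n₀)
/-- The word-size threshold of the table branch. [cite: Pratt2024SCC, §2 (proof of Thm. 1.9)] -/
def thr (n₀ : ℕ) : ℕ := K.M n₀ * K.cB + K.c0

/-- The layout of the table branch for input length `L`. [folklore] -/
def lay (n₀ L : ℕ) : RepLayout where
  M := K.M n₀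
  tk := K.tk
  C := K.C
  r := K.r n₀
  N := K.N
  R := K.R
  q := K.q n₀
  pa := L * 2 + 202
  pb := L * 2 + 202 + K.M n₀
  bm := L * 2 + 202 + K.M n₀ + K.M n₀ + K.r n₀ * K.C
  pt := L * 2 + 202 + K.M n₀ + K.M n₀
  FT l := L * 2 + 202 + K.M n₀ + K.M n₀ + K.r n₀ * K.C + K.C * K.tk + l * 2 ^ K.M n₀
  MB := 2 ^ K.M n₀
  X l := L * 2 + 202 + K.M n₀ + K.M n₀ + K.r n₀ * K.C + K.C * K.tk + 3 * 2 ^ K.M n₀ +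
    3 * (K.R * K.N) + l * K.G n₀
  rU l := L * 2 + 202 + K.M n₀ + K.M n₀ + K.r n₀ * K.C + K.C * K.tk + 3 * 2 ^ K.M n₀ + l * (K.R * K.N)

/-- Start of the coin words. [cite: Pratt2024SCC, §2 (proof of Thm. 1.9)] -/
def cp0 (n₀ L : ℕ) : ℕ := (K.lay n₀ L).X 2 + K.G n₀

/-- The block-membership table as a function. [cite: Pratt2024SCC, §2 (proof of Thm. 1.9)] -/
def BM (j i : ℕ) : ℕ := K.BMl.getD (j * K.tk + i) 0

/-- The coefficient tables as words. [cite: Pratt2024SCC, §2 (proof of Thm. 1.9)] -/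
def Uc (w l i e : ℕ) : ℕ := SProg.wordOfInt w (K.UVWl.getD (l * (K.R * K.N) + i * K.N + e) 0)

/-- `dpSize ≤ G`. [folklore] -/
theorem dpSize_le_G (n₀ : ℕ) : SProg.dpSize K.R K.N (K.q n₀) ≤ K.G n₀ := by
  unfold SProg.dpSize G
  calc ∑ j ∈ Finset.range (K.q n₀ + 1), K.R ^ j * K.N ^ (K.q n₀ - j)
      ≤ ∑ _j ∈ Finset.range (K.q n₀ + 1), K.B ^ K.q n₀ := Finset.sum_le_sum fun j hj => by
        rw [Finset.mem_range] at hj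
        calc K.R ^ j * K.N ^ (K.q n₀ - j) ≤ K.B ^ j * K.B ^ (K.q n₀ - j) :=
              Nat.mul_le_mul (Nat.pow_le_pow_left K.hRB _) (Nat.pow_le_pow_left K.hNB _)
          _ = K.B ^ K.q n₀ := by rw [← pow_add]; congr 1; omega
    _ = K.B ^ K.q n₀ * (K.q n₀ + 1) := by rw [Finset.sum_const, Finset.card_range, smul_eq_mul, mul_comm]

/-- `off < G` and `off + R^q ≤ dpSize`. [folklore] -/
theorem off_add_le (n₀ : ℕ) : K.off n₀ + K.R ^ K.q n₀ = SProg.dpSize K.R K.N (K.q n₀) := by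
  unfold off SProg.dpSize
  rw [Finset.sum_range_succ, Nat.sub_self, pow_zero, mul_one]

/-- `1 ≤ q`, `1 ≤ r`, `n₀ + 1 ≤ n ≤ n₀ + k m`, `M = 3 n`. [folklore] -/
theorem params_basic (n₀ : ℕ) : 1 ≤ K.q n₀ ∧ 1 ≤ K.r n₀ ∧ n₀ + 1 ≤ K.n n₀ ∧ K.n n₀ ≤ n₀ + K.k * K.m ∧
    K.M n₀ = 3 * K.n n₀ ∧ K.r n₀ * K.tk = K.M n₀ := by
  have hk := K.hk; have hm := K.hm
  have hkm : 0 < K.k * K.m := Nat.mul_pos hk hm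
  refine ⟨Nat.succ_pos _, Nat.mul_pos hm (Nat.succ_pos _), ?_, ?_, ?_, rfl⟩
  · unfold n r q
    have := Nat.lt_mul_div_succ n₀ hkm
    nlinarith [this]
  · unfold n r q
    have := Nat.div_mul_le_self n₀ (K.k * K.m)
    nlinarith [this]
  · unfold M n tk; ring

end PrattConsts

/-! ## The programs -/

namespace SProg

open Finset StateTransition PrattConsts

variable {w : ℕ} {O : List ℕ → List ℕ}

/-- First parameters, right after the header and the word size: `q, r, M`, the threshold, and the
branch flag `26 := [w < thr]`. [folklore] -/
def paramsA (K : PrattConsts) : List OpSpec :=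
  [(.div, .dir 5, .dir 3, .imm (K.k * K.m)), (.add, .dir 5, .dir 5, .imm 1), (.mul, .dir 36, .imm K.m, .dir 5),
    (.mul, .dir 6, .dir 36, .imm K.tk), (.add, .dir 37, .dir 6, .imm 0), (.mul, .dir 72, .dir 6, .imm K.cB),
    (.add, .dir 72, .dir 72, .imm K.c0), (.lt, .dir 26, .dir 2, .dir 72)]

/-- Set-up of the brute-force branch: stamp table base `89 := 2L + 202`, stamp `90 := 0`, flag
`81 := 0`, no coins (`98 := 0`, `99 := 100`). [folklore] -/
def smallPre : List OpSpec :=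
  [(.mul, .dir 89, .dir 4, .imm 2), (.add, .dir 89, .dir 89, .imm 202), (.add, .dir 90, .imm 0, .imm 0),
    (.add, .dir 81, .imm 0, .imm 0), (.add, .dir 98, .imm 0, .imm 0), (.add, .dir 99, .imm 100, .imm 0)]

/-- Table branch, run-time parameters (see the register plan in the module docstring). [folklore] -/
def bigB1 (K : PrattConsts) : List OpSpec :=
  [(.add, .dir 34, .imm K.tk, .imm 0), (.add, .dir 35, .imm K.C, .imm 0), (.add, .dir 52, .imm K.N, .imm 0),
    (.add, .dir 53, .imm K.R, .imm 0), (.add, .dir 7, .imm K.R, .imm 0), (.add, .dir 60, .dir 36, .imm 0)]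
/-- `8 := Ntot; 60 := q - 1`. [folklore] -/
def bigB2 : List OpSpec := [(.add, .dir 8, .dir 38, .imm 0), (.sub, .dir 60, .dir 5, .imm 1)]
/-- `60 := q`. [folklore] -/
def bigB3 : List OpSpec := [(.add, .dir 60, .dir 5, .imm 0)]
/-- `63 := B; 60 := q`. [folklore] -/
def bigB4 (K : PrattConsts) : List OpSpec := [(.add, .dir 63, .imm K.B, .imm 0), (.add, .dir 60, .dir 5, .imm 0)]
/-- `64 := q + 1; 11 := B^q (q+1); 65 := n; 66 := 27; 60 := n`. [folklore] -/
def bigB5 (K : PrattConsts) : List OpSpec :=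
  [(.add, .dir 64, .dir 5, .imm 1), (.mul, .dir 11, .dir 11, .dir 64), (.mul, .dir 65, .imm K.k, .dir 36),
    (.add, .dir 66, .imm 27, .imm 0), (.add, .dir 60, .dir 65, .imm 0)]
/-- `68 := C C₂; 60 := r`. [folklore] -/
def bigB6 (K : PrattConsts) : List OpSpec := [(.add, .dir 68, .imm (K.C * K.C₂), .imm 0), (.add, .dir 60, .dir 36, .imm 0)]
/-- `Q`, the repetition counter, `coins`, `RC`, and the registers of the offset loop. [folklore] -/
def bigB7 : List OpSpec :=
  [(.mul, .dir 24, .dir 67, .imm 5), (.div, .dir 24, .dir 24, .dir 69), (.add, .dir 24, .dir 24, .imm 1),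
    (.add, .dir 25, .dir 24, .imm 0), (.sub, .dir 70, .dir 6, .imm 1), (.mul, .dir 71, .dir 38, .imm 3),
    (.add, .dir 70, .dir 70, .dir 71), (.mul, .dir 71, .dir 24, .dir 70), (.add, .dir 60, .imm 0, .imm 0),
    (.add, .dir 61, .dir 38, .imm 0), (.add, .dir 62, .dir 5, .imm 0)]

/-- Table branch, part 1: all run-time parameters. [folklore] -/
def bigPre1 (K : PrattConsts) : SProg :=
  seqs [seqs [block (bigB1 K), powLoop 35 60 38], seqs [block bigB2, powLoop 52 60 9],
    seqs [block bigB3, powLoop 53 60 10], seqs [block (bigB4 K), powLoop 63 60 11],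
    seqs [block (bigB5 K), powLoop 66 60 67], seqs [block (bigB6 K), powLoop 68 60 69],
    seqs [block bigB7, lbLoop K.N K.R]]

/-- Table branch, part 2a: the layout `pa, pb, pt, bm, FT₀`, `MB = 2^M`, `FT₁`. [folklore] -/
def bigB8a (K : PrattConsts) : List OpSpec :=
  [(.mul, .dir 15, .dir 4, .imm 2), (.add, .dir 15, .dir 15, .imm 202), (.add, .dir 30, .dir 15, .imm 0),
    (.add, .dir 31, .dir 30, .dir 6), (.add, .dir 33, .dir 31, .dir 6), (.mul, .dir 59, .dir 36, .dir 35),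
    (.add, .dir 32, .dir 33, .dir 59), (.add, .dir 39, .dir 32, .imm (K.C * K.tk)), (.shl, .dir 49, .imm 1, .dir 6),
    (.add, .dir 23, .dir 39, .dir 49)]
/-- Table branch, part 2b: `FT₂, rU₀₋₂, X₀₋₂, cp0`, the coin address, level bases `0, 1`. [folklore] -/
def bigB8b (K : PrattConsts) : List OpSpec :=
  [(.add, .dir 19, .dir 23, .dir 49), (.add, .dir 12, .dir 19, .dir 49),
    (.add, .dir 13, .dir 12, .imm (K.R * K.N)), (.add, .dir 14, .dir 13, .imm (K.R * K.N)),
    (.add, .dir 16, .dir 14, .imm (K.R * K.N)), (.add, .dir 17, .dir 16, .dir 11), (.add, .dir 18, .dir 17, .dir 11),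
    (.add, .dir 80, .dir 18, .dir 11), (.add, .dir 99, .dir 80, .imm 0), (.add, .dir 20, .dir 16, .dir 60),
    (.add, .dir 21, .dir 17, .dir 60)]
/-- Table branch, part 2c: level base `2`, coin count, flag, pad masks, table pointer. [folklore] -/
def bigB8c : List OpSpec :=
  [(.add, .dir 48, .dir 18, .dir 60), (.add, .dir 98, .dir 71, .imm 0),
    (.add, .dir 81, .imm 0, .imm 0), (.sub, .dir 54, .dir 65, .dir 3), (.shl, .dir 55, .imm 1, .dir 54),
    (.sub, .dir 55, .dir 55, .imm 1), (.mul, .dir 56, .dir 3, .imm 3), (.shl, .dir 27, .dir 55, .dir 56),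
    (.shl, .dir 28, .dir 27, .dir 54), (.shl, .dir 29, .dir 28, .dir 54), (.add, .dir 60, .dir 32, .imm 0)]

/-- Table branch, part 3: the constant tables and the three membership tables. [folklore] -/
def bigPre3 (K : PrattConsts) : SProg :=
  seqs [writeConsts 60 K.BMl, block [(.add, .dir 60, .dir 12, .imm 0)], writeInts 60 K.UVWl,
    parseFam 74 77 39 27, parseFam 75 78 23 28, parseFam 76 79 19 29]

/-- **The deterministic part** of Pratt's program. [cite: Pratt2024SCC, §2 (proof of Thm. 1.9)] -/
def prattPre (K : PrattConsts) : SProg :=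
  seqs [relocate, block headerBlock, probeWidth 82 2, block (paramsA K),
    ifz (.dir 26) (seqs [bigPre1 K, seqs [block (bigB8a K), block (bigB8b K), block bigB8c], bigPre3 K])
      (block smallPre)]

/-- **The randomised part**: the repetitions (table branch) or the brute-force scan, then the output
word. [cite: Pratt2024SCC, §2 (proof of Thm. 1.9)] -/
def prattMain : SProg := seq (ifz (.dir 26) repLoop tripleScan) (output1 81)

/-- **Pratt's program** in coins-first normal form. [cite: Pratt2024SCC, §2 (proof of Thm. 1.9)] -/
def prattProg (K : PrattConsts) : Program := withCoins (prattPre K) 98 99 prattMain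

/-! ## Size hypotheses of the table branch -/

/-- What the word size guarantees in the table branch: everything fits. [folklore] -/
structure BigFits (w : ℕ) (K : PrattConsts) (n₀ L : ℕ) : Prop where
  hcp : K.cp0 n₀ L + K.RC n₀ + 1 < 2 ^ w
  h27 : 27 ^ K.n n₀ * 5 < 2 ^ w
  hCC : (K.C * K.C₂) ^ K.r n₀ < 2 ^ w
  hw : 4 ≤ w
  hn₀ : 3 * n₀ ≤ K.M n₀
  hUVW : ∀ v ∈ K.UVWl, v.natAbs < 2 ^ w

/-- The derived bounds. [folklore] -/
theorem BigFits.bounds {w : ℕ} {K : PrattConsts} {n₀ L : ℕ} (h : BigFits w K n₀ L) :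
    K.tk < 2 ^ w ∧ K.C < 2 ^ w ∧ K.N < 2 ^ w ∧ K.R < 2 ^ w ∧ K.B < 2 ^ w ∧ K.C * K.C₂ < 2 ^ w ∧
    K.r n₀ < 2 ^ w ∧ K.q n₀ + 1 < 2 ^ w ∧ K.Ntot n₀ < 2 ^ w ∧ K.N ^ (K.q n₀ - 1) < 2 ^ w ∧
    K.R ^ K.q n₀ < 2 ^ w ∧ K.B ^ K.q n₀ < 2 ^ w ∧ K.G n₀ < 2 ^ w ∧ K.n n₀ < 2 ^ w ∧
    K.Q n₀ < 2 ^ w ∧ K.coins n₀ < 2 ^ w ∧ K.RC n₀ < 2 ^ w ∧ K.M n₀ < w ∧ 1 ≤ K.M n₀ ∧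
    K.Ntot n₀ = K.N ^ K.q n₀ ∧ SProg.dpSize K.R K.N (K.q n₀) < 2 ^ w ∧ K.off n₀ < K.G n₀ ∧
    2 ^ K.M n₀ < 2 ^ w := by
  obtain ⟨hcp, h27, hCC, hw, _, _⟩ := h
  obtain ⟨hq1, hr1, hn1, _, hM3, hrtk⟩ := K.params_basic n₀
  have hk := K.hk; have hm := K.hm; have hR := K.hR; have hC := K.hC; have hC₂ := K.hC₂
  have hRB := K.hRB; have hNB := K.hNB
  have hN1 : 1 ≤ K.N := Nat.pow_pos hC
  have hB1 : 1 ≤ K.B := hR.trans hRB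
  have hcp0 : K.cp0 n₀ L = L * 2 + 202 + K.M n₀ + K.M n₀ + K.r n₀ * K.C + K.C * K.tk + 3 * 2 ^ K.M n₀ +
      3 * (K.R * K.N) + 2 * K.G n₀ + K.G n₀ := rfl
  have hNtot : K.Ntot n₀ = K.N ^ K.q n₀ := by unfold PrattConsts.Ntot PrattConsts.N PrattConsts.r; rw [← pow_mul]
  have hG : K.G n₀ = K.B ^ K.q n₀ * (K.q n₀ + 1) := rfl
  have hRC : K.RC n₀ = K.Q n₀ * K.coins n₀ := rfl
  have hcoins : K.coins n₀ = K.M n₀ - 1 + K.Ntot n₀ * 3 := rfl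
  have htkM : K.tk ≤ K.M n₀ := hrtk ▸ Nat.le_mul_of_pos_left _ hr1
  have hrM : K.r n₀ ≤ K.M n₀ := hrtk ▸ Nat.le_mul_of_pos_right _ (by unfold PrattConsts.tk; omega)
  have hCr : K.C ≤ K.r n₀ * K.C := Nat.le_mul_of_pos_left _ hr1
  have hNRN : K.N ≤ K.R * K.N := Nat.le_mul_of_pos_left _ hR
  have hRRN : K.R ≤ K.R * K.N := Nat.le_mul_of_pos_right _ hN1
  have hBq : K.B ≤ K.B ^ K.q n₀ := by
    calc K.B = K.B ^ 1 := (pow_one _).symm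
      _ ≤ K.B ^ K.q n₀ := Nat.pow_le_pow_right hB1 hq1
  have hBqG : K.B ^ K.q n₀ ≤ K.G n₀ := hG ▸ Nat.le_mul_of_pos_right _ (Nat.succ_pos _)
  have hqG : K.q n₀ + 1 ≤ K.G n₀ := hG ▸ Nat.le_mul_of_pos_left _ (Nat.pow_pos hB1)
  have hRq : K.R ^ K.q n₀ ≤ K.B ^ K.q n₀ := Nat.pow_le_pow_left hRB _
  have hNq : K.N ^ (K.q n₀ - 1) ≤ K.B ^ K.q n₀ :=
    (Nat.pow_le_pow_left hNB _).trans (Nat.pow_le_pow_right hB1 (Nat.sub_le _ _))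
  have hNtot1 : 1 ≤ K.Ntot n₀ := Nat.pow_pos hC
  have hNtotc : K.Ntot n₀ ≤ K.coins n₀ := by rw [hcoins]; omega
  have hcoins1 : 1 ≤ K.coins n₀ := hNtot1.trans hNtotc
  have hQRC : K.Q n₀ ≤ K.RC n₀ := hRC ▸ Nat.le_mul_of_pos_right _ hcoins1
  have hQ1 : 1 ≤ K.Q n₀ := Nat.le_add_left 1 _
  have hcRC : K.coins n₀ ≤ K.RC n₀ := hRC ▸ Nat.le_mul_of_pos_left _ hQ1
  have hn27 : K.n n₀ < 27 ^ K.n n₀ := Nat.lt_pow_self (by norm_num)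
  have hCC1 : K.C * K.C₂ ≤ (K.C * K.C₂) ^ K.r n₀ := by
    calc K.C * K.C₂ = (K.C * K.C₂) ^ 1 := (pow_one _).symm
      _ ≤ _ := Nat.pow_le_pow_right (Nat.mul_pos hC hC₂) hr1
  have h2M : 2 ^ K.M n₀ < 2 ^ w := by omega
  have hMw : K.M n₀ < w := (Nat.pow_lt_pow_iff_right (by norm_num)).1 h2M
  have hds := K.dpSize_le_G n₀
  have hoff : K.off n₀ < K.G n₀ := by
    have := K.off_add_le n₀; have := Nat.pow_pos (n := K.q n₀) hR; omega
  refine ⟨by omega, by omega, by omega, by omega, by omega, by omega, by omega, by omega, by omega, by omega,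
    by omega, by omega, by omega, by omega, by omega, by omega, by omega, hMw, by omega, hNtot, by omega, hoff, h2M⟩

end SProg

namespace SProg

open Finset StateTransition PrattConsts

variable {w : ℕ} {O : List ℕ → List ℕ}

set_option linter.unusedSimpArgs false in
set_option maxHeartbeats 2000000 in
/-- A step of `bigPre1`. [folklore] -/
theorem bigPre1a_spec {m : ℕ → ℕ} {K : PrattConsts} {n₀ L : ℕ} (hF : BigFits w K n₀ L)
    (h36 : m 36 = K.r n₀) (qs : List (List ℕ)) :
    ∃ st', ExecLE w O (seqs [block (bigB1 K), powLoop 35 60 38]) ⟨m, qs⟩ st' (6 + (4 * K.r n₀ + 2)) ∧ st'.queries = qs ∧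
      st'.mem 34 = K.tk ∧ st'.mem 35 = K.C ∧ st'.mem 52 = K.N ∧ st'.mem 53 = K.R ∧ st'.mem 7 = K.R ∧ st'.mem 38 = K.C ^ K.r n₀ ∧ st'.mem 60 = 0 ∧
      (∀ c, c ≠ 7 → c ≠ 34 → c ≠ 35 → c ≠ 38 → c ≠ 52 → c ≠ 53 → c ≠ 60 → st'.mem c = m c) := by
  obtain ⟨btk, bC, bN, bR, bB, bCC1, br, bq, bNtot, bNq, bRq, bBq, bG, bn, bQ, bcoins, bRC, bMw, bM1,
    hNtot, bds, boff, b2M⟩ := hF.bounds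
  have hw1 : 1 ≤ w := by have := hF.hw; omega
  have hNtotdef : K.Ntot n₀ = K.C ^ K.r n₀ := rfl
  have hGdef : K.G n₀ = K.B ^ K.q n₀ * (K.q n₀ + 1) := rfl
  have hndef : K.n n₀ = K.k * K.r n₀ := rfl
  have hQdef : K.Q n₀ = 27 ^ K.n n₀ * 5 / (K.C * K.C₂) ^ K.r n₀ + 1 := rfl
  have hcoinsdef : K.coins n₀ = K.M n₀ - 1 + K.Ntot n₀ * 3 := rfl
  have hRCdef : K.RC n₀ = K.Q n₀ * K.coins n₀ := rfl
  have h27 := hF.h27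
  have hq1 : 1 ≤ K.q n₀ := (K.params_basic n₀).1
  rw [hndef] at h27 bn hQdef
  rw [hNtotdef] at bNtot hcoinsdef hNtot
  rw [hQdef] at bQ hRCdef
  rw [hcoinsdef] at bcoins hRCdef
  rw [hRCdef] at bRC
  rw [hGdef] at bG
  have hCC := hF.hCC
  have hw2 : w < 2 ^ w := Nat.lt_two_pow_self
  have h27w : (27 : ℕ) < 2 ^ w := by
    have h1 : 27 ^ 1 ≤ 27 ^ (K.k * K.r n₀) :=
      Nat.pow_le_pow_right (by norm_num) (by rw [← hndef]; have := (K.params_basic n₀).2.2.1; omega)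
    rw [pow_one] at h1; omega
  -- phase 1: block bigB1
  obtain ⟨st_1, hex1, hP1⟩ : ∃ st', Exec w O (block (bigB1 K)) ⟨m, qs⟩ st' 6 ∧
      (st'.queries = qs ∧ st'.mem 36 = K.r n₀ ∧ st'.mem 34 = K.tk ∧ st'.mem 35 = K.C ∧ st'.mem 52 = K.N ∧ st'.mem 53 = K.R ∧ st'.mem 7 = K.R ∧ st'.mem 60 = K.r n₀ ∧
        ∀ c, c ≠ 7 → c ≠ 34 → c ≠ 35 → c ≠ 52 → c ≠ 53 → c ≠ 60 → st'.mem c = m c) := by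
    refine Exec.block_of_fwd (bigB1 K) qs fun Rf hRf => ?_
    unfold bigB1 at hRf
    have htmp := execOps_cons_fwd hRf; clear hRf; obtain ⟨v1, hv1, hRf⟩ := htmp
    simp -failIfUnchanged (disch := omega) only [Operand.write, Operand.read, Function.update_self, Function.update_of_ne, BinOp.eval_add_mod', BinOp.eval_mul_mod', Nat.mod_eq_of_lt, BinOp.eval_sub_of_le, BinOp.eval_div, BinOp.eval_lt, Nat.add_zero, Nat.zero_add, h36] at hv1 hRf
    subst v1
    have htmp := execOps_cons_fwd hRf; clear hRf; obtain ⟨v2, hv2, hRf⟩ := htmp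
    simp -failIfUnchanged (disch := omega) only [Operand.write, Operand.read, Function.update_self, Function.update_of_ne, BinOp.eval_add_mod', BinOp.eval_mul_mod', Nat.mod_eq_of_lt, BinOp.eval_sub_of_le, BinOp.eval_div, BinOp.eval_lt, Nat.add_zero, Nat.zero_add, h36] at hv2 hRf
    subst v2
    have htmp := execOps_cons_fwd hRf; clear hRf; obtain ⟨v3, hv3, hRf⟩ := htmp
    simp -failIfUnchanged (disch := omega) only [Operand.write, Operand.read, Function.update_self, Function.update_of_ne, BinOp.eval_add_mod', BinOp.eval_mul_mod', Nat.mod_eq_of_lt, BinOp.eval_sub_of_le, BinOp.eval_div, BinOp.eval_lt, Nat.add_zero, Nat.zero_add, h36] at hv3 hRf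
    subst v3
    have htmp := execOps_cons_fwd hRf; clear hRf; obtain ⟨v4, hv4, hRf⟩ := htmp
    simp -failIfUnchanged (disch := omega) only [Operand.write, Operand.read, Function.update_self, Function.update_of_ne, BinOp.eval_add_mod', BinOp.eval_mul_mod', Nat.mod_eq_of_lt, BinOp.eval_sub_of_le, BinOp.eval_div, BinOp.eval_lt, Nat.add_zero, Nat.zero_add, h36] at hv4 hRf
    subst v4
    have htmp := execOps_cons_fwd hRf; clear hRf; obtain ⟨v5, hv5, hRf⟩ := htmp
    simp -failIfUnchanged (disch := omega) only [Operand.write, Operand.read, Function.update_self, Function.update_of_ne, BinOp.eval_add_mod', BinOp.eval_mul_mod', Nat.mod_eq_of_lt, BinOp.eval_sub_of_le, BinOp.eval_div, BinOp.eval_lt, Nat.add_zero, Nat.zero_add, h36] at hv5 hRf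
    subst v5
    have htmp := execOps_cons_fwd hRf; clear hRf; obtain ⟨v6, hv6, hRf⟩ := htmp
    simp -failIfUnchanged (disch := omega) only [Operand.write, Operand.read, Function.update_self, Function.update_of_ne, BinOp.eval_add_mod', BinOp.eval_mul_mod', Nat.mod_eq_of_lt, BinOp.eval_sub_of_le, BinOp.eval_div, BinOp.eval_lt, Nat.add_zero, Nat.zero_add, h36] at hv6 hRf
    subst v6
    simp only [execOps_nil] at hRf
    subst hRf
    refine ⟨rfl, ?_, ?_, ?_, ?_, ?_, ?_, ?_, fun c hc0 hc1 hc2 hc3 hc4 hc5 => ?_⟩ <;> dsimp only <;>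
      (simp (disch := omega) only [Function.update_of_ne, Function.update_self, h36]; try rfl)
  obtain ⟨hq1, P36, P34, P35, P52, P53, P7, P60, fr1⟩ := hP1
  obtain ⟨m1, qq1⟩ := st_1
  simp only at hq1 P36 P34 P35 P52 P53 P7 P60 fr1 hex1
  subst qq1
  have F1 : ∀ c, c ≠ 7 → c ≠ 34 → c ≠ 35 → c ≠ 38 → c ≠ 52 → c ≠ 53 → c ≠ 60 → m1 c = m c := fun c g0 g1 g2 g3 g4 g5 g6 => fr1 c (by omega) (by omega) (by omega) (by omega) (by omega) (by omega)
  -- phase 2: powLoop 35 60 38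
  have hex2 := powLoop_plain (w := w) (O := O) (m := m1) (X := 35) (E := 60) (Y := 38) (x := K.C) (e := K.r n₀)
    (by norm_num) (by norm_num) (by norm_num) (by norm_num) (by norm_num) (by norm_num) P35 P60 hw1 (by omega) (by omega) qs
  obtain ⟨m2, hm2⟩ : ∃ mm, Function.update (Function.update m1 38 ((K.C) ^ (K.r n₀))) 60 0 = mm := ⟨_, rfl⟩
  rw [hm2] at hex2
  have fr2 : ∀ c, c ≠ 38 → c ≠ 60 → m2 c = m1 c := fun c g1 g2 => by
    rw [← hm2, Function.update_of_ne g2, Function.update_of_ne g1]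
  have P36 : m2 36 = K.r n₀ := (fr2 36 (by norm_num) (by norm_num)).trans P36
  have P34 : m2 34 = K.tk := (fr2 34 (by norm_num) (by norm_num)).trans P34
  have P35 : m2 35 = K.C := (fr2 35 (by norm_num) (by norm_num)).trans P35
  have P52 : m2 52 = K.N := (fr2 52 (by norm_num) (by norm_num)).trans P52
  have P53 : m2 53 = K.R := (fr2 53 (by norm_num) (by norm_num)).trans P53
  have P7 : m2 7 = K.R := (fr2 7 (by norm_num) (by norm_num)).trans P7
  have P38 : m2 38 = K.C ^ K.r n₀ := by rw [← hm2, Function.update_of_ne (by norm_num), Function.update_self]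
  have P60 : m2 60 = 0 := by rw [← hm2, Function.update_self]
  have F2 : ∀ c, c ≠ 7 → c ≠ 34 → c ≠ 35 → c ≠ 38 → c ≠ 52 → c ≠ 53 → c ≠ 60 → m2 c = m c := fun c g0 g1 g2 g3 g4 g5 g6 =>
    (fr2 c (by omega) (by omega)).trans (F1 c g0 g1 g2 g3 g4 g5 g6)
  refine ⟨⟨m2, qs⟩, ?_, rfl, ?_, ?_, ?_, ?_, ?_, ?_, ?_, F2⟩
  · exact hex1.execLE.seqs_cons (ExecLE.seqs_one hex2.execLE)
  · exact P34
  · exact P35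
  · exact P52
  · exact P53
  · exact P7
  · exact P38
  · exact P60

set_option linter.unusedSimpArgs false in
set_option maxHeartbeats 2000000 in
/-- A step of `bigPre1`. [folklore] -/
theorem bigPre1b_spec {m : ℕ → ℕ} {K : PrattConsts} {n₀ L : ℕ} (hF : BigFits w K n₀ L)
    (h38 : m 38 = K.C ^ K.r n₀) (h5 : m 5 = K.q n₀) (h52 : m 52 = K.N) (qs : List (List ℕ)) :
    ∃ st', ExecLE w O (seqs [block bigB2, powLoop 52 60 9]) ⟨m, qs⟩ st' (2 + (4 * (K.q n₀ - 1) + 2)) ∧ st'.queries = qs ∧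
      st'.mem 8 = K.C ^ K.r n₀ ∧ st'.mem 9 = K.N ^ (K.q n₀ - 1) ∧ st'.mem 60 = 0 ∧
      (∀ c, c ≠ 8 → c ≠ 9 → c ≠ 60 → st'.mem c = m c) := by
  obtain ⟨btk, bC, bN, bR, bB, bCC1, br, bq, bNtot, bNq, bRq, bBq, bG, bn, bQ, bcoins, bRC, bMw, bM1,
    hNtot, bds, boff, b2M⟩ := hF.bounds
  have hw1 : 1 ≤ w := by have := hF.hw; omega
  have hNtotdef : K.Ntot n₀ = K.C ^ K.r n₀ := rfl
  have hGdef : K.G n₀ = K.B ^ K.q n₀ * (K.q n₀ + 1) := rfl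
  have hndef : K.n n₀ = K.k * K.r n₀ := rfl
  have hQdef : K.Q n₀ = 27 ^ K.n n₀ * 5 / (K.C * K.C₂) ^ K.r n₀ + 1 := rfl
  have hcoinsdef : K.coins n₀ = K.M n₀ - 1 + K.Ntot n₀ * 3 := rfl
  have hRCdef : K.RC n₀ = K.Q n₀ * K.coins n₀ := rfl
  have h27 := hF.h27
  have hq1 : 1 ≤ K.q n₀ := (K.params_basic n₀).1
  rw [hndef] at h27 bn hQdef
  rw [hNtotdef] at bNtot hcoinsdef hNtot
  rw [hQdef] at bQ hRCdef
  rw [hcoinsdef] at bcoins hRCdef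
  rw [hRCdef] at bRC
  rw [hGdef] at bG
  have hCC := hF.hCC
  have hw2 : w < 2 ^ w := Nat.lt_two_pow_self
  have h27w : (27 : ℕ) < 2 ^ w := by
    have h1 : 27 ^ 1 ≤ 27 ^ (K.k * K.r n₀) :=
      Nat.pow_le_pow_right (by norm_num) (by rw [← hndef]; have := (K.params_basic n₀).2.2.1; omega)
    rw [pow_one] at h1; omega
  -- phase 1: block bigB2
  obtain ⟨st_1, hex1, hP1⟩ : ∃ st', Exec w O (block (bigB2)) ⟨m, qs⟩ st' 2 ∧
      (st'.queries = qs ∧ st'.mem 38 = K.C ^ K.r n₀ ∧ st'.mem 5 = K.q n₀ ∧ st'.mem 52 = K.N ∧ st'.mem 8 = K.C ^ K.r n₀ ∧ st'.mem 60 = K.q n₀ - 1 ∧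
        ∀ c, c ≠ 8 → c ≠ 60 → st'.mem c = m c) := by
    refine Exec.block_of_fwd (bigB2) qs fun Rf hRf => ?_
    unfold bigB2 at hRf
    have htmp := execOps_cons_fwd hRf; clear hRf; obtain ⟨v1, hv1, hRf⟩ := htmp
    simp -failIfUnchanged (disch := omega) only [Operand.write, Operand.read, Function.update_self, Function.update_of_ne, BinOp.eval_add_mod', BinOp.eval_mul_mod', Nat.mod_eq_of_lt, BinOp.eval_sub_of_le, BinOp.eval_div, BinOp.eval_lt, Nat.add_zero, Nat.zero_add, h38, h5, h52] at hv1 hRf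
    subst v1
    have htmp := execOps_cons_fwd hRf; clear hRf; obtain ⟨v2, hv2, hRf⟩ := htmp
    simp -failIfUnchanged (disch := omega) only [Operand.write, Operand.read, Function.update_self, Function.update_of_ne, BinOp.eval_add_mod', BinOp.eval_mul_mod', Nat.mod_eq_of_lt, BinOp.eval_sub_of_le, BinOp.eval_div, BinOp.eval_lt, Nat.add_zero, Nat.zero_add, h38, h5, h52] at hv2 hRf
    subst v2
    simp only [execOps_nil] at hRf
    subst hRf
    refine ⟨rfl, ?_, ?_, ?_, ?_, ?_, fun c hc0 hc1 => ?_⟩ <;> dsimp only <;>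
      (simp (disch := omega) only [Function.update_of_ne, Function.update_self, h38, h5, h52]; try rfl)
  obtain ⟨hq1, P38, P5, P52, P8, P60, fr1⟩ := hP1
  obtain ⟨m1, qq1⟩ := st_1
  simp only at hq1 P38 P5 P52 P8 P60 fr1 hex1
  subst qq1
  have F1 : ∀ c, c ≠ 8 → c ≠ 9 → c ≠ 60 → m1 c = m c := fun c g0 g1 g2 => fr1 c (by omega) (by omega)
  -- phase 2: powLoop 52 60 9
  have hex2 := powLoop_plain (w := w) (O := O) (m := m1) (X := 52) (E := 60) (Y := 9) (x := K.N) (e := K.q n₀ - 1)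
    (by norm_num) (by norm_num) (by norm_num) (by norm_num) (by norm_num) (by norm_num) P52 P60 hw1 (by omega) (by omega) qs
  obtain ⟨m2, hm2⟩ : ∃ mm, Function.update (Function.update m1 9 ((K.N) ^ (K.q n₀ - 1))) 60 0 = mm := ⟨_, rfl⟩
  rw [hm2] at hex2
  have fr2 : ∀ c, c ≠ 9 → c ≠ 60 → m2 c = m1 c := fun c g1 g2 => by
    rw [← hm2, Function.update_of_ne g2, Function.update_of_ne g1]
  have P38 : m2 38 = K.C ^ K.r n₀ := (fr2 38 (by norm_num) (by norm_num)).trans P38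
  have P5 : m2 5 = K.q n₀ := (fr2 5 (by norm_num) (by norm_num)).trans P5
  have P52 : m2 52 = K.N := (fr2 52 (by norm_num) (by norm_num)).trans P52
  have P8 : m2 8 = K.C ^ K.r n₀ := (fr2 8 (by norm_num) (by norm_num)).trans P8
  have P9 : m2 9 = K.N ^ (K.q n₀ - 1) := by rw [← hm2, Function.update_of_ne (by norm_num), Function.update_self]
  have P60 : m2 60 = 0 := by rw [← hm2, Function.update_self]
  have F2 : ∀ c, c ≠ 8 → c ≠ 9 → c ≠ 60 → m2 c = m c := fun c g0 g1 g2 =>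
    (fr2 c (by omega) (by omega)).trans (F1 c g0 g1 g2)
  refine ⟨⟨m2, qs⟩, ?_, rfl, ?_, ?_, ?_, F2⟩
  · exact hex1.execLE.seqs_cons (ExecLE.seqs_one hex2.execLE)
  · exact P8
  · exact P9
  · exact P60

set_option linter.unusedSimpArgs false in
set_option maxHeartbeats 2000000 in
/-- A step of `bigPre1`. [folklore] -/
theorem bigPre1c_spec {m : ℕ → ℕ} {K : PrattConsts} {n₀ L : ℕ} (hF : BigFits w K n₀ L)
    (h5 : m 5 = K.q n₀) (h53 : m 53 = K.R) (qs : List (List ℕ)) :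
    ∃ st', ExecLE w O (seqs [block bigB3, powLoop 53 60 10]) ⟨m, qs⟩ st' (1 + (4 * K.q n₀ + 2)) ∧ st'.queries = qs ∧
      st'.mem 10 = K.R ^ K.q n₀ ∧ st'.mem 60 = 0 ∧
      (∀ c, c ≠ 10 → c ≠ 60 → st'.mem c = m c) := by
  obtain ⟨btk, bC, bN, bR, bB, bCC1, br, bq, bNtot, bNq, bRq, bBq, bG, bn, bQ, bcoins, bRC, bMw, bM1,
    hNtot, bds, boff, b2M⟩ := hF.bounds
  have hw1 : 1 ≤ w := by have := hF.hw; omega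
  have hNtotdef : K.Ntot n₀ = K.C ^ K.r n₀ := rfl
  have hGdef : K.G n₀ = K.B ^ K.q n₀ * (K.q n₀ + 1) := rfl
  have hndef : K.n n₀ = K.k * K.r n₀ := rfl
  have hQdef : K.Q n₀ = 27 ^ K.n n₀ * 5 / (K.C * K.C₂) ^ K.r n₀ + 1 := rfl
  have hcoinsdef : K.coins n₀ = K.M n₀ - 1 + K.Ntot n₀ * 3 := rfl
  have hRCdef : K.RC n₀ = K.Q n₀ * K.coins n₀ := rfl
  have h27 := hF.h27
  have hq1 : 1 ≤ K.q n₀ := (K.params_basic n₀).1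
  rw [hndef] at h27 bn hQdef
  rw [hNtotdef] at bNtot hcoinsdef hNtot
  rw [hQdef] at bQ hRCdef
  rw [hcoinsdef] at bcoins hRCdef
  rw [hRCdef] at bRC
  rw [hGdef] at bG
  have hCC := hF.hCC
  have hw2 : w < 2 ^ w := Nat.lt_two_pow_self
  have h27w : (27 : ℕ) < 2 ^ w := by
    have h1 : 27 ^ 1 ≤ 27 ^ (K.k * K.r n₀) :=
      Nat.pow_le_pow_right (by norm_num) (by rw [← hndef]; have := (K.params_basic n₀).2.2.1; omega)
    rw [pow_one] at h1; omega
  -- phase 1: block bigB3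
  obtain ⟨st_1, hex1, hP1⟩ : ∃ st', Exec w O (block (bigB3)) ⟨m, qs⟩ st' 1 ∧
      (st'.queries = qs ∧ st'.mem 5 = K.q n₀ ∧ st'.mem 53 = K.R ∧ st'.mem 60 = K.q n₀ ∧
        ∀ c, c ≠ 60 → st'.mem c = m c) := by
    refine Exec.block_of_fwd (bigB3) qs fun Rf hRf => ?_
    unfold bigB3 at hRf
    have htmp := execOps_cons_fwd hRf; clear hRf; obtain ⟨v1, hv1, hRf⟩ := htmp
    simp -failIfUnchanged (disch := omega) only [Operand.write, Operand.read, Function.update_self, Function.update_of_ne, BinOp.eval_add_mod', BinOp.eval_mul_mod', Nat.mod_eq_of_lt, BinOp.eval_sub_of_le, BinOp.eval_div, BinOp.eval_lt, Nat.add_zero, Nat.zero_add, h5, h53] at hv1 hRf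
    subst v1
    simp only [execOps_nil] at hRf
    subst hRf
    refine ⟨rfl, ?_, ?_, ?_, fun c hc0 => ?_⟩ <;> dsimp only <;>
      (simp (disch := omega) only [Function.update_of_ne, Function.update_self, h5, h53]; try rfl)
  obtain ⟨hq1, P5, P53, P60, fr1⟩ := hP1
  obtain ⟨m1, qq1⟩ := st_1
  simp only at hq1 P5 P53 P60 fr1 hex1
  subst qq1
  have F1 : ∀ c, c ≠ 10 → c ≠ 60 → m1 c = m c := fun c g0 g1 => fr1 c (by omega)
  -- phase 2: powLoop 53 60 10
  have hex2 := powLoop_plain (w := w) (O := O) (m := m1) (X := 53) (E := 60) (Y := 10) (x := K.R) (e := K.q n₀)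
    (by norm_num) (by norm_num) (by norm_num) (by norm_num) (by norm_num) (by norm_num) P53 P60 hw1 (by omega) (by omega) qs
  obtain ⟨m2, hm2⟩ : ∃ mm, Function.update (Function.update m1 10 ((K.R) ^ (K.q n₀))) 60 0 = mm := ⟨_, rfl⟩
  rw [hm2] at hex2
  have fr2 : ∀ c, c ≠ 10 → c ≠ 60 → m2 c = m1 c := fun c g1 g2 => by
    rw [← hm2, Function.update_of_ne g2, Function.update_of_ne g1]
  have P5 : m2 5 = K.q n₀ := (fr2 5 (by norm_num) (by norm_num)).trans P5
  have P53 : m2 53 = K.R := (fr2 53 (by norm_num) (by norm_num)).trans P53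
  have P10 : m2 10 = K.R ^ K.q n₀ := by rw [← hm2, Function.update_of_ne (by norm_num), Function.update_self]
  have P60 : m2 60 = 0 := by rw [← hm2, Function.update_self]
  have F2 : ∀ c, c ≠ 10 → c ≠ 60 → m2 c = m c := fun c g0 g1 =>
    (fr2 c (by omega) (by omega)).trans (F1 c g0 g1)
  refine ⟨⟨m2, qs⟩, ?_, rfl, ?_, ?_, F2⟩
  · exact hex1.execLE.seqs_cons (ExecLE.seqs_one hex2.execLE)
  · exact P10
  · exact P60

set_option linter.unusedSimpArgs false in
set_option maxHeartbeats 2000000 in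
/-- A step of `bigPre1`. [folklore] -/
theorem bigPre1d_spec {m : ℕ → ℕ} {K : PrattConsts} {n₀ L : ℕ} (hF : BigFits w K n₀ L)
    (h5 : m 5 = K.q n₀) (qs : List (List ℕ)) :
    ∃ st', ExecLE w O (seqs [block (bigB4 K), powLoop 63 60 11]) ⟨m, qs⟩ st' (2 + (4 * K.q n₀ + 2)) ∧ st'.queries = qs ∧
      st'.mem 11 = K.B ^ K.q n₀ ∧ st'.mem 60 = 0 ∧ st'.mem 63 = K.B ∧
      (∀ c, c ≠ 11 → c ≠ 60 → c ≠ 63 → st'.mem c = m c) := by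
  obtain ⟨btk, bC, bN, bR, bB, bCC1, br, bq, bNtot, bNq, bRq, bBq, bG, bn, bQ, bcoins, bRC, bMw, bM1,
    hNtot, bds, boff, b2M⟩ := hF.bounds
  have hw1 : 1 ≤ w := by have := hF.hw; omega
  have hNtotdef : K.Ntot n₀ = K.C ^ K.r n₀ := rfl
  have hGdef : K.G n₀ = K.B ^ K.q n₀ * (K.q n₀ + 1) := rfl
  have hndef : K.n n₀ = K.k * K.r n₀ := rfl
  have hQdef : K.Q n₀ = 27 ^ K.n n₀ * 5 / (K.C * K.C₂) ^ K.r n₀ + 1 := rfl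
  have hcoinsdef : K.coins n₀ = K.M n₀ - 1 + K.Ntot n₀ * 3 := rfl
  have hRCdef : K.RC n₀ = K.Q n₀ * K.coins n₀ := rfl
  have h27 := hF.h27
  have hq1 : 1 ≤ K.q n₀ := (K.params_basic n₀).1
  rw [hndef] at h27 bn hQdef
  rw [hNtotdef] at bNtot hcoinsdef hNtot
  rw [hQdef] at bQ hRCdef
  rw [hcoinsdef] at bcoins hRCdef
  rw [hRCdef] at bRC
  rw [hGdef] at bG
  have hCC := hF.hCC
  have hw2 : w < 2 ^ w := Nat.lt_two_pow_self
  have h27w : (27 : ℕ) < 2 ^ w := by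
    have h1 : 27 ^ 1 ≤ 27 ^ (K.k * K.r n₀) :=
      Nat.pow_le_pow_right (by norm_num) (by rw [← hndef]; have := (K.params_basic n₀).2.2.1; omega)
    rw [pow_one] at h1; omega
  -- phase 1: block bigB4
  obtain ⟨st_1, hex1, hP1⟩ : ∃ st', Exec w O (block (bigB4 K)) ⟨m, qs⟩ st' 2 ∧
      (st'.queries = qs ∧ st'.mem 5 = K.q n₀ ∧ st'.mem 63 = K.B ∧ st'.mem 60 = K.q n₀ ∧
        ∀ c, c ≠ 60 → c ≠ 63 → st'.mem c = m c) := by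
    refine Exec.block_of_fwd (bigB4 K) qs fun Rf hRf => ?_
    unfold bigB4 at hRf
    have htmp := execOps_cons_fwd hRf; clear hRf; obtain ⟨v1, hv1, hRf⟩ := htmp
    simp -failIfUnchanged (disch := omega) only [Operand.write, Operand.read, Function.update_self, Function.update_of_ne, BinOp.eval_add_mod', BinOp.eval_mul_mod', Nat.mod_eq_of_lt, BinOp.eval_sub_of_le, BinOp.eval_div, BinOp.eval_lt, Nat.add_zero, Nat.zero_add, h5] at hv1 hRf
    subst v1
    have htmp := execOps_cons_fwd hRf; clear hRf; obtain ⟨v2, hv2, hRf⟩ := htmp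
    simp -failIfUnchanged (disch := omega) only [Operand.write, Operand.read, Function.update_self, Function.update_of_ne, BinOp.eval_add_mod', BinOp.eval_mul_mod', Nat.mod_eq_of_lt, BinOp.eval_sub_of_le, BinOp.eval_div, BinOp.eval_lt, Nat.add_zero, Nat.zero_add, h5] at hv2 hRf
    subst v2
    simp only [execOps_nil] at hRf
    subst hRf
    refine ⟨rfl, ?_, ?_, ?_, fun c hc0 hc1 => ?_⟩ <;> dsimp only <;>
      (simp (disch := omega) only [Function.update_of_ne, Function.update_self, h5]; try rfl)
  obtain ⟨hq1, P5, P63, P60, fr1⟩ := hP1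
  obtain ⟨m1, qq1⟩ := st_1
  simp only at hq1 P5 P63 P60 fr1 hex1
  subst qq1
  have F1 : ∀ c, c ≠ 11 → c ≠ 60 → c ≠ 63 → m1 c = m c := fun c g0 g1 g2 => fr1 c (by omega) (by omega)
  -- phase 2: powLoop 63 60 11
  have hex2 := powLoop_plain (w := w) (O := O) (m := m1) (X := 63) (E := 60) (Y := 11) (x := K.B) (e := K.q n₀)
    (by norm_num) (by norm_num) (by norm_num) (by norm_num) (by norm_num) (by norm_num) P63 P60 hw1 (by omega) (by omega) qs
  obtain ⟨m2, hm2⟩ : ∃ mm, Function.update (Function.update m1 11 ((K.B) ^ (K.q n₀))) 60 0 = mm := ⟨_, rfl⟩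
  rw [hm2] at hex2
  have fr2 : ∀ c, c ≠ 11 → c ≠ 60 → m2 c = m1 c := fun c g1 g2 => by
    rw [← hm2, Function.update_of_ne g2, Function.update_of_ne g1]
  have P5 : m2 5 = K.q n₀ := (fr2 5 (by norm_num) (by norm_num)).trans P5
  have P63 : m2 63 = K.B := (fr2 63 (by norm_num) (by norm_num)).trans P63
  have P11 : m2 11 = K.B ^ K.q n₀ := by rw [← hm2, Function.update_of_ne (by norm_num), Function.update_self]
  have P60 : m2 60 = 0 := by rw [← hm2, Function.update_self]
  have F2 : ∀ c, c ≠ 11 → c ≠ 60 → c ≠ 63 → m2 c = m c := fun c g0 g1 g2 =>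
    (fr2 c (by omega) (by omega)).trans (F1 c g0 g1 g2)
  refine ⟨⟨m2, qs⟩, ?_, rfl, ?_, ?_, ?_, F2⟩
  · exact hex1.execLE.seqs_cons (ExecLE.seqs_one hex2.execLE)
  · exact P11
  · exact P60
  · exact P63

set_option linter.unusedSimpArgs false in
set_option maxHeartbeats 2000000 in
/-- A step of `bigPre1`. [folklore] -/
theorem bigPre1e_spec {m : ℕ → ℕ} {K : PrattConsts} {n₀ L : ℕ} (hF : BigFits w K n₀ L)
    (h5 : m 5 = K.q n₀) (h11 : m 11 = K.B ^ K.q n₀) (h36 : m 36 = K.r n₀) (qs : List (List ℕ)) :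
    ∃ st', ExecLE w O (seqs [block (bigB5 K), powLoop 66 60 67]) ⟨m, qs⟩ st' (5 + (4 * (K.k * K.r n₀) + 2)) ∧ st'.queries = qs ∧
      st'.mem 11 = K.B ^ K.q n₀ * (K.q n₀ + 1) ∧ st'.mem 65 = K.k * K.r n₀ ∧ st'.mem 67 = 27 ^ (K.k * K.r n₀) ∧ st'.mem 60 = 0 ∧
      (∀ c, c ≠ 11 → c ≠ 60 → c ≠ 64 → c ≠ 65 → c ≠ 66 → c ≠ 67 → st'.mem c = m c) := by
  obtain ⟨btk, bC, bN, bR, bB, bCC1, br, bq, bNtot, bNq, bRq, bBq, bG, bn, bQ, bcoins, bRC, bMw, bM1,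
    hNtot, bds, boff, b2M⟩ := hF.bounds
  have hw1 : 1 ≤ w := by have := hF.hw; omega
  have hNtotdef : K.Ntot n₀ = K.C ^ K.r n₀ := rfl
  have hGdef : K.G n₀ = K.B ^ K.q n₀ * (K.q n₀ + 1) := rfl
  have hndef : K.n n₀ = K.k * K.r n₀ := rfl
  have hQdef : K.Q n₀ = 27 ^ K.n n₀ * 5 / (K.C * K.C₂) ^ K.r n₀ + 1 := rfl
  have hcoinsdef : K.coins n₀ = K.M n₀ - 1 + K.Ntot n₀ * 3 := rfl
  have hRCdef : K.RC n₀ = K.Q n₀ * K.coins n₀ := rfl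
  have h27 := hF.h27
  have hq1 : 1 ≤ K.q n₀ := (K.params_basic n₀).1
  rw [hndef] at h27 bn hQdef
  rw [hNtotdef] at bNtot hcoinsdef hNtot
  rw [hQdef] at bQ hRCdef
  rw [hcoinsdef] at bcoins hRCdef
  rw [hRCdef] at bRC
  rw [hGdef] at bG
  have hCC := hF.hCC
  have hw2 : w < 2 ^ w := Nat.lt_two_pow_self
  have h27w : (27 : ℕ) < 2 ^ w := by
    have h1 : 27 ^ 1 ≤ 27 ^ (K.k * K.r n₀) :=
      Nat.pow_le_pow_right (by norm_num) (by rw [← hndef]; have := (K.params_basic n₀).2.2.1; omega)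
    rw [pow_one] at h1; omega
  -- phase 1: block bigB5
  obtain ⟨st_1, hex1, hP1⟩ : ∃ st', Exec w O (block (bigB5 K)) ⟨m, qs⟩ st' 5 ∧
      (st'.queries = qs ∧ st'.mem 5 = K.q n₀ ∧ st'.mem 36 = K.r n₀ ∧ st'.mem 64 = K.q n₀ + 1 ∧ st'.mem 11 = K.B ^ K.q n₀ * (K.q n₀ + 1) ∧ st'.mem 65 = K.k * K.r n₀ ∧ st'.mem 66 = 27 ∧ st'.mem 60 = K.k * K.r n₀ ∧
        ∀ c, c ≠ 11 → c ≠ 60 → c ≠ 64 → c ≠ 65 → c ≠ 66 → st'.mem c = m c) := by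
    refine Exec.block_of_fwd (bigB5 K) qs fun Rf hRf => ?_
    unfold bigB5 at hRf
    have htmp := execOps_cons_fwd hRf; clear hRf; obtain ⟨v1, hv1, hRf⟩ := htmp
    simp -failIfUnchanged (disch := omega) only [Operand.write, Operand.read, Function.update_self, Function.update_of_ne, BinOp.eval_add_mod', BinOp.eval_mul_mod', Nat.mod_eq_of_lt, BinOp.eval_sub_of_le, BinOp.eval_div, BinOp.eval_lt, Nat.add_zero, Nat.zero_add, h5, h11, h36] at hv1 hRf
    subst v1
    have htmp := execOps_cons_fwd hRf; clear hRf; obtain ⟨v2, hv2, hRf⟩ := htmp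
    simp -failIfUnchanged (disch := omega) only [Operand.write, Operand.read, Function.update_self, Function.update_of_ne, BinOp.eval_add_mod', BinOp.eval_mul_mod', Nat.mod_eq_of_lt, BinOp.eval_sub_of_le, BinOp.eval_div, BinOp.eval_lt, Nat.add_zero, Nat.zero_add, h5, h11, h36] at hv2 hRf
    subst v2
    have htmp := execOps_cons_fwd hRf; clear hRf; obtain ⟨v3, hv3, hRf⟩ := htmp
    simp -failIfUnchanged (disch := omega) only [Operand.write, Operand.read, Function.update_self, Function.update_of_ne, BinOp.eval_add_mod', BinOp.eval_mul_mod', Nat.mod_eq_of_lt, BinOp.eval_sub_of_le, BinOp.eval_div, BinOp.eval_lt, Nat.add_zero, Nat.zero_add, h5, h11, h36] at hv3 hRf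
    subst v3
    have htmp := execOps_cons_fwd hRf; clear hRf; obtain ⟨v4, hv4, hRf⟩ := htmp
    simp -failIfUnchanged (disch := omega) only [Operand.write, Operand.read, Function.update_self, Function.update_of_ne, BinOp.eval_add_mod', BinOp.eval_mul_mod', Nat.mod_eq_of_lt, BinOp.eval_sub_of_le, BinOp.eval_div, BinOp.eval_lt, Nat.add_zero, Nat.zero_add, h5, h11, h36] at hv4 hRf
    subst v4
    have htmp := execOps_cons_fwd hRf; clear hRf; obtain ⟨v5, hv5, hRf⟩ := htmp
    simp -failIfUnchanged (disch := omega) only [Operand.write, Operand.read, Function.update_self, Function.update_of_ne, BinOp.eval_add_mod', BinOp.eval_mul_mod', Nat.mod_eq_of_lt, BinOp.eval_sub_of_le, BinOp.eval_div, BinOp.eval_lt, Nat.add_zero, Nat.zero_add, h5, h11, h36] at hv5 hRf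
    subst v5
    simp only [execOps_nil] at hRf
    subst hRf
    refine ⟨rfl, ?_, ?_, ?_, ?_, ?_, ?_, ?_, fun c hc0 hc1 hc2 hc3 hc4 => ?_⟩ <;> dsimp only <;>
      (simp (disch := omega) only [Function.update_of_ne, Function.update_self, h5, h11, h36]; try rfl)
  obtain ⟨hq1, P5, P36, P64, P11, P65, P66, P60, fr1⟩ := hP1
  obtain ⟨m1, qq1⟩ := st_1
  simp only at hq1 P5 P36 P64 P11 P65 P66 P60 fr1 hex1
  subst qq1
  have F1 : ∀ c, c ≠ 11 → c ≠ 60 → c ≠ 64 → c ≠ 65 → c ≠ 66 → c ≠ 67 → m1 c = m c := fun c g0 g1 g2 g3 g4 g5 => fr1 c (by omega) (by omega) (by omega) (by omega) (by omega)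
  -- phase 2: powLoop 66 60 67
  have hex2 := powLoop_plain (w := w) (O := O) (m := m1) (X := 66) (E := 60) (Y := 67) (x := 27) (e := K.k * K.r n₀)
    (by norm_num) (by norm_num) (by norm_num) (by norm_num) (by norm_num) (by norm_num) P66 P60 hw1 (by omega) (by omega) qs
  obtain ⟨m2, hm2⟩ : ∃ mm, Function.update (Function.update m1 67 ((27) ^ (K.k * K.r n₀))) 60 0 = mm := ⟨_, rfl⟩
  rw [hm2] at hex2
  have fr2 : ∀ c, c ≠ 67 → c ≠ 60 → m2 c = m1 c := fun c g1 g2 => by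
    rw [← hm2, Function.update_of_ne g2, Function.update_of_ne g1]
  have P5 : m2 5 = K.q n₀ := (fr2 5 (by norm_num) (by norm_num)).trans P5
  have P36 : m2 36 = K.r n₀ := (fr2 36 (by norm_num) (by norm_num)).trans P36
  have P64 : m2 64 = K.q n₀ + 1 := (fr2 64 (by norm_num) (by norm_num)).trans P64
  have P11 : m2 11 = K.B ^ K.q n₀ * (K.q n₀ + 1) := (fr2 11 (by norm_num) (by norm_num)).trans P11
  have P65 : m2 65 = K.k * K.r n₀ := (fr2 65 (by norm_num) (by norm_num)).trans P65
  have P66 : m2 66 = 27 := (fr2 66 (by norm_num) (by norm_num)).trans P66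
  have P67 : m2 67 = 27 ^ (K.k * K.r n₀) := by rw [← hm2, Function.update_of_ne (by norm_num), Function.update_self]
  have P60 : m2 60 = 0 := by rw [← hm2, Function.update_self]
  have F2 : ∀ c, c ≠ 11 → c ≠ 60 → c ≠ 64 → c ≠ 65 → c ≠ 66 → c ≠ 67 → m2 c = m c := fun c g0 g1 g2 g3 g4 g5 =>
    (fr2 c (by omega) (by omega)).trans (F1 c g0 g1 g2 g3 g4 g5)
  refine ⟨⟨m2, qs⟩, ?_, rfl, ?_, ?_, ?_, ?_, F2⟩
  · exact hex1.execLE.seqs_cons (ExecLE.seqs_one hex2.execLE)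
  · exact P11
  · exact P65
  · exact P67
  · exact P60

set_option linter.unusedSimpArgs false in
set_option maxHeartbeats 2000000 in
/-- A step of `bigPre1`. [folklore] -/
theorem bigPre1f_spec {m : ℕ → ℕ} {K : PrattConsts} {n₀ L : ℕ} (hF : BigFits w K n₀ L)
    (h36 : m 36 = K.r n₀) (qs : List (List ℕ)) :
    ∃ st', ExecLE w O (seqs [block (bigB6 K), powLoop 68 60 69]) ⟨m, qs⟩ st' (2 + (4 * K.r n₀ + 2)) ∧ st'.queries = qs ∧
      st'.mem 69 = (K.C * K.C₂) ^ K.r n₀ ∧ st'.mem 60 = 0 ∧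
      (∀ c, c ≠ 60 → c ≠ 68 → c ≠ 69 → st'.mem c = m c) := by
  obtain ⟨btk, bC, bN, bR, bB, bCC1, br, bq, bNtot, bNq, bRq, bBq, bG, bn, bQ, bcoins, bRC, bMw, bM1,
    hNtot, bds, boff, b2M⟩ := hF.bounds
  have hw1 : 1 ≤ w := by have := hF.hw; omega
  have hNtotdef : K.Ntot n₀ = K.C ^ K.r n₀ := rfl
  have hGdef : K.G n₀ = K.B ^ K.q n₀ * (K.q n₀ + 1) := rfl
  have hndef : K.n n₀ = K.k * K.r n₀ := rfl
  have hQdef : K.Q n₀ = 27 ^ K.n n₀ * 5 / (K.C * K.C₂) ^ K.r n₀ + 1 := rfl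
  have hcoinsdef : K.coins n₀ = K.M n₀ - 1 + K.Ntot n₀ * 3 := rfl
  have hRCdef : K.RC n₀ = K.Q n₀ * K.coins n₀ := rfl
  have h27 := hF.h27
  have hq1 : 1 ≤ K.q n₀ := (K.params_basic n₀).1
  rw [hndef] at h27 bn hQdef
  rw [hNtotdef] at bNtot hcoinsdef hNtot
  rw [hQdef] at bQ hRCdef
  rw [hcoinsdef] at bcoins hRCdef
  rw [hRCdef] at bRC
  rw [hGdef] at bG
  have hCC := hF.hCC
  have hw2 : w < 2 ^ w := Nat.lt_two_pow_self
  have h27w : (27 : ℕ) < 2 ^ w := by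
    have h1 : 27 ^ 1 ≤ 27 ^ (K.k * K.r n₀) :=
      Nat.pow_le_pow_right (by norm_num) (by rw [← hndef]; have := (K.params_basic n₀).2.2.1; omega)
    rw [pow_one] at h1; omega
  -- phase 1: block bigB6
  obtain ⟨st_1, hex1, hP1⟩ : ∃ st', Exec w O (block (bigB6 K)) ⟨m, qs⟩ st' 2 ∧
      (st'.queries = qs ∧ st'.mem 36 = K.r n₀ ∧ st'.mem 68 = K.C * K.C₂ ∧ st'.mem 60 = K.r n₀ ∧
        ∀ c, c ≠ 60 → c ≠ 68 → st'.mem c = m c) := by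
    refine Exec.block_of_fwd (bigB6 K) qs fun Rf hRf => ?_
    unfold bigB6 at hRf
    have htmp := execOps_cons_fwd hRf; clear hRf; obtain ⟨v1, hv1, hRf⟩ := htmp
    simp -failIfUnchanged (disch := omega) only [Operand.write, Operand.read, Function.update_self, Function.update_of_ne, BinOp.eval_add_mod', BinOp.eval_mul_mod', Nat.mod_eq_of_lt, BinOp.eval_sub_of_le, BinOp.eval_div, BinOp.eval_lt, Nat.add_zero, Nat.zero_add, h36] at hv1 hRf
    subst v1
    have htmp := execOps_cons_fwd hRf; clear hRf; obtain ⟨v2, hv2, hRf⟩ := htmp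
    simp -failIfUnchanged (disch := omega) only [Operand.write, Operand.read, Function.update_self, Function.update_of_ne, BinOp.eval_add_mod', BinOp.eval_mul_mod', Nat.mod_eq_of_lt, BinOp.eval_sub_of_le, BinOp.eval_div, BinOp.eval_lt, Nat.add_zero, Nat.zero_add, h36] at hv2 hRf
    subst v2
    simp only [execOps_nil] at hRf
    subst hRf
    refine ⟨rfl, ?_, ?_, ?_, fun c hc0 hc1 => ?_⟩ <;> dsimp only <;>
      (simp (disch := omega) only [Function.update_of_ne, Function.update_self, h36]; try rfl)
  obtain ⟨hq1, P36, P68, P60, fr1⟩ := hP1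
  obtain ⟨m1, qq1⟩ := st_1
  simp only at hq1 P36 P68 P60 fr1 hex1
  subst qq1
  have F1 : ∀ c, c ≠ 60 → c ≠ 68 → c ≠ 69 → m1 c = m c := fun c g0 g1 g2 => fr1 c (by omega) (by omega)
  -- phase 2: powLoop 68 60 69
  have hex2 := powLoop_plain (w := w) (O := O) (m := m1) (X := 68) (E := 60) (Y := 69) (x := K.C * K.C₂) (e := K.r n₀)
    (by norm_num) (by norm_num) (by norm_num) (by norm_num) (by norm_num) (by norm_num) P68 P60 hw1 (by omega) (by omega) qs
  obtain ⟨m2, hm2⟩ : ∃ mm, Function.update (Function.update m1 69 ((K.C * K.C₂) ^ (K.r n₀))) 60 0 = mm := ⟨_, rfl⟩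
  rw [hm2] at hex2
  have fr2 : ∀ c, c ≠ 69 → c ≠ 60 → m2 c = m1 c := fun c g1 g2 => by
    rw [← hm2, Function.update_of_ne g2, Function.update_of_ne g1]
  have P36 : m2 36 = K.r n₀ := (fr2 36 (by norm_num) (by norm_num)).trans P36
  have P68 : m2 68 = K.C * K.C₂ := (fr2 68 (by norm_num) (by norm_num)).trans P68
  have P69 : m2 69 = (K.C * K.C₂) ^ K.r n₀ := by rw [← hm2, Function.update_of_ne (by norm_num), Function.update_self]
  have P60 : m2 60 = 0 := by rw [← hm2, Function.update_self]
  have F2 : ∀ c, c ≠ 60 → c ≠ 68 → c ≠ 69 → m2 c = m c := fun c g0 g1 g2 =>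
    (fr2 c (by omega) (by omega)).trans (F1 c g0 g1 g2)
  refine ⟨⟨m2, qs⟩, ?_, rfl, ?_, ?_, F2⟩
  · exact hex1.execLE.seqs_cons (ExecLE.seqs_one hex2.execLE)
  · exact P69
  · exact P60

set_option linter.unusedSimpArgs false in
set_option maxHeartbeats 2000000 in
/-- A step of `bigPre1`. [folklore] -/
theorem bigPre1g_spec {m : ℕ → ℕ} {K : PrattConsts} {n₀ L : ℕ} (hF : BigFits w K n₀ L)
    (h67 : m 67 = 27 ^ (K.k * K.r n₀)) (h69 : m 69 = (K.C * K.C₂) ^ K.r n₀) (h6 : m 6 = K.M n₀) (h38 : m 38 = K.C ^ K.r n₀) (h5 : m 5 = K.q n₀) (qs : List (List ℕ)) :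
    ∃ st', ExecLE w O (seqs [block bigB7, lbLoop K.N K.R]) ⟨m, qs⟩ st' (11 + (K.q n₀ * 6 + 1)) ∧ st'.queries = qs ∧
      st'.mem 24 = 27 ^ (K.k * K.r n₀) * 5 / (K.C * K.C₂) ^ K.r n₀ + 1 ∧ st'.mem 25 = 27 ^ (K.k * K.r n₀) * 5 / (K.C * K.C₂) ^ K.r n₀ + 1 ∧ st'.mem 70 = K.M n₀ - 1 + K.C ^ K.r n₀ * 3 ∧ st'.mem 71 = (27 ^ (K.k * K.r n₀) * 5 / (K.C * K.C₂) ^ K.r n₀ + 1) * (K.M n₀ - 1 + K.C ^ K.r n₀ * 3) ∧ st'.mem 60 = K.off n₀ ∧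
      (∀ c, c ≠ 24 → c ≠ 25 → c ≠ 60 → c ≠ 61 → c ≠ 62 → c ≠ 70 → c ≠ 71 → st'.mem c = m c) := by
  obtain ⟨btk, bC, bN, bR, bB, bCC1, br, bq, bNtot, bNq, bRq, bBq, bG, bn, bQ, bcoins, bRC, bMw, bM1,
    hNtot, bds, boff, b2M⟩ := hF.bounds
  have hw1 : 1 ≤ w := by have := hF.hw; omega
  have hNtotdef : K.Ntot n₀ = K.C ^ K.r n₀ := rfl
  have hGdef : K.G n₀ = K.B ^ K.q n₀ * (K.q n₀ + 1) := rfl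
  have hndef : K.n n₀ = K.k * K.r n₀ := rfl
  have hQdef : K.Q n₀ = 27 ^ K.n n₀ * 5 / (K.C * K.C₂) ^ K.r n₀ + 1 := rfl
  have hcoinsdef : K.coins n₀ = K.M n₀ - 1 + K.Ntot n₀ * 3 := rfl
  have hRCdef : K.RC n₀ = K.Q n₀ * K.coins n₀ := rfl
  have h27 := hF.h27
  have hq1 : 1 ≤ K.q n₀ := (K.params_basic n₀).1
  rw [hndef] at h27 bn hQdef
  rw [hNtotdef] at bNtot hcoinsdef hNtot
  rw [hQdef] at bQ hRCdef
  rw [hcoinsdef] at bcoins hRCdef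
  rw [hRCdef] at bRC
  rw [hGdef] at bG
  have hCC := hF.hCC
  have hw2 : w < 2 ^ w := Nat.lt_two_pow_self
  have h27w : (27 : ℕ) < 2 ^ w := by
    have h1 : 27 ^ 1 ≤ 27 ^ (K.k * K.r n₀) :=
      Nat.pow_le_pow_right (by norm_num) (by rw [← hndef]; have := (K.params_basic n₀).2.2.1; omega)
    rw [pow_one] at h1; omega
  -- phase 1: block bigB7
  obtain ⟨st_1, hex1, hP1⟩ : ∃ st', Exec w O (block (bigB7)) ⟨m, qs⟩ st' 11 ∧
      (st'.queries = qs ∧ st'.mem 67 = 27 ^ (K.k * K.r n₀) ∧ st'.mem 69 = (K.C * K.C₂) ^ K.r n₀ ∧ st'.mem 6 = K.M n₀ ∧ st'.mem 38 = K.C ^ K.r n₀ ∧ st'.mem 5 = K.q n₀ ∧ st'.mem 24 = 27 ^ (K.k * K.r n₀) * 5 / (K.C * K.C₂) ^ K.r n₀ + 1 ∧ st'.mem 25 = 27 ^ (K.k * K.r n₀) * 5 / (K.C * K.C₂) ^ K.r n₀ + 1 ∧ st'.mem 70 = K.M n₀ - 1 + K.C ^ K.r n₀ * 3 ∧ st'.mem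 71 = (27 ^ (K.k * K.r n₀) * 5 / (K.C * K.C₂) ^ K.r n₀ + 1) * (K.M n₀ - 1 + K.C ^ K.r n₀ * 3) ∧ st'.mem 60 = 0 ∧ st'.mem 61 = K.C ^ K.r n₀ ∧ st'.mem 62 = K.q n₀ ∧
        ∀ c, c ≠ 24 → c ≠ 25 → c ≠ 60 → c ≠ 61 → c ≠ 62 → c ≠ 70 → c ≠ 71 → st'.mem c = m c) := by
    refine Exec.block_of_fwd (bigB7) qs fun Rf hRf => ?_
    unfold bigB7 at hRf
    have htmp := execOps_cons_fwd hRf; clear hRf; obtain ⟨v1, hv1, hRf⟩ := htmp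
    simp -failIfUnchanged (disch := omega) only [Operand.write, Operand.read, Function.update_self, Function.update_of_ne, BinOp.eval_add_mod', BinOp.eval_mul_mod', Nat.mod_eq_of_lt, BinOp.eval_sub_of_le, BinOp.eval_div, BinOp.eval_lt, Nat.add_zero, Nat.zero_add, h67, h69, h6, h38, h5] at hv1 hRf
    subst v1
    have htmp := execOps_cons_fwd hRf; clear hRf; obtain ⟨v2, hv2, hRf⟩ := htmp
    simp -failIfUnchanged (disch := omega) only [Operand.write, Operand.read, Function.update_self, Function.update_of_ne, BinOp.eval_add_mod', BinOp.eval_mul_mod', Nat.mod_eq_of_lt, BinOp.eval_sub_of_le, BinOp.eval_div, BinOp.eval_lt, Nat.add_zero, Nat.zero_add, h67, h69, h6, h38, h5] at hv2 hRf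
    subst v2
    have htmp := execOps_cons_fwd hRf; clear hRf; obtain ⟨v3, hv3, hRf⟩ := htmp
    simp -failIfUnchanged (disch := omega) only [Operand.write, Operand.read, Function.update_self, Function.update_of_ne, BinOp.eval_add_mod', BinOp.eval_mul_mod', Nat.mod_eq_of_lt, BinOp.eval_sub_of_le, BinOp.eval_div, BinOp.eval_lt, Nat.add_zero, Nat.zero_add, h67, h69, h6, h38, h5] at hv3 hRf
    subst v3
    have htmp := execOps_cons_fwd hRf; clear hRf; obtain ⟨v4, hv4, hRf⟩ := htmp
    simp -failIfUnchanged (disch := omega) only [Operand.write, Operand.read, Function.update_self, Function.update_of_ne, BinOp.eval_add_mod', BinOp.eval_mul_mod', Nat.mod_eq_of_lt, BinOp.eval_sub_of_le, BinOp.eval_div, BinOp.eval_lt, Nat.add_zero, Nat.zero_add, h67, h69, h6, h38, h5] at hv4 hRf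
    subst v4
    have htmp := execOps_cons_fwd hRf; clear hRf; obtain ⟨v5, hv5, hRf⟩ := htmp
    simp -failIfUnchanged (disch := omega) only [Operand.write, Operand.read, Function.update_self, Function.update_of_ne, BinOp.eval_add_mod', BinOp.eval_mul_mod', Nat.mod_eq_of_lt, BinOp.eval_sub_of_le, BinOp.eval_div, BinOp.eval_lt, Nat.add_zero, Nat.zero_add, h67, h69, h6, h38, h5] at hv5 hRf
    subst v5
    have htmp := execOps_cons_fwd hRf; clear hRf; obtain ⟨v6, hv6, hRf⟩ := htmp
    simp -failIfUnchanged (disch := omega) only [Operand.write, Operand.read, Function.update_self, Function.update_of_ne, BinOp.eval_add_mod', BinOp.eval_mul_mod', Nat.mod_eq_of_lt, BinOp.eval_sub_of_le, BinOp.eval_div, BinOp.eval_lt, Nat.add_zero, Nat.zero_add, h67, h69, h6, h38, h5] at hv6 hRf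
    subst v6
    have htmp := execOps_cons_fwd hRf; clear hRf; obtain ⟨v7, hv7, hRf⟩ := htmp
    simp -failIfUnchanged (disch := omega) only [Operand.write, Operand.read, Function.update_self, Function.update_of_ne, BinOp.eval_add_mod', BinOp.eval_mul_mod', Nat.mod_eq_of_lt, BinOp.eval_sub_of_le, BinOp.eval_div, BinOp.eval_lt, Nat.add_zero, Nat.zero_add, h67, h69, h6, h38, h5] at hv7 hRf
    subst v7
    have htmp := execOps_cons_fwd hRf; clear hRf; obtain ⟨v8, hv8, hRf⟩ := htmp
    simp -failIfUnchanged (disch := omega) only [Operand.write, Operand.read, Function.update_self, Function.update_of_ne, BinOp.eval_add_mod', BinOp.eval_mul_mod', Nat.mod_eq_of_lt, BinOp.eval_sub_of_le, BinOp.eval_div, BinOp.eval_lt, Nat.add_zero, Nat.zero_add, h67, h69, h6, h38, h5] at hv8 hRf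
    subst v8
    have htmp := execOps_cons_fwd hRf; clear hRf; obtain ⟨v9, hv9, hRf⟩ := htmp
    simp -failIfUnchanged (disch := omega) only [Operand.write, Operand.read, Function.update_self, Function.update_of_ne, BinOp.eval_add_mod', BinOp.eval_mul_mod', Nat.mod_eq_of_lt, BinOp.eval_sub_of_le, BinOp.eval_div, BinOp.eval_lt, Nat.add_zero, Nat.zero_add, h67, h69, h6, h38, h5] at hv9 hRf
    subst v9
    have htmp := execOps_cons_fwd hRf; clear hRf; obtain ⟨v10, hv10, hRf⟩ := htmp
    simp -failIfUnchanged (disch := omega) only [Operand.write, Operand.read, Function.update_self, Function.update_of_ne, BinOp.eval_add_mod', BinOp.eval_mul_mod', Nat.mod_eq_of_lt, BinOp.eval_sub_of_le, BinOp.eval_div, BinOp.eval_lt, Nat.add_zero, Nat.zero_add, h67, h69, h6, h38, h5] at hv10 hRf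
    subst v10
    have htmp := execOps_cons_fwd hRf; clear hRf; obtain ⟨v11, hv11, hRf⟩ := htmp
    simp -failIfUnchanged (disch := omega) only [Operand.write, Operand.read, Function.update_self, Function.update_of_ne, BinOp.eval_add_mod', BinOp.eval_mul_mod', Nat.mod_eq_of_lt, BinOp.eval_sub_of_le, BinOp.eval_div, BinOp.eval_lt, Nat.add_zero, Nat.zero_add, h67, h69, h6, h38, h5] at hv11 hRf
    subst v11
    simp only [execOps_nil] at hRf
    subst hRf
    refine ⟨rfl, ?_, ?_, ?_, ?_, ?_, ?_, ?_, ?_, ?_, ?_, ?_, ?_, fun c hc0 hc1 hc2 hc3 hc4 hc5 hc6 => ?_⟩ <;> dsimp only <;>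
      (simp (disch := omega) only [Function.update_of_ne, Function.update_self, h67, h69, h6, h38, h5]; try rfl)
  obtain ⟨hq1, P67, P69, P6, P38, P5, P24, P25, P70, P71, P60, P61, P62, fr1⟩ := hP1
  obtain ⟨m1, qq1⟩ := st_1
  simp only at hq1 P67 P69 P6 P38 P5 P24 P25 P70 P71 P60 P61 P62 fr1 hex1
  subst qq1
  have F1 : ∀ c, c ≠ 24 → c ≠ 25 → c ≠ 60 → c ≠ 61 → c ≠ 62 → c ≠ 70 → c ≠ 71 → m1 c = m c := fun c g0 g1 g2 g3 g4 g5 g6 => fr1 c (by omega) (by omega) (by omega) (by omega) (by omega) (by omega) (by omega)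
  -- phase 2: the offset loop
  obtain ⟨st_2, hex2, hq2, P60', fr2⟩ := lbLoop_spec (w := w) (O := O) (m := m1) (N := K.N) (R := K.R) (q := K.q n₀)
    (Nat.pow_pos K.hC) K.hR P60 (by rw [P61, hNtot]) P62 bds qs
  obtain ⟨m2, qq2⟩ := st_2
  simp only at hq2 P60' fr2 hex2
  subst qq2
  have P67 : m2 67 = 27 ^ (K.k * K.r n₀) := (fr2 67 (by norm_num) (by norm_num) (by norm_num)).trans P67
  have P69 : m2 69 = (K.C * K.C₂) ^ K.r n₀ := (fr2 69 (by norm_num) (by norm_num) (by norm_num)).trans P69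
  have P6 : m2 6 = K.M n₀ := (fr2 6 (by norm_num) (by norm_num) (by norm_num)).trans P6
  have P38 : m2 38 = K.C ^ K.r n₀ := (fr2 38 (by norm_num) (by norm_num) (by norm_num)).trans P38
  have P5 : m2 5 = K.q n₀ := (fr2 5 (by norm_num) (by norm_num) (by norm_num)).trans P5
  have P24 : m2 24 = 27 ^ (K.k * K.r n₀) * 5 / (K.C * K.C₂) ^ K.r n₀ + 1 := (fr2 24 (by norm_num) (by norm_num) (by norm_num)).trans P24
  have P25 : m2 25 = 27 ^ (K.k * K.r n₀) * 5 / (K.C * K.C₂) ^ K.r n₀ + 1 := (fr2 25 (by norm_num) (by norm_num) (by norm_num)).trans P25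
  have P70 : m2 70 = K.M n₀ - 1 + K.C ^ K.r n₀ * 3 := (fr2 70 (by norm_num) (by norm_num) (by norm_num)).trans P70
  have P71 : m2 71 = (27 ^ (K.k * K.r n₀) * 5 / (K.C * K.C₂) ^ K.r n₀ + 1) * (K.M n₀ - 1 + K.C ^ K.r n₀ * 3) := (fr2 71 (by norm_num) (by norm_num) (by norm_num)).trans P71
  have F2 : ∀ c, c ≠ 24 → c ≠ 25 → c ≠ 60 → c ≠ 61 → c ≠ 62 → c ≠ 70 → c ≠ 71 → m2 c = m c := fun c g0 g1 g2 g3 g4 g5 g6 =>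
    (fr2 c (by omega) (by omega) (by omega)).trans (F1 c g0 g1 g2 g3 g4 g5 g6)
  refine ⟨⟨m2, qs⟩, ?_, rfl, ?_, ?_, ?_, ?_, ?_, F2⟩
  · exact hex1.execLE.seqs_cons (ExecLE.seqs_one hex2)
  · exact P24
  · exact P25
  · exact P70
  · exact P71
  · exact P60'

/-- Step count of `bigPre1`. [folklore] -/
def pre1Time (K : PrattConsts) (n₀ : ℕ) : ℕ :=
  6 + (4 * K.r n₀ + 2) + (2 + (4 * (K.q n₀ - 1) + 2) + (1 + (4 * K.q n₀ + 2) + (2 + (4 * K.q n₀ + 2) +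
    (5 + (4 * (K.k * K.r n₀) + 2) + (2 + (4 * K.r n₀ + 2) + (11 + (K.q n₀ * 6 + 1)))))))

/-- **Part 1 of the table branch, specified**: all run-time parameters in their registers.
[folklore] -/
theorem bigPre1_spec {m : ℕ → ℕ} {K : PrattConsts} {n₀ L : ℕ} (hF : BigFits w K n₀ L)
    (h5 : m 5 = K.q n₀) (h36 : m 36 = K.r n₀) (h6 : m 6 = K.M n₀) (qs : List (List ℕ)) :
    ∃ st', ExecLE w O (bigPre1 K) ⟨m, qs⟩ st' (pre1Time K n₀) ∧ st'.queries = qs ∧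
      st'.mem 34 = K.tk ∧ st'.mem 35 = K.C ∧ st'.mem 52 = K.N ∧ st'.mem 53 = K.R ∧ st'.mem 7 = K.R ∧
      st'.mem 38 = K.Ntot n₀ ∧ st'.mem 8 = K.Ntot n₀ ∧ st'.mem 9 = K.N ^ (K.q n₀ - 1) ∧
      st'.mem 10 = K.R ^ K.q n₀ ∧ st'.mem 11 = K.G n₀ ∧ st'.mem 24 = K.Q n₀ ∧ st'.mem 25 = K.Q n₀ ∧
      st'.mem 65 = K.n n₀ ∧ st'.mem 70 = K.coins n₀ ∧ st'.mem 71 = K.RC n₀ ∧ st'.mem 60 = K.off n₀ ∧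
      (∀ c, ¬ (7 ≤ c ∧ c ≤ 11) → c ≠ 24 → c ≠ 25 → c ≠ 34 → c ≠ 35 → c ≠ 38 → c ≠ 52 → c ≠ 53 → ¬ (60 ≤ c ∧ c ≤ 71) → st'.mem c = m c) := by
  obtain ⟨st_a, ex_a, q_a, a34, a35, a52, a53, a7, a38, a60, f_a⟩ := bigPre1a_spec (w := w) (O := O) hF h36 qs
  obtain ⟨m_a, qq_a⟩ := st_a
  simp only at q_a a34 a35 a52 a53 a7 a38 a60 f_a ex_a
  subst qq_a
  have ac5 : m_a 5 = _ := (f_a 5 (by norm_num) (by norm_num) (by norm_num) (by norm_num) (by norm_num) (by norm_num) (by norm_num)).trans h5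
  have ac36 : m_a 36 = _ := (f_a 36 (by norm_num) (by norm_num) (by norm_num) (by norm_num) (by norm_num) (by norm_num) (by norm_num)).trans h36
  have ac6 : m_a 6 = _ := (f_a 6 (by norm_num) (by norm_num) (by norm_num) (by norm_num) (by norm_num) (by norm_num) (by norm_num)).trans h6
  have F_a : ∀ c, ¬ (7 ≤ c ∧ c ≤ 11) → c ≠ 24 → c ≠ 25 → c ≠ 34 → c ≠ 35 → c ≠ 38 → c ≠ 52 → c ≠ 53 → ¬ (60 ≤ c ∧ c ≤ 71) → m_a c = m c := fun c g1 g2 g3 g4 g5 g6 g7 g8 g9 => f_a c (by omega) (by omega) (by omega) (by omega) (by omega) (by omega) (by omega)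
  obtain ⟨st_b, ex_b, q_b, b8, b9, b60, f_b⟩ := bigPre1b_spec (w := w) (O := O) hF a38 ac5 a52 qs
  obtain ⟨m_b, qq_b⟩ := st_b
  simp only at q_b b8 b9 b60 f_b ex_b
  subst qq_b
  have bc5 : m_b 5 = _ := (f_b 5 (by norm_num) (by norm_num) (by norm_num)).trans ac5
  have bc36 : m_b 36 = _ := (f_b 36 (by norm_num) (by norm_num) (by norm_num)).trans ac36
  have bc6 : m_b 6 = _ := (f_b 6 (by norm_num) (by norm_num) (by norm_num)).trans ac6
  have bc34 : m_b 34 = _ := (f_b 34 (by norm_num) (by norm_num) (by norm_num)).trans a34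
  have bc35 : m_b 35 = _ := (f_b 35 (by norm_num) (by norm_num) (by norm_num)).trans a35
  have bc52 : m_b 52 = _ := (f_b 52 (by norm_num) (by norm_num) (by norm_num)).trans a52
  have bc53 : m_b 53 = _ := (f_b 53 (by norm_num) (by norm_num) (by norm_num)).trans a53
  have bc7 : m_b 7 = _ := (f_b 7 (by norm_num) (by norm_num) (by norm_num)).trans a7
  have bc38 : m_b 38 = _ := (f_b 38 (by norm_num) (by norm_num) (by norm_num)).trans a38
  have F_b : ∀ c, ¬ (7 ≤ c ∧ c ≤ 11) → c ≠ 24 → c ≠ 25 → c ≠ 34 → c ≠ 35 → c ≠ 38 → c ≠ 52 → c ≠ 53 → ¬ (60 ≤ c ∧ c ≤ 71) → m_b c = m c := fun c g1 g2 g3 g4 g5 g6 g7 g8 g9 =>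
    (f_b c (by omega) (by omega) (by omega)).trans (F_a c g1 g2 g3 g4 g5 g6 g7 g8 g9)
  obtain ⟨st_c, ex_c, q_c, c10, c60, f_c⟩ := bigPre1c_spec (w := w) (O := O) hF bc5 bc53 qs
  obtain ⟨m_c, qq_c⟩ := st_c
  simp only at q_c c10 c60 f_c ex_c
  subst qq_c
  have cc5 : m_c 5 = _ := (f_c 5 (by norm_num) (by norm_num)).trans bc5
  have cc36 : m_c 36 = _ := (f_c 36 (by norm_num) (by norm_num)).trans bc36
  have cc6 : m_c 6 = _ := (f_c 6 (by norm_num) (by norm_num)).trans bc6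
  have cc34 : m_c 34 = _ := (f_c 34 (by norm_num) (by norm_num)).trans bc34
  have cc35 : m_c 35 = _ := (f_c 35 (by norm_num) (by norm_num)).trans bc35
  have cc52 : m_c 52 = _ := (f_c 52 (by norm_num) (by norm_num)).trans bc52
  have cc53 : m_c 53 = _ := (f_c 53 (by norm_num) (by norm_num)).trans bc53
  have cc7 : m_c 7 = _ := (f_c 7 (by norm_num) (by norm_num)).trans bc7
  have cc38 : m_c 38 = _ := (f_c 38 (by norm_num) (by norm_num)).trans bc38
  have cc8 : m_c 8 = _ := (f_c 8 (by norm_num) (by norm_num)).trans b8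
  have cc9 : m_c 9 = _ := (f_c 9 (by norm_num) (by norm_num)).trans b9
  have F_c : ∀ c, ¬ (7 ≤ c ∧ c ≤ 11) → c ≠ 24 → c ≠ 25 → c ≠ 34 → c ≠ 35 → c ≠ 38 → c ≠ 52 → c ≠ 53 → ¬ (60 ≤ c ∧ c ≤ 71) → m_c c = m c := fun c g1 g2 g3 g4 g5 g6 g7 g8 g9 =>
    (f_c c (by omega) (by omega)).trans (F_b c g1 g2 g3 g4 g5 g6 g7 g8 g9)
  obtain ⟨st_d, ex_d, q_d, d11, d60, d63, f_d⟩ := bigPre1d_spec (w := w) (O := O) hF cc5 qs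
  obtain ⟨m_d, qq_d⟩ := st_d
  simp only at q_d d11 d60 d63 f_d ex_d
  subst qq_d
  have dc5 : m_d 5 = _ := (f_d 5 (by norm_num) (by norm_num) (by norm_num)).trans cc5
  have dc36 : m_d 36 = _ := (f_d 36 (by norm_num) (by norm_num) (by norm_num)).trans cc36
  have dc6 : m_d 6 = _ := (f_d 6 (by norm_num) (by norm_num) (by norm_num)).trans cc6
  have dc34 : m_d 34 = _ := (f_d 34 (by norm_num) (by norm_num) (by norm_num)).trans cc34
  have dc35 : m_d 35 = _ := (f_d 35 (by norm_num) (by norm_num) (by norm_num)).trans cc35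
  have dc52 : m_d 52 = _ := (f_d 52 (by norm_num) (by norm_num) (by norm_num)).trans cc52
  have dc53 : m_d 53 = _ := (f_d 53 (by norm_num) (by norm_num) (by norm_num)).trans cc53
  have dc7 : m_d 7 = _ := (f_d 7 (by norm_num) (by norm_num) (by norm_num)).trans cc7
  have dc38 : m_d 38 = _ := (f_d 38 (by norm_num) (by norm_num) (by norm_num)).trans cc38
  have dc8 : m_d 8 = _ := (f_d 8 (by norm_num) (by norm_num) (by norm_num)).trans cc8
  have dc9 : m_d 9 = _ := (f_d 9 (by norm_num) (by norm_num) (by norm_num)).trans cc9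
  have dc10 : m_d 10 = _ := (f_d 10 (by norm_num) (by norm_num) (by norm_num)).trans c10
  have F_d : ∀ c, ¬ (7 ≤ c ∧ c ≤ 11) → c ≠ 24 → c ≠ 25 → c ≠ 34 → c ≠ 35 → c ≠ 38 → c ≠ 52 → c ≠ 53 → ¬ (60 ≤ c ∧ c ≤ 71) → m_d c = m c := fun c g1 g2 g3 g4 g5 g6 g7 g8 g9 =>
    (f_d c (by omega) (by omega) (by omega)).trans (F_c c g1 g2 g3 g4 g5 g6 g7 g8 g9)
  obtain ⟨st_e, ex_e, q_e, e11, e65, e67, e60, f_e⟩ := bigPre1e_spec (w := w) (O := O) hF dc5 d11 dc36 qs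
  obtain ⟨m_e, qq_e⟩ := st_e
  simp only at q_e e11 e65 e67 e60 f_e ex_e
  subst qq_e
  have ec5 : m_e 5 = _ := (f_e 5 (by norm_num) (by norm_num) (by norm_num) (by norm_num) (by norm_num) (by norm_num)).trans dc5
  have ec36 : m_e 36 = _ := (f_e 36 (by norm_num) (by norm_num) (by norm_num) (by norm_num) (by norm_num) (by norm_num)).trans dc36
  have ec6 : m_e 6 = _ := (f_e 6 (by norm_num) (by norm_num) (by norm_num) (by norm_num) (by norm_num) (by norm_num)).trans dc6
  have ec34 : m_e 34 = _ := (f_e 34 (by norm_num) (by norm_num) (by norm_num) (by norm_num) (by norm_num) (by norm_num)).trans dc34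
  have ec35 : m_e 35 = _ := (f_e 35 (by norm_num) (by norm_num) (by norm_num) (by norm_num) (by norm_num) (by norm_num)).trans dc35
  have ec52 : m_e 52 = _ := (f_e 52 (by norm_num) (by norm_num) (by norm_num) (by norm_num) (by norm_num) (by norm_num)).trans dc52
  have ec53 : m_e 53 = _ := (f_e 53 (by norm_num) (by norm_num) (by norm_num) (by norm_num) (by norm_num) (by norm_num)).trans dc53
  have ec7 : m_e 7 = _ := (f_e 7 (by norm_num) (by norm_num) (by norm_num) (by norm_num) (by norm_num) (by norm_num)).trans dc7
  have ec38 : m_e 38 = _ := (f_e 38 (by norm_num) (by norm_num) (by norm_num) (by norm_num) (by norm_num) (by norm_num)).trans dc38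
  have ec8 : m_e 8 = _ := (f_e 8 (by norm_num) (by norm_num) (by norm_num) (by norm_num) (by norm_num) (by norm_num)).trans dc8
  have ec9 : m_e 9 = _ := (f_e 9 (by norm_num) (by norm_num) (by norm_num) (by norm_num) (by norm_num) (by norm_num)).trans dc9
  have ec10 : m_e 10 = _ := (f_e 10 (by norm_num) (by norm_num) (by norm_num) (by norm_num) (by norm_num) (by norm_num)).trans dc10
  have ec63 : m_e 63 = _ := (f_e 63 (by norm_num) (by norm_num) (by norm_num) (by norm_num) (by norm_num) (by norm_num)).trans d63
  have F_e : ∀ c, ¬ (7 ≤ c ∧ c ≤ 11) → c ≠ 24 → c ≠ 25 → c ≠ 34 → c ≠ 35 → c ≠ 38 → c ≠ 52 → c ≠ 53 → ¬ (60 ≤ c ∧ c ≤ 71) → m_e c = m c := fun c g1 g2 g3 g4 g5 g6 g7 g8 g9 =>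
    (f_e c (by omega) (by omega) (by omega) (by omega) (by omega) (by omega)).trans (F_d c g1 g2 g3 g4 g5 g6 g7 g8 g9)
  obtain ⟨st_f, ex_f, q_f, f69, f60, f_f⟩ := bigPre1f_spec (w := w) (O := O) hF ec36 qs
  obtain ⟨m_f, qq_f⟩ := st_f
  simp only at q_f f69 f60 f_f ex_f
  subst qq_f
  have fc5 : m_f 5 = _ := (f_f 5 (by norm_num) (by norm_num) (by norm_num)).trans ec5
  have fc36 : m_f 36 = _ := (f_f 36 (by norm_num) (by norm_num) (by norm_num)).trans ec36
  have fc6 : m_f 6 = _ := (f_f 6 (by norm_num) (by norm_num) (by norm_num)).trans ec6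
  have fc34 : m_f 34 = _ := (f_f 34 (by norm_num) (by norm_num) (by norm_num)).trans ec34
  have fc35 : m_f 35 = _ := (f_f 35 (by norm_num) (by norm_num) (by norm_num)).trans ec35
  have fc52 : m_f 52 = _ := (f_f 52 (by norm_num) (by norm_num) (by norm_num)).trans ec52
  have fc53 : m_f 53 = _ := (f_f 53 (by norm_num) (by norm_num) (by norm_num)).trans ec53
  have fc7 : m_f 7 = _ := (f_f 7 (by norm_num) (by norm_num) (by norm_num)).trans ec7
  have fc38 : m_f 38 = _ := (f_f 38 (by norm_num) (by norm_num) (by norm_num)).trans ec38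
  have fc8 : m_f 8 = _ := (f_f 8 (by norm_num) (by norm_num) (by norm_num)).trans ec8
  have fc9 : m_f 9 = _ := (f_f 9 (by norm_num) (by norm_num) (by norm_num)).trans ec9
  have fc10 : m_f 10 = _ := (f_f 10 (by norm_num) (by norm_num) (by norm_num)).trans ec10
  have fc63 : m_f 63 = _ := (f_f 63 (by norm_num) (by norm_num) (by norm_num)).trans ec63
  have fc11 : m_f 11 = _ := (f_f 11 (by norm_num) (by norm_num) (by norm_num)).trans e11
  have fc65 : m_f 65 = _ := (f_f 65 (by norm_num) (by norm_num) (by norm_num)).trans e65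
  have fc67 : m_f 67 = _ := (f_f 67 (by norm_num) (by norm_num) (by norm_num)).trans e67
  have F_f : ∀ c, ¬ (7 ≤ c ∧ c ≤ 11) → c ≠ 24 → c ≠ 25 → c ≠ 34 → c ≠ 35 → c ≠ 38 → c ≠ 52 → c ≠ 53 → ¬ (60 ≤ c ∧ c ≤ 71) → m_f c = m c := fun c g1 g2 g3 g4 g5 g6 g7 g8 g9 =>
    (f_f c (by omega) (by omega) (by omega)).trans (F_e c g1 g2 g3 g4 g5 g6 g7 g8 g9)
  obtain ⟨st_g, ex_g, q_g, g24, g25, g70, g71, g60, f_g⟩ := bigPre1g_spec (w := w) (O := O) hF fc67 f69 fc6 fc38 fc5 qs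
  obtain ⟨m_g, qq_g⟩ := st_g
  simp only at q_g g24 g25 g70 g71 g60 f_g ex_g
  subst qq_g
  have gc5 : m_g 5 = _ := (f_g 5 (by norm_num) (by norm_num) (by norm_num) (by norm_num) (by norm_num) (by norm_num) (by norm_num)).trans fc5
  have gc36 : m_g 36 = _ := (f_g 36 (by norm_num) (by norm_num) (by norm_num) (by norm_num) (by norm_num) (by norm_num) (by norm_num)).trans fc36
  have gc6 : m_g 6 = _ := (f_g 6 (by norm_num) (by norm_num) (by norm_num) (by norm_num) (by norm_num) (by norm_num) (by norm_num)).trans fc6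
  have gc34 : m_g 34 = _ := (f_g 34 (by norm_num) (by norm_num) (by norm_num) (by norm_num) (by norm_num) (by norm_num) (by norm_num)).trans fc34
  have gc35 : m_g 35 = _ := (f_g 35 (by norm_num) (by norm_num) (by norm_num) (by norm_num) (by norm_num) (by norm_num) (by norm_num)).trans fc35
  have gc52 : m_g 52 = _ := (f_g 52 (by norm_num) (by norm_num) (by norm_num) (by norm_num) (by norm_num) (by norm_num) (by norm_num)).trans fc52
  have gc53 : m_g 53 = _ := (f_g 53 (by norm_num) (by norm_num) (by norm_num) (by norm_num) (by norm_num) (by norm_num) (by norm_num)).trans fc53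
  have gc7 : m_g 7 = _ := (f_g 7 (by norm_num) (by norm_num) (by norm_num) (by norm_num) (by norm_num) (by norm_num) (by norm_num)).trans fc7
  have gc38 : m_g 38 = _ := (f_g 38 (by norm_num) (by norm_num) (by norm_num) (by norm_num) (by norm_num) (by norm_num) (by norm_num)).trans fc38
  have gc8 : m_g 8 = _ := (f_g 8 (by norm_num) (by norm_num) (by norm_num) (by norm_num) (by norm_num) (by norm_num) (by norm_num)).trans fc8
  have gc9 : m_g 9 = _ := (f_g 9 (by norm_num) (by norm_num) (by norm_num) (by norm_num) (by norm_num) (by norm_num) (by norm_num)).trans fc9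
  have gc10 : m_g 10 = _ := (f_g 10 (by norm_num) (by norm_num) (by norm_num) (by norm_num) (by norm_num) (by norm_num) (by norm_num)).trans fc10
  have gc63 : m_g 63 = _ := (f_g 63 (by norm_num) (by norm_num) (by norm_num) (by norm_num) (by norm_num) (by norm_num) (by norm_num)).trans fc63
  have gc11 : m_g 11 = _ := (f_g 11 (by norm_num) (by norm_num) (by norm_num) (by norm_num) (by norm_num) (by norm_num) (by norm_num)).trans fc11
  have gc65 : m_g 65 = _ := (f_g 65 (by norm_num) (by norm_num) (by norm_num) (by norm_num) (by norm_num) (by norm_num) (by norm_num)).trans fc65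
  have gc67 : m_g 67 = _ := (f_g 67 (by norm_num) (by norm_num) (by norm_num) (by norm_num) (by norm_num) (by norm_num) (by norm_num)).trans fc67
  have gc69 : m_g 69 = _ := (f_g 69 (by norm_num) (by norm_num) (by norm_num) (by norm_num) (by norm_num) (by norm_num) (by norm_num)).trans f69
  have F_g : ∀ c, ¬ (7 ≤ c ∧ c ≤ 11) → c ≠ 24 → c ≠ 25 → c ≠ 34 → c ≠ 35 → c ≠ 38 → c ≠ 52 → c ≠ 53 → ¬ (60 ≤ c ∧ c ≤ 71) → m_g c = m c := fun c g1 g2 g3 g4 g5 g6 g7 g8 g9 =>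
    (f_g c (by omega) (by omega) (by omega) (by omega) (by omega) (by omega) (by omega)).trans (F_f c g1 g2 g3 g4 g5 g6 g7 g8 g9)
  refine ⟨⟨m_g, qs⟩, ?_, rfl, gc34, gc35, gc52, gc53, gc7, gc38, gc8, gc9, gc10, gc11, g24, g25, gc65, g70, g71, g60, F_g⟩
  unfold bigPre1 pre1Time
  exact ex_a.seqs_cons (ex_b.seqs_cons (ex_c.seqs_cons (ex_d.seqs_cons (ex_e.seqs_cons (ex_f.seqs_cons (ExecLE.seqs_one ex_g))))))

set_option linter.unusedSimpArgs false in
set_option maxHeartbeats 2000000 in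
/-- Layout registers, first part. [folklore] -/
theorem bigB8a_spec {m : ℕ → ℕ} {K : PrattConsts} {n₀ L : ℕ} (hF : BigFits w K n₀ L)
    (h4 : m 4 = L) (h6 : m 6 = K.M n₀) (h36 : m 36 = K.r n₀) (h35 : m 35 = K.C) (qs : List (List ℕ)) :
    ∃ st', Exec w O (block (bigB8a K)) ⟨m, qs⟩ st' 10 ∧ st'.queries = qs ∧
      st'.mem 15 = L * 2 + 202 ∧
      st'.mem 30 = L * 2 + 202 ∧
      st'.mem 31 = L * 2 + 202 + K.M n₀ ∧
      st'.mem 33 = L * 2 + 202 + K.M n₀ + K.M n₀ ∧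
      st'.mem 32 = L * 2 + 202 + K.M n₀ + K.M n₀ + K.r n₀ * K.C ∧
      st'.mem 39 = L * 2 + 202 + K.M n₀ + K.M n₀ + K.r n₀ * K.C + K.C * K.tk ∧
      st'.mem 49 = 1 * 2 ^ K.M n₀ ∧
      st'.mem 23 = L * 2 + 202 + K.M n₀ + K.M n₀ + K.r n₀ * K.C + K.C * K.tk + 1 * 2 ^ K.M n₀ ∧
      (∀ c, c ≠ 15 → c ≠ 23 → c ≠ 30 → c ≠ 31 → c ≠ 32 → c ≠ 33 → c ≠ 39 → c ≠ 49 → c ≠ 59 → st'.mem c = m c) := by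
  obtain ⟨btk, bC, bN, bR, bB, bCC1, br, bq, bNtot, bNq, bRq, bBq, bG, bn, bQ, bcoins, bRC, bMw, bM1,
    hNtot, bds, boff, b2M⟩ := hF.bounds
  have hcp := hF.hcp
  have hcp0def : K.cp0 n₀ L = L * 2 + 202 + K.M n₀ + K.M n₀ + K.r n₀ * K.C + K.C * K.tk + 3 * 2 ^ K.M n₀ +
      3 * (K.R * K.N) + 2 * K.G n₀ + K.G n₀ := rfl
  have hw2 : w < 2 ^ w := Nat.lt_two_pow_self
  obtain ⟨_, _, hn1, _, hM3, _⟩ := K.params_basic n₀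
  have h2d1 : 1 ≤ 2 ^ (K.n n₀ - n₀) := Nat.one_le_two_pow
  have hpmw : (1 * 2 ^ (K.n n₀ - n₀) - 1) * 2 ^ (n₀ * 3) * 2 ^ (K.n n₀ - n₀) * 2 ^ (K.n n₀ - n₀) < 2 ^ w := by
    have hn₀ := hF.hn₀
    have hA : 0 < 2 ^ (n₀ * 3) * (2 ^ (K.n n₀ - n₀) * 2 ^ (K.n n₀ - n₀)) := by positivity
    rw [Nat.mul_assoc, Nat.mul_assoc]
    calc (1 * 2 ^ (K.n n₀ - n₀) - 1) * (2 ^ (n₀ * 3) * (2 ^ (K.n n₀ - n₀) * 2 ^ (K.n n₀ - n₀)))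
        < 2 ^ (K.n n₀ - n₀) * (2 ^ (n₀ * 3) * (2 ^ (K.n n₀ - n₀) * 2 ^ (K.n n₀ - n₀))) :=
          Nat.mul_lt_mul_of_pos_right (by omega) hA
      _ = 2 ^ (K.n n₀ - n₀ + n₀ * 3 + (K.n n₀ - n₀) + (K.n n₀ - n₀)) := by rw [pow_add, pow_add, pow_add]; ring
      _ ≤ 2 ^ w := Nat.pow_le_pow_right (by norm_num) (by omega)
  have hpm2 : 2 ^ (n₀ * 3) * 2 ^ (K.n n₀ - n₀) * 2 ^ (K.n n₀ - n₀) ≥ 1 :=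
    Nat.mul_pos (Nat.mul_pos (Nat.two_pow_pos _) (Nat.two_pow_pos _)) (Nat.two_pow_pos _)
  have hpm1w : (1 * 2 ^ (K.n n₀ - n₀) - 1) * 2 ^ (n₀ * 3) * 2 ^ (K.n n₀ - n₀) < 2 ^ w :=
    lt_of_le_of_lt (Nat.le_mul_of_pos_right _ (Nat.two_pow_pos _)) hpmw
  have hpm0w : (1 * 2 ^ (K.n n₀ - n₀) - 1) * 2 ^ (n₀ * 3) < 2 ^ w :=
    lt_of_le_of_lt (Nat.le_mul_of_pos_right _ (Nat.two_pow_pos _)) hpm1w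
  have h55w : 1 * 2 ^ (K.n n₀ - n₀) < 2 ^ w := by
    rw [one_mul]
    exact Nat.pow_lt_pow_right (by norm_num) (by omega)
  suffices hh : ∃ st', Exec w O (block (bigB8a K)) ⟨m, qs⟩ st' 10 ∧ (st'.queries = qs ∧
      st'.mem 15 = L * 2 + 202 ∧
      st'.mem 30 = L * 2 + 202 ∧
      st'.mem 31 = L * 2 + 202 + K.M n₀ ∧
      st'.mem 33 = L * 2 + 202 + K.M n₀ + K.M n₀ ∧
      st'.mem 32 = L * 2 + 202 + K.M n₀ + K.M n₀ + K.r n₀ * K.C ∧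
      st'.mem 39 = L * 2 + 202 + K.M n₀ + K.M n₀ + K.r n₀ * K.C + K.C * K.tk ∧
      st'.mem 49 = 1 * 2 ^ K.M n₀ ∧
      st'.mem 23 = L * 2 + 202 + K.M n₀ + K.M n₀ + K.r n₀ * K.C + K.C * K.tk + 1 * 2 ^ K.M n₀ ∧
      (∀ c, c ≠ 15 → c ≠ 23 → c ≠ 30 → c ≠ 31 → c ≠ 32 → c ≠ 33 → c ≠ 39 → c ≠ 49 → c ≠ 59 → st'.mem c = m c)) by
    obtain ⟨st', h1, h2⟩ := hh; exact ⟨st', h1, h2⟩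
  refine Exec.block_of_fwd (bigB8a K) qs fun Rf hRf => ?_
  unfold bigB8a at hRf
  have htmp := execOps_cons_fwd hRf; clear hRf; obtain ⟨v1, hv1, hRf⟩ := htmp
  simp -failIfUnchanged (disch := omega) only [Operand.write, Operand.read, Function.update_self, Function.update_of_ne, BinOp.eval_add_mod', BinOp.eval_mul_mod', Nat.mod_eq_of_lt, BinOp.eval_sub_of_le, BinOp.eval_div, BinOp.eval_lt, BinOp.eval_shl_of_lt, Nat.add_zero, Nat.zero_add, h4, h6, h36, h35] at hv1 hRf
  subst v1
  have htmp := execOps_cons_fwd hRf; clear hRf; obtain ⟨v2, hv2, hRf⟩ := htmp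
  simp -failIfUnchanged (disch := omega) only [Operand.write, Operand.read, Function.update_self, Function.update_of_ne, BinOp.eval_add_mod', BinOp.eval_mul_mod', Nat.mod_eq_of_lt, BinOp.eval_sub_of_le, BinOp.eval_div, BinOp.eval_lt, BinOp.eval_shl_of_lt, Nat.add_zero, Nat.zero_add, h4, h6, h36, h35] at hv2 hRf
  subst v2
  have htmp := execOps_cons_fwd hRf; clear hRf; obtain ⟨v3, hv3, hRf⟩ := htmp
  simp -failIfUnchanged (disch := omega) only [Operand.write, Operand.read, Function.update_self, Function.update_of_ne, BinOp.eval_add_mod', BinOp.eval_mul_mod', Nat.mod_eq_of_lt, BinOp.eval_sub_of_le, BinOp.eval_div, BinOp.eval_lt, BinOp.eval_shl_of_lt, Nat.add_zero, Nat.zero_add, h4, h6, h36, h35] at hv3 hRf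
  subst v3
  have htmp := execOps_cons_fwd hRf; clear hRf; obtain ⟨v4, hv4, hRf⟩ := htmp
  simp -failIfUnchanged (disch := omega) only [Operand.write, Operand.read, Function.update_self, Function.update_of_ne, BinOp.eval_add_mod', BinOp.eval_mul_mod', Nat.mod_eq_of_lt, BinOp.eval_sub_of_le, BinOp.eval_div, BinOp.eval_lt, BinOp.eval_shl_of_lt, Nat.add_zero, Nat.zero_add, h4, h6, h36, h35] at hv4 hRf
  subst v4
  have htmp := execOps_cons_fwd hRf; clear hRf; obtain ⟨v5, hv5, hRf⟩ := htmp
  simp -failIfUnchanged (disch := omega) only [Operand.write, Operand.read, Function.update_self, Function.update_of_ne, BinOp.eval_add_mod', BinOp.eval_mul_mod', Nat.mod_eq_of_lt, BinOp.eval_sub_of_le, BinOp.eval_div, BinOp.eval_lt, BinOp.eval_shl_of_lt, Nat.add_zero, Nat.zero_add, h4, h6, h36, h35] at hv5 hRf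
  subst v5
  have htmp := execOps_cons_fwd hRf; clear hRf; obtain ⟨v6, hv6, hRf⟩ := htmp
  simp -failIfUnchanged (disch := omega) only [Operand.write, Operand.read, Function.update_self, Function.update_of_ne, BinOp.eval_add_mod', BinOp.eval_mul_mod', Nat.mod_eq_of_lt, BinOp.eval_sub_of_le, BinOp.eval_div, BinOp.eval_lt, BinOp.eval_shl_of_lt, Nat.add_zero, Nat.zero_add, h4, h6, h36, h35] at hv6 hRf
  subst v6
  have htmp := execOps_cons_fwd hRf; clear hRf; obtain ⟨v7, hv7, hRf⟩ := htmp
  simp -failIfUnchanged (disch := omega) only [Operand.write, Operand.read, Function.update_self, Function.update_of_ne, BinOp.eval_add_mod', BinOp.eval_mul_mod', Nat.mod_eq_of_lt, BinOp.eval_sub_of_le, BinOp.eval_div, BinOp.eval_lt, BinOp.eval_shl_of_lt, Nat.add_zero, Nat.zero_add, h4, h6, h36, h35] at hv7 hRf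
  subst v7
  have htmp := execOps_cons_fwd hRf; clear hRf; obtain ⟨v8, hv8, hRf⟩ := htmp
  simp -failIfUnchanged (disch := omega) only [Operand.write, Operand.read, Function.update_self, Function.update_of_ne, BinOp.eval_add_mod', BinOp.eval_mul_mod', Nat.mod_eq_of_lt, BinOp.eval_sub_of_le, BinOp.eval_div, BinOp.eval_lt, BinOp.eval_shl_of_lt, Nat.add_zero, Nat.zero_add, h4, h6, h36, h35] at hv8 hRf
  subst v8
  have htmp := execOps_cons_fwd hRf; clear hRf; obtain ⟨v9, hv9, hRf⟩ := htmp
  simp -failIfUnchanged (disch := omega) only [Operand.write, Operand.read, Function.update_self, Function.update_of_ne, BinOp.eval_add_mod', BinOp.eval_mul_mod', Nat.mod_eq_of_lt, BinOp.eval_sub_of_le, BinOp.eval_div, BinOp.eval_lt, BinOp.eval_shl_of_lt, Nat.add_zero, Nat.zero_add, h4, h6, h36, h35] at hv9 hRf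
  subst v9
  have htmp := execOps_cons_fwd hRf; clear hRf; obtain ⟨v10, hv10, hRf⟩ := htmp
  simp -failIfUnchanged (disch := omega) only [Operand.write, Operand.read, Function.update_self, Function.update_of_ne, BinOp.eval_add_mod', BinOp.eval_mul_mod', Nat.mod_eq_of_lt, BinOp.eval_sub_of_le, BinOp.eval_div, BinOp.eval_lt, BinOp.eval_shl_of_lt, Nat.add_zero, Nat.zero_add, h4, h6, h36, h35] at hv10 hRf
  subst v10
  simp only [execOps_nil] at hRf
  subst hRf
  refine ⟨rfl, ?_, ?_, ?_, ?_, ?_, ?_, ?_, ?_, fun c hc0 hc1 hc2 hc3 hc4 hc5 hc6 hc7 hc8 => ?_⟩ <;> dsimp only <;>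
    (simp (disch := omega) only [Function.update_of_ne, Function.update_self, h4, h6, h36, h35]; try rfl)

set_option linter.unusedSimpArgs false in
set_option maxHeartbeats 2000000 in
/-- Layout registers, second part. [folklore] -/
theorem bigB8b_spec {m : ℕ → ℕ} {K : PrattConsts} {n₀ L : ℕ} (hF : BigFits w K n₀ L)
    (h23 : m 23 = L * 2 + 202 + K.M n₀ + K.M n₀ + K.r n₀ * K.C + K.C * K.tk + 1 * 2 ^ K.M n₀) (h49 : m 49 = 1 * 2 ^ K.M n₀) (h11 : m 11 = K.G n₀) (h60 : m 60 = K.off n₀) (qs : List (List ℕ)) :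
    ∃ st', Exec w O (block (bigB8b K)) ⟨m, qs⟩ st' 11 ∧ st'.queries = qs ∧
      st'.mem 19 = L * 2 + 202 + K.M n₀ + K.M n₀ + K.r n₀ * K.C + K.C * K.tk + 1 * 2 ^ K.M n₀ + 1 * 2 ^ K.M n₀ ∧
      st'.mem 12 = L * 2 + 202 + K.M n₀ + K.M n₀ + K.r n₀ * K.C + K.C * K.tk + 1 * 2 ^ K.M n₀ + 1 * 2 ^ K.M n₀ + 1 * 2 ^ K.M n₀ ∧
      st'.mem 13 = L * 2 + 202 + K.M n₀ + K.M n₀ + K.r n₀ * K.C + K.C * K.tk + 1 * 2 ^ K.M n₀ + 1 * 2 ^ K.M n₀ + 1 * 2 ^ K.M n₀ + K.R * K.N ∧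
      st'.mem 14 = L * 2 + 202 + K.M n₀ + K.M n₀ + K.r n₀ * K.C + K.C * K.tk + 1 * 2 ^ K.M n₀ + 1 * 2 ^ K.M n₀ + 1 * 2 ^ K.M n₀ + K.R * K.N + K.R * K.N ∧
      st'.mem 16 = L * 2 + 202 + K.M n₀ + K.M n₀ + K.r n₀ * K.C + K.C * K.tk + 1 * 2 ^ K.M n₀ + 1 * 2 ^ K.M n₀ + 1 * 2 ^ K.M n₀ + K.R * K.N + K.R * K.N + K.R * K.N ∧
      st'.mem 17 = L * 2 + 202 + K.M n₀ + K.M n₀ + K.r n₀ * K.C + K.C * K.tk + 1 * 2 ^ K.M n₀ + 1 * 2 ^ K.M n₀ + 1 * 2 ^ K.M n₀ + K.R * K.N + K.R * K.N + K.R * K.N + K.G n₀ ∧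
      st'.mem 18 = L * 2 + 202 + K.M n₀ + K.M n₀ + K.r n₀ * K.C + K.C * K.tk + 1 * 2 ^ K.M n₀ + 1 * 2 ^ K.M n₀ + 1 * 2 ^ K.M n₀ + K.R * K.N + K.R * K.N + K.R * K.N + K.G n₀ + K.G n₀ ∧
      st'.mem 80 = L * 2 + 202 + K.M n₀ + K.M n₀ + K.r n₀ * K.C + K.C * K.tk + 1 * 2 ^ K.M n₀ + 1 * 2 ^ K.M n₀ + 1 * 2 ^ K.M n₀ + K.R * K.N + K.R * K.N + K.R * K.N + K.G n₀ + K.G n₀ + K.G n₀ ∧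
      st'.mem 99 = L * 2 + 202 + K.M n₀ + K.M n₀ + K.r n₀ * K.C + K.C * K.tk + 1 * 2 ^ K.M n₀ + 1 * 2 ^ K.M n₀ + 1 * 2 ^ K.M n₀ + K.R * K.N + K.R * K.N + K.R * K.N + K.G n₀ + K.G n₀ + K.G n₀ ∧
      st'.mem 20 = L * 2 + 202 + K.M n₀ + K.M n₀ + K.r n₀ * K.C + K.C * K.tk + 1 * 2 ^ K.M n₀ + 1 * 2 ^ K.M n₀ + 1 * 2 ^ K.M n₀ + K.R * K.N + K.R * K.N + K.R * K.N + K.off n₀ ∧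
      st'.mem 21 = L * 2 + 202 + K.M n₀ + K.M n₀ + K.r n₀ * K.C + K.C * K.tk + 1 * 2 ^ K.M n₀ + 1 * 2 ^ K.M n₀ + 1 * 2 ^ K.M n₀ + K.R * K.N + K.R * K.N + K.R * K.N + K.G n₀ + K.off n₀ ∧
      (∀ c, c ≠ 12 → c ≠ 13 → c ≠ 14 → c ≠ 16 → c ≠ 17 → c ≠ 18 → c ≠ 19 → c ≠ 20 → c ≠ 21 → c ≠ 80 → c ≠ 99 → st'.mem c = m c) := by
  obtain ⟨btk, bC, bN, bR, bB, bCC1, br, bq, bNtot, bNq, bRq, bBq, bG, bn, bQ, bcoins, bRC, bMw, bM1,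
    hNtot, bds, boff, b2M⟩ := hF.bounds
  have hcp := hF.hcp
  have hcp0def : K.cp0 n₀ L = L * 2 + 202 + K.M n₀ + K.M n₀ + K.r n₀ * K.C + K.C * K.tk + 3 * 2 ^ K.M n₀ +
      3 * (K.R * K.N) + 2 * K.G n₀ + K.G n₀ := rfl
  have hw2 : w < 2 ^ w := Nat.lt_two_pow_self
  obtain ⟨_, _, hn1, _, hM3, _⟩ := K.params_basic n₀
  have h2d1 : 1 ≤ 2 ^ (K.n n₀ - n₀) := Nat.one_le_two_pow
  have hpmw : (1 * 2 ^ (K.n n₀ - n₀) - 1) * 2 ^ (n₀ * 3) * 2 ^ (K.n n₀ - n₀) * 2 ^ (K.n n₀ - n₀) < 2 ^ w := by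
    have hn₀ := hF.hn₀
    have hA : 0 < 2 ^ (n₀ * 3) * (2 ^ (K.n n₀ - n₀) * 2 ^ (K.n n₀ - n₀)) := by positivity
    rw [Nat.mul_assoc, Nat.mul_assoc]
    calc (1 * 2 ^ (K.n n₀ - n₀) - 1) * (2 ^ (n₀ * 3) * (2 ^ (K.n n₀ - n₀) * 2 ^ (K.n n₀ - n₀)))
        < 2 ^ (K.n n₀ - n₀) * (2 ^ (n₀ * 3) * (2 ^ (K.n n₀ - n₀) * 2 ^ (K.n n₀ - n₀))) :=
          Nat.mul_lt_mul_of_pos_right (by omega) hA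
      _ = 2 ^ (K.n n₀ - n₀ + n₀ * 3 + (K.n n₀ - n₀) + (K.n n₀ - n₀)) := by rw [pow_add, pow_add, pow_add]; ring
      _ ≤ 2 ^ w := Nat.pow_le_pow_right (by norm_num) (by omega)
  have hpm2 : 2 ^ (n₀ * 3) * 2 ^ (K.n n₀ - n₀) * 2 ^ (K.n n₀ - n₀) ≥ 1 :=
    Nat.mul_pos (Nat.mul_pos (Nat.two_pow_pos _) (Nat.two_pow_pos _)) (Nat.two_pow_pos _)
  have hpm1w : (1 * 2 ^ (K.n n₀ - n₀) - 1) * 2 ^ (n₀ * 3) * 2 ^ (K.n n₀ - n₀) < 2 ^ w :=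
    lt_of_le_of_lt (Nat.le_mul_of_pos_right _ (Nat.two_pow_pos _)) hpmw
  have hpm0w : (1 * 2 ^ (K.n n₀ - n₀) - 1) * 2 ^ (n₀ * 3) < 2 ^ w :=
    lt_of_le_of_lt (Nat.le_mul_of_pos_right _ (Nat.two_pow_pos _)) hpm1w
  have h55w : 1 * 2 ^ (K.n n₀ - n₀) < 2 ^ w := by
    rw [one_mul]
    exact Nat.pow_lt_pow_right (by norm_num) (by omega)
  suffices hh : ∃ st', Exec w O (block (bigB8b K)) ⟨m, qs⟩ st' 11 ∧ (st'.queries = qs ∧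
      st'.mem 19 = L * 2 + 202 + K.M n₀ + K.M n₀ + K.r n₀ * K.C + K.C * K.tk + 1 * 2 ^ K.M n₀ + 1 * 2 ^ K.M n₀ ∧
      st'.mem 12 = L * 2 + 202 + K.M n₀ + K.M n₀ + K.r n₀ * K.C + K.C * K.tk + 1 * 2 ^ K.M n₀ + 1 * 2 ^ K.M n₀ + 1 * 2 ^ K.M n₀ ∧
      st'.mem 13 = L * 2 + 202 + K.M n₀ + K.M n₀ + K.r n₀ * K.C + K.C * K.tk + 1 * 2 ^ K.M n₀ + 1 * 2 ^ K.M n₀ + 1 * 2 ^ K.M n₀ + K.R * K.N ∧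
      st'.mem 14 = L * 2 + 202 + K.M n₀ + K.M n₀ + K.r n₀ * K.C + K.C * K.tk + 1 * 2 ^ K.M n₀ + 1 * 2 ^ K.M n₀ + 1 * 2 ^ K.M n₀ + K.R * K.N + K.R * K.N ∧
      st'.mem 16 = L * 2 + 202 + K.M n₀ + K.M n₀ + K.r n₀ * K.C + K.C * K.tk + 1 * 2 ^ K.M n₀ + 1 * 2 ^ K.M n₀ + 1 * 2 ^ K.M n₀ + K.R * K.N + K.R * K.N + K.R * K.N ∧
      st'.mem 17 = L * 2 + 202 + K.M n₀ + K.M n₀ + K.r n₀ * K.C + K.C * K.tk + 1 * 2 ^ K.M n₀ + 1 * 2 ^ K.M n₀ + 1 * 2 ^ K.M n₀ + K.R * K.N + K.R * K.N + K.R * K.N + K.G n₀ ∧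
      st'.mem 18 = L * 2 + 202 + K.M n₀ + K.M n₀ + K.r n₀ * K.C + K.C * K.tk + 1 * 2 ^ K.M n₀ + 1 * 2 ^ K.M n₀ + 1 * 2 ^ K.M n₀ + K.R * K.N + K.R * K.N + K.R * K.N + K.G n₀ + K.G n₀ ∧
      st'.mem 80 = L * 2 + 202 + K.M n₀ + K.M n₀ + K.r n₀ * K.C + K.C * K.tk + 1 * 2 ^ K.M n₀ + 1 * 2 ^ K.M n₀ + 1 * 2 ^ K.M n₀ + K.R * K.N + K.R * K.N + K.R * K.N + K.G n₀ + K.G n₀ + K.G n₀ ∧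
      st'.mem 99 = L * 2 + 202 + K.M n₀ + K.M n₀ + K.r n₀ * K.C + K.C * K.tk + 1 * 2 ^ K.M n₀ + 1 * 2 ^ K.M n₀ + 1 * 2 ^ K.M n₀ + K.R * K.N + K.R * K.N + K.R * K.N + K.G n₀ + K.G n₀ + K.G n₀ ∧
      st'.mem 20 = L * 2 + 202 + K.M n₀ + K.M n₀ + K.r n₀ * K.C + K.C * K.tk + 1 * 2 ^ K.M n₀ + 1 * 2 ^ K.M n₀ + 1 * 2 ^ K.M n₀ + K.R * K.N + K.R * K.N + K.R * K.N + K.off n₀ ∧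
      st'.mem 21 = L * 2 + 202 + K.M n₀ + K.M n₀ + K.r n₀ * K.C + K.C * K.tk + 1 * 2 ^ K.M n₀ + 1 * 2 ^ K.M n₀ + 1 * 2 ^ K.M n₀ + K.R * K.N + K.R * K.N + K.R * K.N + K.G n₀ + K.off n₀ ∧
      (∀ c, c ≠ 12 → c ≠ 13 → c ≠ 14 → c ≠ 16 → c ≠ 17 → c ≠ 18 → c ≠ 19 → c ≠ 20 → c ≠ 21 → c ≠ 80 → c ≠ 99 → st'.mem c = m c)) by
    obtain ⟨st', h1, h2⟩ := hh; exact ⟨st', h1, h2⟩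
  refine Exec.block_of_fwd (bigB8b K) qs fun Rf hRf => ?_
  unfold bigB8b at hRf
  have htmp := execOps_cons_fwd hRf; clear hRf; obtain ⟨v1, hv1, hRf⟩ := htmp
  simp -failIfUnchanged (disch := omega) only [Operand.write, Operand.read, Function.update_self, Function.update_of_ne, BinOp.eval_add_mod', BinOp.eval_mul_mod', Nat.mod_eq_of_lt, BinOp.eval_sub_of_le, BinOp.eval_div, BinOp.eval_lt, BinOp.eval_shl_of_lt, Nat.add_zero, Nat.zero_add, h23, h49, h11, h60] at hv1 hRf
  subst v1
  have htmp := execOps_cons_fwd hRf; clear hRf; obtain ⟨v2, hv2, hRf⟩ := htmp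
  simp -failIfUnchanged (disch := omega) only [Operand.write, Operand.read, Function.update_self, Function.update_of_ne, BinOp.eval_add_mod', BinOp.eval_mul_mod', Nat.mod_eq_of_lt, BinOp.eval_sub_of_le, BinOp.eval_div, BinOp.eval_lt, BinOp.eval_shl_of_lt, Nat.add_zero, Nat.zero_add, h23, h49, h11, h60] at hv2 hRf
  subst v2
  have htmp := execOps_cons_fwd hRf; clear hRf; obtain ⟨v3, hv3, hRf⟩ := htmp
  simp -failIfUnchanged (disch := omega) only [Operand.write, Operand.read, Function.update_self, Function.update_of_ne, BinOp.eval_add_mod', BinOp.eval_mul_mod', Nat.mod_eq_of_lt, BinOp.eval_sub_of_le, BinOp.eval_div, BinOp.eval_lt, BinOp.eval_shl_of_lt, Nat.add_zero, Nat.zero_add, h23, h49, h11, h60] at hv3 hRf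
  subst v3
  have htmp := execOps_cons_fwd hRf; clear hRf; obtain ⟨v4, hv4, hRf⟩ := htmp
  simp -failIfUnchanged (disch := omega) only [Operand.write, Operand.read, Function.update_self, Function.update_of_ne, BinOp.eval_add_mod', BinOp.eval_mul_mod', Nat.mod_eq_of_lt, BinOp.eval_sub_of_le, BinOp.eval_div, BinOp.eval_lt, BinOp.eval_shl_of_lt, Nat.add_zero, Nat.zero_add, h23, h49, h11, h60] at hv4 hRf
  subst v4
  have htmp := execOps_cons_fwd hRf; clear hRf; obtain ⟨v5, hv5, hRf⟩ := htmp
  simp -failIfUnchanged (disch := omega) only [Operand.write, Operand.read, Function.update_self, Function.update_of_ne, BinOp.eval_add_mod', BinOp.eval_mul_mod', Nat.mod_eq_of_lt, BinOp.eval_sub_of_le, BinOp.eval_div, BinOp.eval_lt, BinOp.eval_shl_of_lt, Nat.add_zero, Nat.zero_add, h23, h49, h11, h60] at hv5 hRf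
  subst v5
  have htmp := execOps_cons_fwd hRf; clear hRf; obtain ⟨v6, hv6, hRf⟩ := htmp
  simp -failIfUnchanged (disch := omega) only [Operand.write, Operand.read, Function.update_self, Function.update_of_ne, BinOp.eval_add_mod', BinOp.eval_mul_mod', Nat.mod_eq_of_lt, BinOp.eval_sub_of_le, BinOp.eval_div, BinOp.eval_lt, BinOp.eval_shl_of_lt, Nat.add_zero, Nat.zero_add, h23, h49, h11, h60] at hv6 hRf
  subst v6
  have htmp := execOps_cons_fwd hRf; clear hRf; obtain ⟨v7, hv7, hRf⟩ := htmp
  simp -failIfUnchanged (disch := omega) only [Operand.write, Operand.read, Function.update_self, Function.update_of_ne, BinOp.eval_add_mod', BinOp.eval_mul_mod', Nat.mod_eq_of_lt, BinOp.eval_sub_of_le, BinOp.eval_div, BinOp.eval_lt, BinOp.eval_shl_of_lt, Nat.add_zero, Nat.zero_add, h23, h49, h11, h60] at hv7 hRf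
  subst v7
  have htmp := execOps_cons_fwd hRf; clear hRf; obtain ⟨v8, hv8, hRf⟩ := htmp
  simp -failIfUnchanged (disch := omega) only [Operand.write, Operand.read, Function.update_self, Function.update_of_ne, BinOp.eval_add_mod', BinOp.eval_mul_mod', Nat.mod_eq_of_lt, BinOp.eval_sub_of_le, BinOp.eval_div, BinOp.eval_lt, BinOp.eval_shl_of_lt, Nat.add_zero, Nat.zero_add, h23, h49, h11, h60] at hv8 hRf
  subst v8
  have htmp := execOps_cons_fwd hRf; clear hRf; obtain ⟨v9, hv9, hRf⟩ := htmp
  simp -failIfUnchanged (disch := omega) only [Operand.write, Operand.read, Function.update_self, Function.update_of_ne, BinOp.eval_add_mod', BinOp.eval_mul_mod', Nat.mod_eq_of_lt, BinOp.eval_sub_of_le, BinOp.eval_div, BinOp.eval_lt, BinOp.eval_shl_of_lt, Nat.add_zero, Nat.zero_add, h23, h49, h11, h60] at hv9 hRf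
  subst v9
  have htmp := execOps_cons_fwd hRf; clear hRf; obtain ⟨v10, hv10, hRf⟩ := htmp
  simp -failIfUnchanged (disch := omega) only [Operand.write, Operand.read, Function.update_self, Function.update_of_ne, BinOp.eval_add_mod', BinOp.eval_mul_mod', Nat.mod_eq_of_lt, BinOp.eval_sub_of_le, BinOp.eval_div, BinOp.eval_lt, BinOp.eval_shl_of_lt, Nat.add_zero, Nat.zero_add, h23, h49, h11, h60] at hv10 hRf
  subst v10
  have htmp := execOps_cons_fwd hRf; clear hRf; obtain ⟨v11, hv11, hRf⟩ := htmp
  simp -failIfUnchanged (disch := omega) only [Operand.write, Operand.read, Function.update_self, Function.update_of_ne, BinOp.eval_add_mod', BinOp.eval_mul_mod', Nat.mod_eq_of_lt, BinOp.eval_sub_of_le, BinOp.eval_div, BinOp.eval_lt, BinOp.eval_shl_of_lt, Nat.add_zero, Nat.zero_add, h23, h49, h11, h60] at hv11 hRf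
  subst v11
  simp only [execOps_nil] at hRf
  subst hRf
  refine ⟨rfl, ?_, ?_, ?_, ?_, ?_, ?_, ?_, ?_, ?_, ?_, ?_, fun c hc0 hc1 hc2 hc3 hc4 hc5 hc6 hc7 hc8 hc9 hc10 => ?_⟩ <;> dsimp only <;>
    (simp (disch := omega) only [Function.update_of_ne, Function.update_self, h23, h49, h11, h60]; try rfl)

set_option linter.unusedSimpArgs false in
set_option maxHeartbeats 2000000 in
/-- Layout registers, third part: level bases, coin count, flag, pad masks, table pointer. [folklore] -/
theorem bigB8c_spec {m : ℕ → ℕ} {K : PrattConsts} {n₀ L : ℕ} (hF : BigFits w K n₀ L)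
    (h18 : m 18 = L * 2 + 202 + K.M n₀ + K.M n₀ + K.r n₀ * K.C + K.C * K.tk + 1 * 2 ^ K.M n₀ + 1 * 2 ^ K.M n₀ + 1 * 2 ^ K.M n₀ + K.R * K.N + K.R * K.N + K.R * K.N + K.G n₀ + K.G n₀) (h60 : m 60 = K.off n₀) (h71 : m 71 = K.RC n₀) (h65 : m 65 = K.n n₀) (h3 : m 3 = n₀) (h32 : m 32 = L * 2 + 202 + K.M n₀ + K.M n₀ + K.r n₀ * K.C) (qs : List (List ℕ)) :
    ∃ st', Exec w O (block (bigB8c)) ⟨m, qs⟩ st' 11 ∧ st'.queries = qs ∧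
      st'.mem 48 = L * 2 + 202 + K.M n₀ + K.M n₀ + K.r n₀ * K.C + K.C * K.tk + 1 * 2 ^ K.M n₀ + 1 * 2 ^ K.M n₀ + 1 * 2 ^ K.M n₀ + K.R * K.N + K.R * K.N + K.R * K.N + K.G n₀ + K.G n₀ + K.off n₀ ∧
      st'.mem 98 = K.RC n₀ ∧
      st'.mem 81 = 0 ∧
      st'.mem 54 = (K.n n₀ - n₀) ∧
      st'.mem 27 = (1 * 2 ^ (K.n n₀ - n₀) - 1) * 2 ^ (n₀ * 3) ∧
      st'.mem 28 = (1 * 2 ^ (K.n n₀ - n₀) - 1) * 2 ^ (n₀ * 3) * 2 ^ (K.n n₀ - n₀) ∧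
      st'.mem 29 = (1 * 2 ^ (K.n n₀ - n₀) - 1) * 2 ^ (n₀ * 3) * 2 ^ (K.n n₀ - n₀) * 2 ^ (K.n n₀ - n₀) ∧
      st'.mem 60 = L * 2 + 202 + K.M n₀ + K.M n₀ + K.r n₀ * K.C ∧
      (∀ c, c ≠ 27 → c ≠ 28 → c ≠ 29 → c ≠ 48 → c ≠ 54 → c ≠ 55 → c ≠ 56 → c ≠ 60 → c ≠ 81 → c ≠ 98 → st'.mem c = m c) := by
  obtain ⟨btk, bC, bN, bR, bB, bCC1, br, bq, bNtot, bNq, bRq, bBq, bG, bn, bQ, bcoins, bRC, bMw, bM1,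
    hNtot, bds, boff, b2M⟩ := hF.bounds
  have hcp := hF.hcp
  have hcp0def : K.cp0 n₀ L = L * 2 + 202 + K.M n₀ + K.M n₀ + K.r n₀ * K.C + K.C * K.tk + 3 * 2 ^ K.M n₀ +
      3 * (K.R * K.N) + 2 * K.G n₀ + K.G n₀ := rfl
  have hw2 : w < 2 ^ w := Nat.lt_two_pow_self
  obtain ⟨_, _, hn1, _, hM3, _⟩ := K.params_basic n₀
  have h2d1 : 1 ≤ 2 ^ (K.n n₀ - n₀) := Nat.one_le_two_pow
  have hpmw : (1 * 2 ^ (K.n n₀ - n₀) - 1) * 2 ^ (n₀ * 3) * 2 ^ (K.n n₀ - n₀) * 2 ^ (K.n n₀ - n₀) < 2 ^ w := by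
    have hn₀ := hF.hn₀
    have hA : 0 < 2 ^ (n₀ * 3) * (2 ^ (K.n n₀ - n₀) * 2 ^ (K.n n₀ - n₀)) := by positivity
    rw [Nat.mul_assoc, Nat.mul_assoc]
    calc (1 * 2 ^ (K.n n₀ - n₀) - 1) * (2 ^ (n₀ * 3) * (2 ^ (K.n n₀ - n₀) * 2 ^ (K.n n₀ - n₀)))
        < 2 ^ (K.n n₀ - n₀) * (2 ^ (n₀ * 3) * (2 ^ (K.n n₀ - n₀) * 2 ^ (K.n n₀ - n₀))) :=
          Nat.mul_lt_mul_of_pos_right (by omega) hA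
      _ = 2 ^ (K.n n₀ - n₀ + n₀ * 3 + (K.n n₀ - n₀) + (K.n n₀ - n₀)) := by rw [pow_add, pow_add, pow_add]; ring
      _ ≤ 2 ^ w := Nat.pow_le_pow_right (by norm_num) (by omega)
  have hpm2 : 2 ^ (n₀ * 3) * 2 ^ (K.n n₀ - n₀) * 2 ^ (K.n n₀ - n₀) ≥ 1 :=
    Nat.mul_pos (Nat.mul_pos (Nat.two_pow_pos _) (Nat.two_pow_pos _)) (Nat.two_pow_pos _)
  have hpm1w : (1 * 2 ^ (K.n n₀ - n₀) - 1) * 2 ^ (n₀ * 3) * 2 ^ (K.n n₀ - n₀) < 2 ^ w :=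
    lt_of_le_of_lt (Nat.le_mul_of_pos_right _ (Nat.two_pow_pos _)) hpmw
  have hpm0w : (1 * 2 ^ (K.n n₀ - n₀) - 1) * 2 ^ (n₀ * 3) < 2 ^ w :=
    lt_of_le_of_lt (Nat.le_mul_of_pos_right _ (Nat.two_pow_pos _)) hpm1w
  have h55w : 1 * 2 ^ (K.n n₀ - n₀) < 2 ^ w := by
    rw [one_mul]
    exact Nat.pow_lt_pow_right (by norm_num) (by omega)
  suffices hh : ∃ st', Exec w O (block (bigB8c)) ⟨m, qs⟩ st' 11 ∧ (st'.queries = qs ∧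
      st'.mem 48 = L * 2 + 202 + K.M n₀ + K.M n₀ + K.r n₀ * K.C + K.C * K.tk + 1 * 2 ^ K.M n₀ + 1 * 2 ^ K.M n₀ + 1 * 2 ^ K.M n₀ + K.R * K.N + K.R * K.N + K.R * K.N + K.G n₀ + K.G n₀ + K.off n₀ ∧
      st'.mem 98 = K.RC n₀ ∧
      st'.mem 81 = 0 ∧
      st'.mem 54 = (K.n n₀ - n₀) ∧
      st'.mem 27 = (1 * 2 ^ (K.n n₀ - n₀) - 1) * 2 ^ (n₀ * 3) ∧
      st'.mem 28 = (1 * 2 ^ (K.n n₀ - n₀) - 1) * 2 ^ (n₀ * 3) * 2 ^ (K.n n₀ - n₀) ∧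
      st'.mem 29 = (1 * 2 ^ (K.n n₀ - n₀) - 1) * 2 ^ (n₀ * 3) * 2 ^ (K.n n₀ - n₀) * 2 ^ (K.n n₀ - n₀) ∧
      st'.mem 60 = L * 2 + 202 + K.M n₀ + K.M n₀ + K.r n₀ * K.C ∧
      (∀ c, c ≠ 27 → c ≠ 28 → c ≠ 29 → c ≠ 48 → c ≠ 54 → c ≠ 55 → c ≠ 56 → c ≠ 60 → c ≠ 81 → c ≠ 98 → st'.mem c = m c)) by
    obtain ⟨st', h1, h2⟩ := hh; exact ⟨st', h1, h2⟩
  refine Exec.block_of_fwd (bigB8c) qs fun Rf hRf => ?_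
  unfold bigB8c at hRf
  have htmp := execOps_cons_fwd hRf; clear hRf; obtain ⟨v1, hv1, hRf⟩ := htmp
  simp -failIfUnchanged (disch := omega) only [Operand.write, Operand.read, Function.update_self, Function.update_of_ne, BinOp.eval_add_mod', BinOp.eval_mul_mod', Nat.mod_eq_of_lt, BinOp.eval_sub_of_le, BinOp.eval_div, BinOp.eval_lt, BinOp.eval_shl_of_lt, Nat.add_zero, Nat.zero_add, h18, h60, h71, h65, h3, h32] at hv1 hRf
  subst v1
  have htmp := execOps_cons_fwd hRf; clear hRf; obtain ⟨v2, hv2, hRf⟩ := htmp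
  simp -failIfUnchanged (disch := omega) only [Operand.write, Operand.read, Function.update_self, Function.update_of_ne, BinOp.eval_add_mod', BinOp.eval_mul_mod', Nat.mod_eq_of_lt, BinOp.eval_sub_of_le, BinOp.eval_div, BinOp.eval_lt, BinOp.eval_shl_of_lt, Nat.add_zero, Nat.zero_add, h18, h60, h71, h65, h3, h32] at hv2 hRf
  subst v2
  have htmp := execOps_cons_fwd hRf; clear hRf; obtain ⟨v3, hv3, hRf⟩ := htmp
  simp -failIfUnchanged (disch := omega) only [Operand.write, Operand.read, Function.update_self, Function.update_of_ne, BinOp.eval_add_mod', BinOp.eval_mul_mod', Nat.mod_eq_of_lt, BinOp.eval_sub_of_le, BinOp.eval_div, BinOp.eval_lt, BinOp.eval_shl_of_lt, Nat.add_zero, Nat.zero_add, h18, h60, h71, h65, h3, h32] at hv3 hRf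
  subst v3
  have htmp := execOps_cons_fwd hRf; clear hRf; obtain ⟨v4, hv4, hRf⟩ := htmp
  simp -failIfUnchanged (disch := omega) only [Operand.write, Operand.read, Function.update_self, Function.update_of_ne, BinOp.eval_add_mod', BinOp.eval_mul_mod', Nat.mod_eq_of_lt, BinOp.eval_sub_of_le, BinOp.eval_div, BinOp.eval_lt, BinOp.eval_shl_of_lt, Nat.add_zero, Nat.zero_add, h18, h60, h71, h65, h3, h32] at hv4 hRf
  subst v4
  have htmp := execOps_cons_fwd hRf; clear hRf; obtain ⟨v5, hv5, hRf⟩ := htmp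
  simp -failIfUnchanged (disch := omega) only [Operand.write, Operand.read, Function.update_self, Function.update_of_ne, BinOp.eval_add_mod', BinOp.eval_mul_mod', Nat.mod_eq_of_lt, BinOp.eval_sub_of_le, BinOp.eval_div, BinOp.eval_lt, BinOp.eval_shl_of_lt, Nat.add_zero, Nat.zero_add, h18, h60, h71, h65, h3, h32] at hv5 hRf
  subst v5
  have htmp := execOps_cons_fwd hRf; clear hRf; obtain ⟨v6, hv6, hRf⟩ := htmp
  simp -failIfUnchanged (disch := omega) only [Operand.write, Operand.read, Function.update_self, Function.update_of_ne, BinOp.eval_add_mod', BinOp.eval_mul_mod', Nat.mod_eq_of_lt, BinOp.eval_sub_of_le, BinOp.eval_div, BinOp.eval_lt, BinOp.eval_shl_of_lt, Nat.add_zero, Nat.zero_add, h18, h60, h71, h65, h3, h32] at hv6 hRf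
  subst v6
  have htmp := execOps_cons_fwd hRf; clear hRf; obtain ⟨v7, hv7, hRf⟩ := htmp
  simp -failIfUnchanged (disch := omega) only [Operand.write, Operand.read, Function.update_self, Function.update_of_ne, BinOp.eval_add_mod', BinOp.eval_mul_mod', Nat.mod_eq_of_lt, BinOp.eval_sub_of_le, BinOp.eval_div, BinOp.eval_lt, BinOp.eval_shl_of_lt, Nat.add_zero, Nat.zero_add, h18, h60, h71, h65, h3, h32] at hv7 hRf
  subst v7
  have htmp := execOps_cons_fwd hRf; clear hRf; obtain ⟨v8, hv8, hRf⟩ := htmp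
  simp -failIfUnchanged (disch := omega) only [Operand.write, Operand.read, Function.update_self, Function.update_of_ne, BinOp.eval_add_mod', BinOp.eval_mul_mod', Nat.mod_eq_of_lt, BinOp.eval_sub_of_le, BinOp.eval_div, BinOp.eval_lt, BinOp.eval_shl_of_lt, Nat.add_zero, Nat.zero_add, h18, h60, h71, h65, h3, h32] at hv8 hRf
  subst v8
  have htmp := execOps_cons_fwd hRf; clear hRf; obtain ⟨v9, hv9, hRf⟩ := htmp
  simp -failIfUnchanged (disch := omega) only [Operand.write, Operand.read, Function.update_self, Function.update_of_ne, BinOp.eval_add_mod', BinOp.eval_mul_mod', Nat.mod_eq_of_lt, BinOp.eval_sub_of_le, BinOp.eval_div, BinOp.eval_lt, BinOp.eval_shl_of_lt, Nat.add_zero, Nat.zero_add, h18, h60, h71, h65, h3, h32] at hv9 hRf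
  subst v9
  have htmp := execOps_cons_fwd hRf; clear hRf; obtain ⟨v10, hv10, hRf⟩ := htmp
  simp -failIfUnchanged (disch := omega) only [Operand.write, Operand.read, Function.update_self, Function.update_of_ne, BinOp.eval_add_mod', BinOp.eval_mul_mod', Nat.mod_eq_of_lt, BinOp.eval_sub_of_le, BinOp.eval_div, BinOp.eval_lt, BinOp.eval_shl_of_lt, Nat.add_zero, Nat.zero_add, h18, h60, h71, h65, h3, h32] at hv10 hRf
  subst v10
  have htmp := execOps_cons_fwd hRf; clear hRf; obtain ⟨v11, hv11, hRf⟩ := htmp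
  simp -failIfUnchanged (disch := omega) only [Operand.write, Operand.read, Function.update_self, Function.update_of_ne, BinOp.eval_add_mod', BinOp.eval_mul_mod', Nat.mod_eq_of_lt, BinOp.eval_sub_of_le, BinOp.eval_div, BinOp.eval_lt, BinOp.eval_shl_of_lt, Nat.add_zero, Nat.zero_add, h18, h60, h71, h65, h3, h32] at hv11 hRf
  subst v11
  simp only [execOps_nil] at hRf
  subst hRf
  refine ⟨rfl, ?_, ?_, ?_, ?_, ?_, ?_, ?_, ?_, fun c hc0 hc1 hc2 hc3 hc4 hc5 hc6 hc7 hc8 hc9 => ?_⟩ <;> dsimp only <;>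
    (simp (disch := omega) only [Function.update_of_ne, Function.update_self, h18, h60, h71, h65, h3, h32]; try rfl)

end SProg

namespace SProg

open Finset StateTransition PrattConsts

variable {w : ℕ} {O : List ℕ → List ℕ}

/-- `setMask` depends only on the listed element words. [folklore] -/
theorem setMask_congr {m m' : ℕ → ℕ} {ep PM t : ℕ} (h : ∀ t', t' < t → m (ep + t') = m' (ep + t')) :
    setMask m ep PM t = setMask m' ep PM t := by
  unfold setMask
  congr 1
  exact sum_congr rfl fun t' ht' => by rw [h t' (mem_range.1 ht')]

/-- The header of an input of length `L`, `n₀` elements per set and family lengths `len`. [folklore] -/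
def hdr (L n₀ : ℕ) (len : ℕ → ℕ) : Header := ⟨L + 100, n₀, len⟩

/-- What the input region must look like for the parse of the table branch (all about the memory
below `2L + 102`, which nothing before the parse touches): the three families lie inside the input,
their element words are `< 3 n₀`, and their masks are `< 2^M`. [folklore] -/
structure ParseOK (m : ℕ → ℕ) (K : PrattConsts) (n₀ L : ℕ) (len : ℕ → ℕ) : Prop where
  hAin : (hdr L n₀ len).A 2 + len 2 * (n₀ + 1) ≤ 2 * L + 101
  hel : ∀ l j t, l < 3 → j < len l → t < n₀ → m ((hdr L n₀ len).A l + j * (n₀ + 1) + 1 + t) < 3 * n₀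
  hcode : ∀ l j, l < 3 → j < len l →
    setMask m ((hdr L n₀ len).A l + j * (n₀ + 1) + 1) (K.PM n₀ l) n₀ < 2 ^ K.M n₀

/-- Family addresses increase. [folklore] -/
theorem hdr_A_mono (L n₀ : ℕ) (len : ℕ → ℕ) :
    L + 103 = (hdr L n₀ len).A 0 ∧
    (hdr L n₀ len).A 0 + len 0 * (n₀ + 1) + 1 = (hdr L n₀ len).A 1 ∧
    (hdr L n₀ len).A 1 + len 1 * (n₀ + 1) + 1 = (hdr L n₀ len).A 2 := ⟨rfl, rfl, rfl⟩

/-- **Parsing one family, plain form**, from a memory `mm` that agrees with `m` on the input region.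
[cite: Pratt2024SCC, §2 (proof of Thm. 1.9)] -/
theorem parseFam_plain {mm m : ℕ → ℕ} {A ln n₀ FT MB PM RA RL RFT RPM L : ℕ}
    (hagree : ∀ c, 100 ≤ c → c ≤ 2 * L + 101 → mm c = m c)
    (hA : L + 103 ≤ A) (hAE : A + ln * (n₀ + 1) ≤ 2 * L + 101) (hFT : 2 * L + 102 ≤ FT)
    (hFTE : FT + MB ≤ 2 ^ w) (hMw : 3 * n₀ < w)
    (hel : ∀ j t, j < ln → t < n₀ → m (A + j * (n₀ + 1) + 1 + t) < 3 * n₀)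
    (hcode : ∀ j, j < ln → setMask m (A + j * (n₀ + 1) + 1) PM n₀ < MB)
    (hRA : RA < 82) (hRL : RL < 82) (hRFT : RFT < 82) (hRPM : RPM < 82)
    (r3 : mm 3 = n₀) (r73 : mm 73 = n₀ + 1) (ra : mm RA = A) (rl : mm RL = ln) (rft : mm RFT = FT)
    (rpm : mm RPM = PM) (qs : List (List ℕ)) :
    ∃ st', ExecLE w O (parseFam RA RL RFT RPM) ⟨mm, qs⟩ st' (ln * (n₀ * 7 + 12) + 3) ∧ st'.queries = qs ∧
      (∀ a, a < MB → (∃ j, j < ln ∧ a = setMask m (A + j * (n₀ + 1) + 1) PM n₀) → st'.mem (FT + a) = 1) ∧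
      (∀ a, a < MB → (∀ j, j < ln → a ≠ setMask m (A + j * (n₀ + 1) + 1) PM n₀) →
        st'.mem (FT + a) = mm (FT + a)) ∧
      (∀ c, ¬ (82 ≤ c ∧ c ≤ 88) → c ≠ 91 → ¬ (FT ≤ c ∧ c < FT + MB) → st'.mem c = mm c) := by
  have hrow : ∀ {j}, j < ln → j * (n₀ + 1) + (n₀ + 1) ≤ ln * (n₀ + 1) := fun {j} hj => by
    have := Nat.mul_le_mul_right (n₀ + 1) hj; rw [Nat.succ_mul] at this; exact this
  have hcodeq : ∀ j, j < ln → setMask mm (A + j * (n₀ + 1) + 1) PM n₀ = setMask m (A + j * (n₀ + 1) + 1) PM n₀ :=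
    fun j hj => setMask_congr fun t' ht' => by have := hrow hj; exact hagree _ (by omega) (by omega)
  let F : FamLayout := ⟨A, ln, n₀ + 1, n₀, FT, MB, PM⟩
  have hcF : ∀ j, F.code mm j = setMask mm (A + j * (n₀ + 1) + 1) PM n₀ := fun j => rfl
  have hS : FamSide w mm F := by
    refine ⟨show 100 ≤ A by omega, show A + ln * (n₀ + 1) < 2 ^ w by omega, le_refl _,
      show 100 ≤ FT by omega, hFTE, show ln < 2 ^ w from ?_, Or.inl (show A + ln * (n₀ + 1) ≤ FT by omega),
      fun j t (hj : j < ln) (ht : t < n₀) => ?_, fun j (hj : j < ln) => ?_⟩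
    · have : ln ≤ ln * (n₀ + 1) := Nat.le_mul_of_pos_right _ (Nat.succ_pos _); omega
    · show mm (A + j * (n₀ + 1) + 1 + t) < w
      have := hrow hj
      rw [hagree _ (by omega) (by omega)]; exact (hel j t hj ht).trans hMw
    · show F.code mm j < MB
      rw [hcF, hcodeq j hj]; exact hcode j hj
  have hR : FamRegs mm F RA RL RFT RPM := ⟨hRA, hRL, hRFT, hRPM, r3, r73, ra, rl, rft, rpm⟩
  obtain ⟨st', hex, hI⟩ := parseFam_spec (w := w) (O := O) hS hR qs
  obtain ⟨hq, _, _, htab, hfr⟩ := hI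
  refine ⟨st', hex, hq, fun a ha hex' => ?_, fun a ha hall => ?_, hfr⟩
  · obtain ⟨j, hj, rfl⟩ := hex'
    rw [htab _ ha, if_pos ⟨j, hj, by rw [hcF, hcodeq j hj]⟩]
  · rw [htab _ ha, if_neg ?_]
    rintro ⟨j, hj, hja⟩
    exact hall j hj (by rw [hja, hcF, hcodeq j hj])

/-- Step count of `bigPre3`. [folklore] -/
def pre3Time (K : PrattConsts) (n₀ : ℕ) (len : ℕ → ℕ) : ℕ :=
  2 * K.BMl.length + (1 + (2 * K.UVWl.length + (len 0 * (n₀ * 7 + 12) + 3 + (len 1 * (n₀ * 7 + 12) + 3 +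
    (len 2 * (n₀ * 7 + 12) + 3)))))

set_option linter.unusedSimpArgs false in
set_option maxHeartbeats 2000000 in
/-- **Part 3 of the table branch, specified**: the block-membership table at `bm`, the coefficient
words at `rU₀`, and the three membership tables: cell `FT_l + a` is `1` if `a` is the mask of a listed
set of family `l` and `0` otherwise. [cite: Pratt2024SCC, §2 (proof of Thm. 1.9)] -/
theorem bigPre3_spec {m : ℕ → ℕ} {K : PrattConsts} {n₀ L : ℕ} {len : ℕ → ℕ} (hF : BigFits w K n₀ L)
    (hP : ParseOK m K n₀ L len)
    (h60 : m 60 = (K.lay n₀ L).bm) (h12 : m 12 = (K.lay n₀ L).rU 0) (h3 : m 3 = n₀) (h73 : m 73 = n₀ + 1)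
    (h74 : m 74 = (hdr L n₀ len).A 0) (h75 : m 75 = (hdr L n₀ len).A 1) (h76 : m 76 = (hdr L n₀ len).A 2)
    (h77 : m 77 = len 0) (h78 : m 78 = len 1) (h79 : m 79 = len 2)
    (h39 : m 39 = (K.lay n₀ L).FT 0) (h23 : m 23 = (K.lay n₀ L).FT 1) (h19 : m 19 = (K.lay n₀ L).FT 2)
    (h27 : m 27 = K.PM n₀ 0) (h28 : m 28 = K.PM n₀ 1) (h29 : m 29 = K.PM n₀ 2)
    (hFT0 : ∀ l a, l < 3 → a < 2 ^ K.M n₀ → m ((K.lay n₀ L).FT l + a) = 0) (qs : List (List ℕ)) :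
    ∃ st', ExecLE w O (bigPre3 K) ⟨m, qs⟩ st' (pre3Time K n₀ len) ∧ st'.queries = qs ∧
      (∀ j i, j < K.C → i < K.tk → st'.mem ((K.lay n₀ L).bm + j * K.tk + i) = K.BMl.getD (j * K.tk + i) 0) ∧
      (∀ idx, idx < 3 * (K.R * K.N) → st'.mem ((K.lay n₀ L).rU 0 + idx) = wordOfInt w (K.UVWl.getD idx 0)) ∧
      (∀ l a, l < 3 → a < 2 ^ K.M n₀ →
        (∃ j, j < len l ∧ a = setMask m ((hdr L n₀ len).A l + j * (n₀ + 1) + 1) (K.PM n₀ l) n₀) →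
        st'.mem ((K.lay n₀ L).FT l + a) = 1) ∧
      (∀ l a, l < 3 → a < 2 ^ K.M n₀ →
        (∀ j, j < len l → a ≠ setMask m ((hdr L n₀ len).A l + j * (n₀ + 1) + 1) (K.PM n₀ l) n₀) →
        st'.mem ((K.lay n₀ L).FT l + a) = 0) ∧
      (∀ c, ¬ (82 ≤ c ∧ c ≤ 88) → c ≠ 91 → c ≠ 60 →
        ¬ ((K.lay n₀ L).bm ≤ c ∧ c < (K.lay n₀ L).bm + K.C * K.tk) →
        ¬ ((K.lay n₀ L).rU 0 ≤ c ∧ c < (K.lay n₀ L).rU 0 + 3 * (K.R * K.N)) →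
        ¬ ((K.lay n₀ L).FT 0 ≤ c ∧ c < (K.lay n₀ L).FT 0 + 3 * 2 ^ K.M n₀) → st'.mem c = m c) := by
  obtain ⟨btk, bC, bN, bR, bB, bCC1, br, bq, bNtot, bNq, bRq, bBq, bG, bn, bQ, bcoins, bRC, bMw, bM1,
    hNtot, bds, boff, b2M⟩ := hF.bounds
  have hcp := hF.hcp
  have hw1 : 1 ≤ w := by have := hF.hw; omega
  have hn₀M := hF.hn₀
  have h3n₀ : 3 * n₀ < w := by omega
  have hcp0def : K.cp0 n₀ L = L * 2 + 202 + K.M n₀ + K.M n₀ + K.r n₀ * K.C + K.C * K.tk + 3 * 2 ^ K.M n₀ +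
      3 * (K.R * K.N) + 2 * K.G n₀ + K.G n₀ := rfl
  have hbm : (K.lay n₀ L).bm = L * 2 + 202 + K.M n₀ + K.M n₀ + K.r n₀ * K.C := rfl
  have hFT : ∀ l, (K.lay n₀ L).FT l = L * 2 + 202 + K.M n₀ + K.M n₀ + K.r n₀ * K.C + K.C * K.tk + l * 2 ^ K.M n₀ :=
    fun l => rfl
  have hrU0 : (K.lay n₀ L).rU 0 = L * 2 + 202 + K.M n₀ + K.M n₀ + K.r n₀ * K.C + K.C * K.tk + 3 * 2 ^ K.M n₀ +
      0 * (K.R * K.N) := rfl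
  obtain ⟨BM, hBMv⟩ : ∃ v, (K.lay n₀ L).bm = v := ⟨_, rfl⟩
  obtain ⟨F0, hF0⟩ : ∃ v, (K.lay n₀ L).FT 0 = v := ⟨_, rfl⟩
  obtain ⟨U0, hU0⟩ : ∃ v, (K.lay n₀ L).rU 0 = v := ⟨_, rfl⟩
  obtain ⟨MB, hMB⟩ : ∃ v, 2 ^ K.M n₀ = v := ⟨_, rfl⟩
  have eF0 := hFT 0
  rw [hBMv] at hbm h60; rw [hF0] at eF0 h39; rw [hU0] at hrU0 h12
  rw [hMB] at eF0 hrU0 hcp0def hFT hFT0 b2M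
  have hFTl : ∀ l, (K.lay n₀ L).FT l = F0 + l * MB := fun l => by rw [hFT l, eF0]; omega
  rw [hFTl 1] at h23; rw [hFTl 2] at h19
  have hlenBM : K.BMl.length = K.C * K.tk := K.hBMlen
  have hlenU : K.UVWl.length = 3 * (K.R * K.N) := K.hUVWlen
  obtain ⟨hA0, hA1, hA2⟩ := hdr_A_mono L n₀ len
  obtain ⟨A0, eA0⟩ : ∃ v, (hdr L n₀ len).A 0 = v := ⟨_, rfl⟩
  obtain ⟨A1, eA1⟩ : ∃ v, (hdr L n₀ len).A 1 = v := ⟨_, rfl⟩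
  obtain ⟨A2, eA2⟩ : ∃ v, (hdr L n₀ len).A 2 = v := ⟨_, rfl⟩
  obtain ⟨hAin, hel, hcode⟩ := hP
  rw [eA0] at hA0 hA1 h74; rw [eA1] at hA1 hA2 h75; rw [eA2] at hA2 hAin h76
  have hs0 : len 0 ≤ len 0 * (n₀ + 1) := Nat.le_mul_of_pos_right _ (Nat.succ_pos _)
  have hs1 : len 1 ≤ len 1 * (n₀ + 1) := Nat.le_mul_of_pos_right _ (Nat.succ_pos _)
  -- phase 1: the block-membership table
  have hex₁ := writeConsts_plain (w := w) (O := O) (m := m) (P := 60) (p := BM) (by norm_num) K.BMl h60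
    (by omega) (by omega) (fun v hv => by
      have := K.hBM1 v hv
      calc v ≤ 1 := this
        _ < 2 ^ w := Nat.one_lt_two_pow (by omega)) qs
  obtain ⟨m₁, hm₁⟩ : ∃ mm, wcMem m 60 BM K.BMl = mm := ⟨_, rfl⟩
  rw [hm₁] at hex₁
  have t₁ : ∀ idx, idx < K.C * K.tk → m₁ (BM + idx) = K.BMl.getD idx 0 := fun idx hidx => by
    rw [← hm₁]; unfold wcMem
    rw [if_neg (by omega), if_pos (by constructor <;> omega), Nat.add_sub_cancel_left]
  have f₁ : ∀ c, c ≠ 60 → ¬ (BM ≤ c ∧ c < BM + K.C * K.tk) → m₁ c = m c := fun c h1 h2 => by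
    rw [← hm₁]; unfold wcMem; rw [if_neg h1, if_neg (by rw [hlenBM]; exact h2)]
  -- phase 2: the pointer to `rU₀`
  obtain ⟨st₂, hex₂, hP₂⟩ : ∃ st', Exec w O (block [(.add, .dir 60, .dir 12, .imm 0)]) ⟨m₁, qs⟩ st' 1 ∧
      (st'.queries = qs ∧ st'.mem 60 = U0 ∧ ∀ c, c ≠ 60 → st'.mem c = m₁ c) := by
    have g12 : m₁ 12 = U0 := by rw [f₁ 12 (by omega) (by omega)]; exact h12
    refine Exec.block_of_fwd _ qs fun Rf hRf => ?_
    have htmp := execOps_cons_fwd hRf; clear hRf; obtain ⟨v1, hv1, hRf⟩ := htmp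
    simp -failIfUnchanged (disch := omega) only [Operand.write, Operand.read,
      Function.update_self, Function.update_of_ne, BinOp.eval_add_mod', Nat.mod_eq_of_lt, Nat.add_zero, g12] at hv1 hRf
    subst v1
    simp only [execOps_nil] at hRf
    subst hRf
    refine ⟨rfl, ?_, fun c hc => ?_⟩ <;> dsimp only <;>
      simp (disch := omega) only [Function.update_of_ne, Function.update_self]
  obtain ⟨hq₂, e60, f₂⟩ := hP₂
  obtain ⟨m₂, qq₂⟩ := st₂
  simp only at hq₂ e60 f₂ hex₂
  subst qq₂
  -- phase 3: the coefficient words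
  have hex₃ := writeInts_spec (w := w) (O := O) (P := 60) (by norm_num) hw1 K.UVWl (m := m₂) (p := U0) e60
    (by omega) (by omega) hF.hUVW qs
  obtain ⟨m₃, hm₃⟩ : ∃ mm, wiMem w m₂ 60 U0 K.UVWl = mm := ⟨_, rfl⟩
  rw [hm₃] at hex₃
  have t₃ : ∀ idx, idx < 3 * (K.R * K.N) → m₃ (U0 + idx) = wordOfInt w (K.UVWl.getD idx 0) := fun idx hidx => by
    rw [← hm₃]; unfold wiMem
    rw [if_neg (by omega), if_pos (by constructor <;> omega), Nat.add_sub_cancel_left]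
  have f₃ : ∀ c, c ≠ 60 → ¬ (U0 ≤ c ∧ c < U0 + 3 * (K.R * K.N)) → m₃ c = m₂ c := fun c h1 h2 => by
    rw [← hm₃]; unfold wiMem; rw [if_neg h1, if_neg (by rw [hlenU]; exact h2)]
  have K₃ : ∀ c, c ≠ 60 → ¬ (BM ≤ c ∧ c < BM + K.C * K.tk) → ¬ (U0 ≤ c ∧ c < U0 + 3 * (K.R * K.N)) →
      m₃ c = m c := fun c h1 h2 h3 => by rw [f₃ c h1 h3, f₂ c h1, f₁ c h1 h2]
  have hin₃ : ∀ c, 100 ≤ c → c ≤ 2 * L + 101 → m₃ c = m c := fun c h1 h2 => K₃ c (by omega) (by omega) (by omega)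
  -- phase 4: family 0
  obtain ⟨st₄, hex₄, hq₄, one₄, zero₄, fr₄⟩ := parseFam_plain (w := w) (O := O) (mm := m₃) (m := m) (A := A0)
    (ln := len 0) (n₀ := n₀) (FT := F0) (MB := MB) (PM := K.PM n₀ 0) (RA := 74) (RL := 77) (RFT := 39) (RPM := 27)
    (L := L) hin₃ (by omega) (by omega) (by omega) (by omega) h3n₀
    (fun j t hj ht => by rw [← eA0]; exact hel 0 j t (by norm_num) hj ht)
    (fun j hj => by rw [← eA0, ← hMB]; exact hcode 0 j (by norm_num) hj)
    (by norm_num) (by norm_num) (by norm_num) (by norm_num)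
    ((K₃ 3 (by omega) (by omega) (by omega)).trans h3) ((K₃ 73 (by omega) (by omega) (by omega)).trans h73)
    ((K₃ 74 (by omega) (by omega) (by omega)).trans h74) ((K₃ 77 (by omega) (by omega) (by omega)).trans h77)
    ((K₃ 39 (by omega) (by omega) (by omega)).trans h39) ((K₃ 27 (by omega) (by omega) (by omega)).trans h27) qs
  obtain ⟨m₄, qq₄⟩ := st₄
  simp only at hq₄ one₄ zero₄ fr₄ hex₄
  subst qq₄
  have hin₄ : ∀ c, 100 ≤ c → c ≤ 2 * L + 101 → m₄ c = m c := fun c h1 h2 =>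
    (fr₄ c (by omega) (by omega) (by omega)).trans (hin₃ c h1 h2)
  have K₄ : ∀ c, c < 82 → c ≠ 60 → m₄ c = m c := fun c h1 h2 =>
    (fr₄ c (by omega) (by omega) (by omega)).trans (K₃ c h2 (by omega) (by omega))
  -- phase 5: family 1
  obtain ⟨st₅, hex₅, hq₅, one₅, zero₅, fr₅⟩ := parseFam_plain (w := w) (O := O) (mm := m₄) (m := m) (A := A1)
    (ln := len 1) (n₀ := n₀) (FT := F0 + 1 * MB) (MB := MB) (PM := K.PM n₀ 1) (RA := 75) (RL := 78) (RFT := 23)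
    (RPM := 28) (L := L) hin₄ (by omega) (by omega) (by omega) (by omega) h3n₀
    (fun j t hj ht => by rw [← eA1]; exact hel 1 j t (by norm_num) hj ht)
    (fun j hj => by rw [← eA1, ← hMB]; exact hcode 1 j (by norm_num) hj)
    (by norm_num) (by norm_num) (by norm_num) (by norm_num)
    ((K₄ 3 (by omega) (by omega)).trans h3) ((K₄ 73 (by omega) (by omega)).trans h73)
    ((K₄ 75 (by omega) (by omega)).trans h75) ((K₄ 78 (by omega) (by omega)).trans h78)
    ((K₄ 23 (by omega) (by omega)).trans h23) ((K₄ 28 (by omega) (by omega)).trans h28) qs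
  obtain ⟨m₅, qq₅⟩ := st₅
  simp only at hq₅ one₅ zero₅ fr₅ hex₅
  subst qq₅
  have hin₅ : ∀ c, 100 ≤ c → c ≤ 2 * L + 101 → m₅ c = m c := fun c h1 h2 =>
    (fr₅ c (by omega) (by omega) (by omega)).trans (hin₄ c h1 h2)
  have K₅ : ∀ c, c < 82 → c ≠ 60 → m₅ c = m c := fun c h1 h2 =>
    (fr₅ c (by omega) (by omega) (by omega)).trans (K₄ c h1 h2)
  -- phase 6: family 2
  obtain ⟨st₆, hex₆, hq₆, one₆, zero₆, fr₆⟩ := parseFam_plain (w := w) (O := O) (mm := m₅) (m := m) (A := A2)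
    (ln := len 2) (n₀ := n₀) (FT := F0 + 2 * MB) (MB := MB) (PM := K.PM n₀ 2) (RA := 76) (RL := 79) (RFT := 19)
    (RPM := 29) (L := L) hin₅ (by omega) (by omega) (by omega) (by omega) h3n₀
    (fun j t hj ht => by rw [← eA2]; exact hel 2 j t (by norm_num) hj ht)
    (fun j hj => by rw [← eA2, ← hMB]; exact hcode 2 j (by norm_num) hj)
    (by norm_num) (by norm_num) (by norm_num) (by norm_num)
    ((K₅ 3 (by omega) (by omega)).trans h3) ((K₅ 73 (by omega) (by omega)).trans h73)
    ((K₅ 76 (by omega) (by omega)).trans h76) ((K₅ 79 (by omega) (by omega)).trans h79)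
    ((K₅ 19 (by omega) (by omega)).trans h19) ((K₅ 29 (by omega) (by omega)).trans h29) qs
  obtain ⟨m₆, qq₆⟩ := st₆
  simp only at hq₆ one₆ zero₆ fr₆ hex₆
  subst qq₆
  -- assembly
  refine ⟨⟨m₆, qs⟩, ?_, rfl, fun j i hj hi => ?_, fun idx hidx => ?_, fun l a hl ha hex' => ?_,
    fun l a hl ha hall => ?_, fun c g1 g2 g3 g4 g5 g6 => ?_⟩
  · unfold bigPre3 pre3Time
    exact hex₁.execLE.seqs_cons (hex₂.execLE.seqs_cons (hex₃.execLE.seqs_cons (hex₄.seqs_cons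
      (hex₅.seqs_cons (ExecLE.seqs_one hex₆)))))
  · show m₆ ((K.lay n₀ L).bm + j * K.tk + i) = _
    have hjt : j * K.tk + K.tk ≤ K.C * K.tk := by
      have := Nat.mul_le_mul_right K.tk hj; rw [Nat.succ_mul] at this; exact this
    rw [hBMv, Nat.add_assoc, fr₆ _ (by omega) (by omega) (by omega), fr₅ _ (by omega) (by omega) (by omega),
      fr₄ _ (by omega) (by omega) (by omega), f₃ _ (by omega) (by omega), f₂ _ (by omega)]
    exact t₁ _ (by omega)
  · show m₆ ((K.lay n₀ L).rU 0 + idx) = _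
    rw [hU0, fr₆ _ (by omega) (by omega) (by omega), fr₅ _ (by omega) (by omega) (by omega),
      fr₄ _ (by omega) (by omega) (by omega)]
    exact t₃ idx hidx
  · show m₆ ((K.lay n₀ L).FT l + a) = 1
    rw [hFTl l]
    rw [hMB] at ha
    interval_cases l
    · rw [eA0] at hex'
      rw [fr₆ _ (by omega) (by omega) (by omega), fr₅ _ (by omega) (by omega) (by omega),
        show F0 + 0 * MB + a = F0 + a by omega]
      exact one₄ a ha hex'
    · rw [eA1] at hex'
      rw [fr₆ _ (by omega) (by omega) (by omega)]
      exact one₅ a ha hex'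
    · rw [eA2] at hex'
      exact one₆ a ha hex'
  · show m₆ ((K.lay n₀ L).FT l + a) = 0
    rw [hMB] at ha
    have hz := hFT0 l a hl ha
    rw [hFTl l] at hz ⊢
    interval_cases l
    · rw [eA0] at hall
      rw [fr₆ _ (by omega) (by omega) (by omega), fr₅ _ (by omega) (by omega) (by omega),
        show F0 + 0 * MB + a = F0 + a by omega, zero₄ a ha hall, K₃ _ (by omega) (by omega) (by omega)]
      rw [show F0 + 0 * MB + a = F0 + a by omega] at hz; exact hz
    · rw [eA1] at hall
      rw [fr₆ _ (by omega) (by omega) (by omega), zero₅ a ha hall, fr₄ _ (by omega) (by omega) (by omega),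
        K₃ _ (by omega) (by omega) (by omega)]
      exact hz
    · rw [eA2] at hall
      rw [zero₆ a ha hall, fr₅ _ (by omega) (by omega) (by omega), fr₄ _ (by omega) (by omega) (by omega),
        K₃ _ (by omega) (by omega) (by omega)]
      exact hz
  · show m₆ c = m c
    rw [hBMv] at g4; rw [hU0] at g5; rw [hF0] at g6
    rw [fr₆ c g1 g2 (by omega), fr₅ c g1 g2 (by omega), fr₄ c g1 g2 (by omega)]
    exact K₃ c g3 g4 g5

end SProg

namespace SProg

open Finset StateTransition PrattConsts

variable {w : ℕ} {O : List ℕ → List ℕ}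

/-! ## The first parameters and the branch flag -/

set_option linter.unusedSimpArgs false in
/-- **`paramsA`, specified**: `q, r, M`, the threshold, and the flag `26 = [w < thr]`. [folklore] -/
theorem paramsA_spec {m : ℕ → ℕ} {K : PrattConsts} {n₀ : ℕ} (h3 : m 3 = n₀) (h2 : m 2 = w)
    (hthrw : K.thr n₀ < 2 ^ w) (qs : List (List ℕ)) :
    ∃ st', Exec w O (block (paramsA K)) ⟨m, qs⟩ st' 8 ∧ st'.queries = qs ∧
      st'.mem 5 = K.q n₀ ∧ st'.mem 36 = K.r n₀ ∧ st'.mem 6 = K.M n₀ ∧ st'.mem 37 = K.M n₀ ∧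
      st'.mem 72 = K.thr n₀ ∧ st'.mem 26 = (if w < K.thr n₀ then 1 else 0) ∧ st'.mem 2 = w ∧ st'.mem 3 = n₀ ∧
      (∀ c, c ≠ 5 → c ≠ 6 → c ≠ 26 → c ≠ 36 → c ≠ 37 → c ≠ 72 → st'.mem c = m c) := by
  have hthr : K.thr n₀ = K.m * (n₀ / (K.k * K.m) + 1) * K.tk * K.cB + K.c0 := rfl
  have hcB := K.hcB; have hm := K.hm; have hk := K.hk
  have htk : 3 ≤ K.tk := by unfold PrattConsts.tk; omega
  obtain ⟨T1, hT1⟩ : ∃ v, n₀ / (K.k * K.m) + 1 = v := ⟨_, rfl⟩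
  obtain ⟨T2, hT2⟩ : ∃ v, K.m * T1 = v := ⟨_, rfl⟩
  obtain ⟨T3, hT3⟩ : ∃ v, T2 * K.tk = v := ⟨_, rfl⟩
  obtain ⟨T4, hT4⟩ : ∃ v, T3 * K.cB = v := ⟨_, rfl⟩
  rw [hT1, hT2, hT3, hT4] at hthr
  have hT12 : T1 ≤ T2 := by rw [← hT2]; exact Nat.le_mul_of_pos_left _ hm
  have hT23 : T2 ≤ T3 := by rw [← hT3]; exact Nat.le_mul_of_pos_right _ (by omega)
  have hT34 : T3 ≤ T4 := by rw [← hT4]; exact Nat.le_mul_of_pos_right _ hcB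
  rw [hthr] at hthrw
  have hw2 : w < 2 ^ w := Nat.lt_two_pow_self
  suffices hh : ∃ st', Exec w O (block (paramsA K)) ⟨m, qs⟩ st' 8 ∧ (st'.queries = qs ∧
      st'.mem 5 = T1 ∧ st'.mem 36 = T2 ∧ st'.mem 6 = T3 ∧ st'.mem 37 = T3 ∧
      st'.mem 72 = T4 + K.c0 ∧ st'.mem 26 = (if w < T4 + K.c0 then 1 else 0) ∧ st'.mem 2 = w ∧ st'.mem 3 = n₀ ∧
      (∀ c, c ≠ 5 → c ≠ 6 → c ≠ 26 → c ≠ 36 → c ≠ 37 → c ≠ 72 → st'.mem c = m c)) by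
    obtain ⟨st', hex, hq, g5, g36, g6, g37, g72, g26, g2, g3, hfr⟩ := hh
    refine ⟨st', hex, hq, ?_, ?_, ?_, ?_, ?_, ?_, g2, g3, hfr⟩
    · rw [g5, ← hT1]; rfl
    · rw [g36, ← hT2, ← hT1]; rfl
    · rw [g6, ← hT3, ← hT2, ← hT1]; rfl
    · rw [g37, ← hT3, ← hT2, ← hT1]; rfl
    · rw [g72, hthr]
    · rw [g26, hthr]
  refine Exec.block_of_fwd (paramsA K) qs fun Rf hRf => ?_
  unfold paramsA at hRf
  have htmp := execOps_cons_fwd hRf; clear hRf; obtain ⟨v1, hv1, hRf⟩ := htmp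
  simp -failIfUnchanged (disch := omega) only [Operand.write, Operand.read, Function.update_self,
    Function.update_of_ne, BinOp.eval_add_mod', BinOp.eval_mul_mod', Nat.mod_eq_of_lt, BinOp.eval_div,
    BinOp.eval_lt, Nat.add_zero, h3, h2] at hv1 hRf
  subst v1
  have htmp := execOps_cons_fwd hRf; clear hRf; obtain ⟨v2, hv2, hRf⟩ := htmp
  simp -failIfUnchanged (disch := omega) only [Operand.write, Operand.read, Function.update_self,
    Function.update_of_ne, BinOp.eval_add_mod', BinOp.eval_mul_mod', Nat.mod_eq_of_lt, BinOp.eval_div,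
    BinOp.eval_lt, Nat.add_zero, h3, h2, hT1] at hv2 hRf
  subst v2
  have htmp := execOps_cons_fwd hRf; clear hRf; obtain ⟨v3, hv3, hRf⟩ := htmp
  simp -failIfUnchanged (disch := omega) only [Operand.write, Operand.read, Function.update_self,
    Function.update_of_ne, BinOp.eval_add_mod', BinOp.eval_mul_mod', Nat.mod_eq_of_lt, BinOp.eval_div,
    BinOp.eval_lt, Nat.add_zero, h3, h2, hT2] at hv3 hRf
  subst v3
  have htmp := execOps_cons_fwd hRf; clear hRf; obtain ⟨v4, hv4, hRf⟩ := htmp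
  simp -failIfUnchanged (disch := omega) only [Operand.write, Operand.read, Function.update_self,
    Function.update_of_ne, BinOp.eval_add_mod', BinOp.eval_mul_mod', Nat.mod_eq_of_lt, BinOp.eval_div,
    BinOp.eval_lt, Nat.add_zero, h3, h2, hT3] at hv4 hRf
  subst v4
  have htmp := execOps_cons_fwd hRf; clear hRf; obtain ⟨v5, hv5, hRf⟩ := htmp
  simp -failIfUnchanged (disch := omega) only [Operand.write, Operand.read, Function.update_self,
    Function.update_of_ne, BinOp.eval_add_mod', BinOp.eval_mul_mod', Nat.mod_eq_of_lt, BinOp.eval_div,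
    BinOp.eval_lt, Nat.add_zero, h3, h2] at hv5 hRf
  subst v5
  have htmp := execOps_cons_fwd hRf; clear hRf; obtain ⟨v6, hv6, hRf⟩ := htmp
  simp -failIfUnchanged (disch := omega) only [Operand.write, Operand.read, Function.update_self,
    Function.update_of_ne, BinOp.eval_add_mod', BinOp.eval_mul_mod', Nat.mod_eq_of_lt, BinOp.eval_div,
    BinOp.eval_lt, Nat.add_zero, h3, h2, hT4] at hv6 hRf
  subst v6
  have htmp := execOps_cons_fwd hRf; clear hRf; obtain ⟨v7, hv7, hRf⟩ := htmp
  simp -failIfUnchanged (disch := omega) only [Operand.write, Operand.read, Function.update_self,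
    Function.update_of_ne, BinOp.eval_add_mod', BinOp.eval_mul_mod', Nat.mod_eq_of_lt, BinOp.eval_div,
    BinOp.eval_lt, Nat.add_zero, h3, h2] at hv7 hRf
  subst v7
  have htmp := execOps_cons_fwd hRf; clear hRf; obtain ⟨v8, hv8, hRf⟩ := htmp
  simp -failIfUnchanged (disch := omega) only [Operand.write, Operand.read, Function.update_self,
    Function.update_of_ne, BinOp.eval_add_mod', BinOp.eval_mul_mod', Nat.mod_eq_of_lt, BinOp.eval_div,
    BinOp.eval_lt, Nat.add_zero, h3, h2] at hv8 hRf
  subst v8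
  simp only [execOps_nil] at hRf
  subst hRf
  refine ⟨rfl, ?_, ?_, ?_, ?_, ?_, ?_, ?_, ?_, fun c g1 g2 g3 g4 g5 g6 => ?_⟩ <;> dsimp only <;>
    (simp (disch := omega) only [Function.update_of_ne, Function.update_self, h2, h3]; try rfl)

set_option linter.unusedSimpArgs false in
/-- **`smallPre`, specified.** [folklore] -/
theorem smallPre_spec {m : ℕ → ℕ} {L : ℕ} (h4 : m 4 = L) (hL : L * 2 + 202 < 2 ^ w) (qs : List (List ℕ)) :
    ∃ st', Exec w O (block smallPre) ⟨m, qs⟩ st' 6 ∧ st'.queries = qs ∧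
      st'.mem 89 = L * 2 + 202 ∧ st'.mem 90 = 0 ∧ st'.mem 81 = 0 ∧ st'.mem 98 = 0 ∧ st'.mem 99 = 100 ∧
      (∀ c, c ≠ 81 → c ≠ 89 → c ≠ 90 → c ≠ 98 → c ≠ 99 → st'.mem c = m c) := by
  have h100 : 100 < 2 ^ w := by omega
  suffices hh : ∃ st', Exec w O (block smallPre) ⟨m, qs⟩ st' 6 ∧ (st'.queries = qs ∧
      st'.mem 89 = L * 2 + 202 ∧ st'.mem 90 = 0 ∧ st'.mem 81 = 0 ∧ st'.mem 98 = 0 ∧ st'.mem 99 = 100 ∧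
      (∀ c, c ≠ 81 → c ≠ 89 → c ≠ 90 → c ≠ 98 → c ≠ 99 → st'.mem c = m c)) by
    obtain ⟨st', h1, h2⟩ := hh; exact ⟨st', h1, h2⟩
  refine Exec.block_of_fwd smallPre qs fun Rf hRf => ?_
  unfold smallPre at hRf
  have htmp := execOps_cons_fwd hRf; clear hRf; obtain ⟨v1, hv1, hRf⟩ := htmp
  simp -failIfUnchanged (disch := omega) only [Operand.write, Operand.read, Function.update_self,
    Function.update_of_ne, BinOp.eval_add_mod', BinOp.eval_mul_mod', Nat.mod_eq_of_lt, Nat.add_zero, Nat.zero_add, h4] at hv1 hRf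
  subst v1
  have htmp := execOps_cons_fwd hRf; clear hRf; obtain ⟨v2, hv2, hRf⟩ := htmp
  simp -failIfUnchanged (disch := omega) only [Operand.write, Operand.read, Function.update_self,
    Function.update_of_ne, BinOp.eval_add_mod', BinOp.eval_mul_mod', Nat.mod_eq_of_lt, Nat.add_zero, Nat.zero_add, h4] at hv2 hRf
  subst v2
  have htmp := execOps_cons_fwd hRf; clear hRf; obtain ⟨v3, hv3, hRf⟩ := htmp
  simp -failIfUnchanged (disch := omega) only [Operand.write, Operand.read, Function.update_self,
    Function.update_of_ne, BinOp.eval_add_mod', BinOp.eval_mul_mod', Nat.mod_eq_of_lt, Nat.add_zero, Nat.zero_add, h4] at hv3 hRf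
  subst v3
  have htmp := execOps_cons_fwd hRf; clear hRf; obtain ⟨v4, hv4, hRf⟩ := htmp
  simp -failIfUnchanged (disch := omega) only [Operand.write, Operand.read, Function.update_self,
    Function.update_of_ne, BinOp.eval_add_mod', BinOp.eval_mul_mod', Nat.mod_eq_of_lt, Nat.add_zero, Nat.zero_add, h4] at hv4 hRf
  subst v4
  have htmp := execOps_cons_fwd hRf; clear hRf; obtain ⟨v5, hv5, hRf⟩ := htmp
  simp -failIfUnchanged (disch := omega) only [Operand.write, Operand.read, Function.update_self,
    Function.update_of_ne, BinOp.eval_add_mod', BinOp.eval_mul_mod', Nat.mod_eq_of_lt, Nat.add_zero, Nat.zero_add, h4] at hv5 hRf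
  subst v5
  have htmp := execOps_cons_fwd hRf; clear hRf; obtain ⟨v6, hv6, hRf⟩ := htmp
  simp -failIfUnchanged (disch := omega) only [Operand.write, Operand.read, Function.update_self,
    Function.update_of_ne, BinOp.eval_add_mod', BinOp.eval_mul_mod', Nat.mod_eq_of_lt, Nat.add_zero, Nat.zero_add, h4] at hv6 hRf
  subst v6
  simp only [execOps_nil] at hRf
  subst hRf
  refine ⟨rfl, ?_, ?_, ?_, ?_, ?_, fun c g1 g2 g3 g4 g5 => ?_⟩ <;> dsimp only <;>
    (simp (disch := omega) only [Function.update_of_ne, Function.update_self, h4]; try rfl)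

/-! ## The layout of the table branch, in equations -/

/-- The layout, field by field. [folklore] -/
theorem lay_eqs (K : PrattConsts) (n₀ L : ℕ) :
    (K.lay n₀ L).pa = L * 2 + 202 ∧ (K.lay n₀ L).pb = (K.lay n₀ L).pa + K.M n₀ ∧
    (K.lay n₀ L).pt = (K.lay n₀ L).pb + K.M n₀ ∧ (K.lay n₀ L).bm = (K.lay n₀ L).pt + K.r n₀ * K.C ∧
    (K.lay n₀ L).FT 0 = (K.lay n₀ L).bm + K.C * K.tk ∧ (K.lay n₀ L).FT 1 = (K.lay n₀ L).FT 0 + 2 ^ K.M n₀ ∧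
    (K.lay n₀ L).FT 2 = (K.lay n₀ L).FT 1 + 2 ^ K.M n₀ ∧ (K.lay n₀ L).rU 0 = (K.lay n₀ L).FT 2 + 2 ^ K.M n₀ ∧
    (K.lay n₀ L).rU 1 = (K.lay n₀ L).rU 0 + K.R * K.N ∧ (K.lay n₀ L).rU 2 = (K.lay n₀ L).rU 1 + K.R * K.N ∧
    (K.lay n₀ L).X 0 = (K.lay n₀ L).rU 2 + K.R * K.N ∧ (K.lay n₀ L).X 1 = (K.lay n₀ L).X 0 + K.G n₀ ∧
    (K.lay n₀ L).X 2 = (K.lay n₀ L).X 1 + K.G n₀ ∧ K.cp0 n₀ L = (K.lay n₀ L).X 2 + K.G n₀ ∧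
    (K.lay n₀ L).LB 0 = (K.lay n₀ L).X 0 + K.off n₀ ∧ (K.lay n₀ L).LB 1 = (K.lay n₀ L).X 1 + K.off n₀ ∧
    (K.lay n₀ L).LB 2 = (K.lay n₀ L).X 2 + K.off n₀ ∧ (K.lay n₀ L).MB = 2 ^ K.M n₀ ∧
    (K.lay n₀ L).M = K.M n₀ ∧ (K.lay n₀ L).tk = K.tk ∧ (K.lay n₀ L).C = K.C ∧ (K.lay n₀ L).r = K.r n₀ ∧
    (K.lay n₀ L).N = K.N ∧ (K.lay n₀ L).R = K.R ∧ (K.lay n₀ L).q = K.q n₀ ∧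
    (K.lay n₀ L).dsz = dpSize K.R K.N (K.q n₀) ∧ (K.lay n₀ L).Ntot = K.N ^ K.q n₀ := by
  refine ⟨rfl, rfl, rfl, rfl, ?_, ?_, ?_, ?_, ?_, ?_, ?_, ?_, ?_, rfl, rfl, rfl, rfl, rfl, rfl, rfl, rfl, rfl,
    rfl, rfl, rfl, rfl, rfl⟩ <;> simp only [PrattConsts.lay] <;> ring

/-- The layout of the table branch satisfies the layout constraints of the repetition. [folklore] -/
theorem repSide_lay {K : PrattConsts} {n₀ L : ℕ} (hF : BigFits w K n₀ L) : RepSide w (K.lay n₀ L) (K.cp0 n₀ L) := by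
  obtain ⟨e1, e2, e3, e4, e5, e6, e7, e8, e9, e10, e11, e12, e13, e14, _, _, _, e18, e19, e20, e21, e22, e23, e24,
    e25, e26, _⟩ := lay_eqs K n₀ L
  obtain ⟨_, _, _, _, _, _, _, _, _, _, _, _, _, _, _, _, _, bMw, bM1, _, _, _, _⟩ := hF.bounds
  have hds := K.dpSize_le_G n₀
  rw [← e26] at hds
  refine ⟨by omega, by omega, by omega, by rw [e22, e21]; omega, by rw [e21, e20]; omega, by omega, by omega,
    by omega, by rw [e24, e23]; omega, by rw [e24, e23]; omega, by rw [e24, e23]; omega, by omega, by omega,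
    by omega, by rw [e19]; exact bM1, by rw [e19]; exact bMw.le, hF.hw,
    by rw [e22, e20, e19]; rfl, by rw [e21]; exact K.hC, by rw [e23]; exact Nat.pow_pos K.hC, by rw [e24]; exact K.hR,
    by rw [e18, e19]⟩

/-- Entries of a `0/1` list, read with default `0`, are `≤ 1`. [folklore] -/
theorem getD_le_one {l : List ℕ} (h : ∀ v ∈ l, v ≤ 1) (i : ℕ) : l.getD i 0 ≤ 1 := by
  rw [List.getD_eq_getElem?_getD]
  by_cases hi : i < l.length
  · rw [List.getElem?_eq_getElem hi, Option.getD_some]; exact h _ (List.getElem_mem hi)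
  · rw [List.getElem?_eq_none (by omega), Option.getD_none]; exact Nat.zero_le _

/-- The tables of a run: block membership, the three parsed membership tables of the input `m`
(relocated instance), the coefficient words. [cite: Pratt2024SCC, §2 (proof of Thm. 1.9)] -/
noncomputable def tabs (K : PrattConsts) (w n₀ L : ℕ) (len : ℕ → ℕ) (m : ℕ → ℕ) : RepTables where
  BM := K.BM
  Ft l a := by
    classical
    exact if ∃ j, j < len l ∧ a = setMask m ((hdr L n₀ len).A l + j * (n₀ + 1) + 1) (K.PM n₀ l) n₀ then 1 else 0
  Uc := K.Uc w

/-- The state at the end of the deterministic part, table branch. [folklore] -/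
structure BigOut (w : ℕ) (K : PrattConsts) (n₀ L : ℕ) (len : ℕ → ℕ) (m₀ : ℕ → ℕ) (st : Store) : Prop where
  queries : st.queries = []
  regs : RepRegs st.mem (K.lay n₀ L) (K.cp0 n₀ L) 0
  r25 : st.mem 25 = K.Q n₀
  r26 : st.mem 26 = 0
  r98 : st.mem 98 = K.RC n₀
  r99 : st.mem 99 = K.cp0 n₀ L
  data : RepData w st.mem (tabs K w n₀ L len m₀) (K.lay n₀ L)

/-- Step count of the deterministic part, table branch. [folklore] -/
def preBigTime (K : PrattConsts) (w n₀ L : ℕ) (len : ℕ → ℕ) : ℕ :=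
  7 * L + (14 + (4 * w + 3 + (8 + (pre1Time K n₀ + (10 + (11 + 11)) + pre3Time K n₀ len + 2))))

end SProg

end Literature.Computability.Cryptography.WordRAM
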